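import Literature.MathematicalPhysics.QuantumFieldTheory.Balaban1983to89.T4AveragingDeficitWallBoundary
import Literature.MathematicalPhysics.QuantumFieldTheory.Balaban1983to89.T4EMLTangentInjective

/-!
# T4AveragingDeficitNonAbelian — the periodic value wall (β′-per) for Bałaban's non-linear average (42) on GENERAL
# (non-abelian) unitary configurations, kernel-proved: `|𝓓_{W(torus)}(V)| ≤ C(d,L)·(‖∇_V F‖²_{ℓ²} + a³·M^d)` —
# v1 (§1–§4): the upper half `𝓓 ≤ C·a³·M^d` via the axial-gauge flux linearisation of the `L`-plaquette variable (the
# `(bch)` binder of the termwise-quartic picture); v1.1 (§5–§9, appended): the lower (covariant Poincaré) half,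
# `DeficitValueWallPer` as a THEOREM for all unitary data, and the reduction `ClaimBetaPer ⟺ β`; v1.2 (§10–§11,
# appended): the LOCAL value wall `DeficitValueWallLoc` on arbitrary block windows of `ℤ^d` (boundary slot
# `a·‖∇_V F‖_{ℓ¹}`) as a THEOREM for all unitary data, and `ClaimBetaLoc ⟺ β ⟺ ClaimBetaPer`

VERSION v1.2.1 (lineage gen 7, 2026-08-19; v1.2.1 = v1.2 with the DOCSTRING-ONLY page fix B7 (11) p. 18 → p. 19 at
four places, citation-police finding P-t4lit1g6-2 — no declaration changed): §1–§4 are v1 (accepted p193897) and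
§5–§9 are v1.1 (accepted p194467) byte-for-byte in their declarations; §10–§11 are new.  What v1's header called "NOT proved here (record Appendix β
§10: [analysis])" — the LOWER inequality for non-abelian `V` — is proved in §8 (v1.1); what the record's Appendix β
§9 (ix) left [analysis] for the local-density reading NE3 (D) — the block-window wall β′-loc with its first-order
boundary slot — is proved in §10 (v1.2), for every unitary small-field configuration on `ℤ^d` (no periodicity).

HONEST FRAMING (cell `pub-balaban`, T4-DAG PAGE 1; lineage `b2b-balaban-t4-ne3-p2`, gen 7; companion of
`T4AveragingDeficitWall` v1.1, `T4AveragingDeficitWallLocal` v1.1, `T4AveragingDeficitWallBoundary` v1.4, same seat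
NE3 = U1 (b)).  The cell's T4 target is the finite-torus continuum limit of the unit-scale averaged loop expectations —
NOT infinite volume, NO mass gap, NOT the Clay problem, NOT summit progress.  NE3 stays COND-free: no `BetaPertH`, no
(B), no (B^μ) enter this file.  The derivative wall (β) = `DeficitDerivWall` is NOT re-typed and NOT attacked here.

WHAT IS PROVED.  `T4AveragingDeficitWallBoundary` §4 typed the PERIODIC value wall
`DeficitValueWallPer L C a₀ : ∀ M ≥ 1, ∀ V unitary, (LM)-periodic, SmallField V a (a ≤ a₀),
|𝓓_{W([0,M)^d)}(V)| ≤ C (‖∇_V F‖²_{ℓ²(B([0,M)^d))} + a³ M^d)` and proved it (both signs) for the ABELIAN image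
configurations (§5–§8 there, `deficit_imCfg_wallPer`).  Here the UPPER inequality is proved for EVERY unitary
configuration, with no gradient term at all:
  `deficit L V (blockWindow L (periodBox M)) ≤ upperConst d L · a³ · M^d`        (`deficit_torus_le`, §4)
under `IsUnitaryCfg V`, `IsPeriodicCfg V (L·M)`, `SmallField V a`, `0 ≤ a`, `512(d+1)(d+4)L²·a ≤ 1`, `1 ≤ L`,
`1 ≤ M`, `N ≥ 1` (and, trivially, the one-sided `DeficitValueWallPer` shape `deficit_torus_le_wallShape`); i.e. Bałaban's averaging NEVER RAISES the Wilson action of a whole torus by more than `O(a³)` per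
block (the coarse action with the `L^{d−4}` weight is at most the fine action plus `C a³ M^d`).  v1.1 (§8) proves the
LOWER inequality for EVERY unitary configuration under the same hypotheses,
  `−deficit L V (blockWindow L (periodBox M)) ≤ 2·lowerConst d L · gradFluxSq V (blockSites L (periodBox M))
       + lowerConstNA d L · a³ · M^d`                                              (`deficit_torus_ge`, §8)
(`lowerConst` = the abelian constant of the Boundary file, `gradFluxSq` = `Σ_{x,κ,π} ‖Ad_{V(x,κ)}F(x+e_κ;π) − F(x;π)‖²`
the COVARIANT flux-gradient energy of `T4AveragingDeficitWall`), hence the two-sided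
  `|deficit …| ≤ wallConstNA d L · (gradFluxSq V (blockSites L (periodBox M)) + a³ · M^d)`   (`abs_deficit_torus_le`)
and THE TYPED PERIODIC VALUE WALL ITSELF:
  `deficitValueWallPer_holds : 1 ≤ L → DeficitValueWallPer d n L (wallConstNA d L) (1/(512(d+1)(d+4)L²))`.
Consequently (§9) the typed conjunction `ClaimBetaPer d n L = ∃ C a₀ R, … ∧ DeficitDerivWall … ∧ DeficitValueWallPer …`
is EQUIVALENT to the bare derivative wall: `claimBetaPer_iff_derivWall : ClaimBetaPer d n L ↔ ∃ C ≥ 0, 0 < a₀ ≤ 1, R,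
DeficitDerivWall d n L C a₀ R` (both walls are monotone in `C`, antitone in `a₀`).  v1.2 (§10) proves the LOCAL
value wall of `T4AveragingDeficitWallBoundary` §4 — block windows `W(Y)` of `ℤ^d`, `Y` ANY finite set of coarse sites,
NO periodicity — for EVERY unitary configuration with (44) and `512(d+1)(d+4)L²a ≤ 1`:
  `deficit L V (blockWindow L Y) ≤ 4La·gradFluxL1 V N + L·gradFluxSq V N + upperConst d L·a³·#Y`   (`deficit_blockWindow_le`)
  `−deficit L V (blockWindow L Y) ≤ 4La·gradFluxL1 V N + (L + 2·lowerConst d L)·gradFluxSq V N + lowerConstNA d L·a³·#Y`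
                                                                                               (`deficit_blockWindow_ge`)
with `N = nbhd (2L) (blockSites L Y)` and `gradFluxL1 = Σ‖∇_V F‖` (the first-order boundary slot of the typed wall),
hence `abs_deficit_blockWindow_le` and THE TYPED LOCAL VALUE WALL ITSELF:
  `deficitValueWallLoc_holds : 1 ≤ L → DeficitValueWallLoc d n L (wallConstLoc d L) (1/(512(d+1)(d+4)L²)) (2L)`,
`wallConstLoc = wallConstNA + 5L`; and (§11, both walls being monotone in the radius `R` too)
`claimBetaLoc_iff_derivWall : ClaimBetaLoc d n L ↔ ∃ C ≥ 0, 0 < a₀ ≤ 1, R, DeficitDerivWall d n L C a₀ R` and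
`claimBetaLoc_iff_claimBetaPer`.  β = `DeficitDerivWall` is NOT proved, NOT re-typed and NOT weakened here; it remains
the [analysis] item of the record — after v1.2 it is the ONLY unproved conjunct of every typed form of CLAIM β.

MECHANISM (three kernel steps, all [folklore] matrix analysis on top of the tree's `B7Prop1Explicit`).
(1) AXIAL-GAUGE FLUX LINEARISATION (§2, any complete normed `ℂ`-algebra; this is the `(bch)` remainder which
`T4TermwiseQuartic.averagingError_le` takes as a HYPOTHESIS binder, derived here for the concrete average (42)):
in the axial gauge of B7 p. 24 at the far corner `y = z + Le_μ + Le_ν` (tree (1.7) of B5), with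
`θ = 8(d+1)(d+4)L²α₀`, `sup|V₀(∂p) − 1| ≤ α₀`, `512(d+1)(d+4)L²α₀ ≤ 1`,
  `‖log V̄₀(∂P) − Θ‖ ≤ 300 θ²`,  `Θ := Σ_{x∈B(z)} L^{−d} Σ_{i,j<L} log V₀(∂p_{x+ie_μ+je_ν})`,  `‖Θ‖ ≤ 2L²α₀`,
(`fluxLinearisation`): the second-order Taylor control of `prop1_core` (side estimates, corner cancellation, the
discrete Stokes theorem) pushed one step further — Stokes turns the rectangle sums into plaquette sums, and each
plaquette sum `A(∂p)` is `log V₀(∂p)` up to `expRem(4a) + expRem(2α₀)`; also `‖V̄₀(∂P) − 1‖ ≤ 4θ`.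
(2) WEIGHT EXPANSION BY UNITARY FRAMES (§1, §3): for skew-Hermitian `X` (`T4EMLTangentInjective.frame`:
`X = U diag(−iθ_a) U⋆`), `1 − Re tr e^X/N = (1/N)Σ_a(1 − cos θ_a)`, whence
`0 ≤ hs(X,X)/(2N) − (1 − Re tr e^X/N) ≤ (5/96)‖X‖²·hs(X,X)/N` (`T4AveragingDeficitWallBoundary.cosRem_le`), and the
perturbation `hs(Θ+R,Θ+R) ≤ hs(Θ,Θ) + 2N‖Θ‖‖R‖ + N‖R‖²`; JENSEN for the Hilbert–Schmidt square with total weight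
`L²` (`T4EMLTangentInjective.hs_convex_sq`): `hs(Θ,Θ) ≤ L^{2−d} Σ hs(F₀,F₀)`, and `hs` is `Ad`-invariant, so the
axial rotation `F₀ = u F u⁻¹` (`B7Prop1Explicit.hol_gaugeAct_closed`, `mlog_units_conj`) drops out; per coarse
plaquette (§3 `wt_cplaq_axial_le`, §4 `wt_chol_le` after the gauge step (45)):
`1 − Re tr V̄(∂P) ≤ (L²L^{−d}/2N)·Σ_{stencil} hs(F,F) + 711θ³`, and per fine plaquette (`wt_fhol_ge`)
`1 − Re tr V(∂p′) ≥ hs(F,F)/2N − (5/6)a⁴`.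
(3) TORUS COVERING (§4 `sum_stencil_periodBox`): `Σ_{y∈[0,M)^d} Σ_{x∈B(Ly)} Σ_{i,j<L} g(x+ie_μ+je_ν) = L² Σ_{x∈B([0,M)^d)} g(x)` for
`(LM)`-periodic `g` (`sum_blocks_eq`, `blockSites_periodBox`, `sum_periodBox_shift` of the Boundary file; the
fluxes are periodic by `hol_add_period`), so the quadratic
parts CANCEL EXACTLY (`L^{d−4}·L^{2−d}·L² = 1`) and only `L^{d−4}·(2N‖Θ‖‖R‖ + N‖R‖²)/(2N) ≤ 711 L^{d−4}θ³` per coarse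
plaquette and the fine quartic remainders `(5/6)a⁴` per fine plaquette survive:
`upperConst d L = #Plane(d)·(364032·(d+1)³(d+4)³·L^{d+2} + L^d)`.
(4) THE LOWER HALF (v1.1, §5–§8; [folklore] matrix analysis + the SCALAR stencil Poincaré inequality
`T4AveragingDeficitWallBoundary.stencil_poincare` of the abelian proof).  Fine side from above: `1 − Re tr V(∂p′) ≤
hs(F,F)/2N` (`wt_fhol_le`, `1 − cos t ≤ t²/2`).  Coarse side from below, in the axial gauge: `1 − Re tr V̄₀(∂P) ≥
hs(Θ,Θ)/2N − 9θ³` (`wt_cplaq_axial_ge`: cross term `≤ 7.5θ³`, quartic correction `(5/96)(5θ)²·25θ² ≤ 0.51θ³` by the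
fourth conjunct `‖log V̄₀(∂P)‖ ≤ 5θ ≤ 1` of `fluxLinearisation`).  JENSEN'S SLACK MADE EXACT (`hs_pair_variance`,
`hs_fluxAvg_variance`): `L^{2d}·hs(Θ,Θ) = L^{d+2}·Σ_k hs(Φ_k,Φ_k) − ½·Σ_{k,k'} hs(Φ_k − Φ_{k'}, Φ_k − Φ_{k'})` over the
`L^{d+2}` stencil plaquettes `k`, `Φ_k = log V₀(∂p_k) = Ad_{u(x_k)}F(x_k;π)` ((11): `hs(Φ_k,Φ_k) = hs(F,F)`).  THE MATRIX
STENCIL POINCARÉ INEQUALITY (`stencil_poincare_hs`): `Σ_{k,k'} hs(Φ_k − Φ_{k'},·) ≤ C_P·Σ_kΣ_κ hs(Φ(x_k+e_κ) − Φ(x_k),·)`,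
coordinatewise (`hs(X,X) = Σ_{ij}(Re² + Im²)`, `hs_sub_self_eq_coord`) from the scalar one.  THE COVARIANT STEP
(`hs_fdiff_gauge_le`): for unitary `u`, `V`, with `u(x+e_κ) = V₀(x,κ)⁻¹u(x)V(x,κ)` (definition of the gauge action),
`hs(Ad_{u(x+e_κ)}F(x+e_κ) − Ad_{u(x)}F(x),·) ≤ 2·hs(Ad_{V(x,κ)}F(x+e_κ) − F(x),·) + 8‖V₀(x,κ) − 1‖²·hs(F(x+e_κ),·)` —
the first term is `2·hs(∇_V F(x,κ;π),·)` (`covGrad`), and the TRANSPORT DEFECT is small because the axial-gauge bond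
variables satisfy `‖V₀(b) − 1‖ ≤ |b₋ − y_c|₁·a ≤ (d+2)L·a` on the stencil (`axial_bond_bound` — unconditional — and
`l1_stencil_sub_centre_le`) while `hs(F,F) ≤ N‖F‖² ≤ 4Na²`: defect `≤ 32(d+2)²L²N·a⁴` per (stencil site, direction)
(`stencil_grad_bound`).  Per coarse plaquette (`coarse_ge_y`) and summed over the torus with the covering identity
(`sum_stencil_eq`, `sum_stencil_periodBox`; the covariant gradient energy is periodic too) the quadratic parts cancel
exactly as in (3), `C_P·L²/(4N·L^{d+4}) · 2 = 2·lowerConst/(N)` meets `hs ≤ N‖·‖²`, the defect contributes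
`8C_P d(d+2)²a⁴ ≤ C_P d(d+2)²a³/64` per coarse site (`a ≤ 1/512`) and the cubic term `9·L^{d−4}θ³ = 4608(d+1)³(d+4)³
L^{d+2}a³`: `lowerConstNA d L = #Plane(d)·(4608(d+1)³(d+4)³L^{d+2} + C_P·d(d+2)²/64)`,
`wallConstNA = upperConst + 2·lowerConst + lowerConstNA`.
(5) BLOCK WINDOWS (v1.2, §10).  Without periodicity the covering (3) leaves a MISMATCH: by block tiling
(`sum_blocks_eq`) `L⁻²·Σ_{y∈Y}Σ_{stencil} hs F − Σ_{x∈B(Y)} hs F = L⁻²·Σ_{x∈B(Y)}Σ_{i,j<L}[hs F(x+ie_μ+je_ν) − hs F(x)]`,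
a sum of staircases of `< 2L` unit steps; each step is COVARIANT (`abs_hs_flux_step_le`): `hs` is `Ad`-invariant, so
`hs F(z+e_κ) − hs F(z) = 2hs(∇_V F(z,κ), F(z)) + hs(∇_V F, ∇_V F)`, `|…| ≤ N(4a|∇_V F| + |∇_V F|²)` (`|F| ≤ 2a`); the
staircases stay within sup-distance `< 2L` of `B(Y)` with multiplicity `≤ L³` (`sum_shift2_abs_le`,
`sum_shift_le_nbhd`), whence `|mismatch| ≤ 2LN·Σ_{N_{2L}(B(Y))}Σ_κ(4a|∇_V F| + |∇_V F|²)` per plane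
(`stencil_mismatch_abs_le`) — the `a·‖∇_V F‖_{ℓ¹}` slot.  The stencil sums of the covariant gradient energy in the
lower half are dominated by `L²×` the sum over `N_{2L}(B(Y))` (shifted block copies); everything else is (2)–(4) per
coarse plaquette (`wt_chol_le`, `wt_fhol_ge`, `wt_fhol_le`, `coarse_ge_y` hold for arbitrary `V` and `y`).
ORDER COUNT (record Appendix β §10): the non-abelian corrections enter ONLY through the cross term `hs(Θ,R)/N`,
`|…| ≤ ‖Θ‖‖R‖ = O(L²α₀·L⁴α₀²)` — the `a³` slot of (β′-per); in the abelian case `R` vanishes identically (Boundary §5).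
Two-engine numerics (unit scratch `wall_probe3.py`/`.out`) measured the torus sums of the exact decomposition
`𝓓 = −J + cross + rr − quart_c + quart_f` on smooth non-commuting and on random periodic `SU(2)` data.

CITATION HEADER (lean-in-tree rule 2026-08-18; cited-only lint 2026-08-19 for §10–§11).  No sentence of any paper
is used as a hypothesis; the manuscripts under audit are not cited for any disputed step; every declaration is
[folklore] (matrix inequalities, bookkeeping; in §10–§11 the [folklore] helpers are `private`) or a kernel-checked
estimate about the tree's OWN transcriptions of the printed formulas, whose `[cite: …]` tag names those FORMULAS as
context (in §10–§11: the block average (42) p. 23, the `L`-plaquette variable (44) p. 24, the gauge covariance (45)/(11),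
the Wilson weight B11 (5) p. 278) — the STATEMENTS β′-loc = `DeficitValueWallLoc` and `ClaimBetaLoc` are the cell's own
typed walls (`T4AveragingDeficitWallBoundary` §4, in the tree, asserted nowhere), here PROVED resp. REDUCED to β, never
quoted; in detail the transcriptions are — B7 (9) p. 18 / p. 24 (parallel
transport, axial gauge, tree contours (1.7) of B5), (42) p. 23 (the average `V̄`), (44) p. 24 (the `L`-plaquette
variable), (45) p. 24 / (11) p. 19 (gauge covariance; v1.2.1: «p. 19» per the citation register F-T4-76, GAPS
A-t4lit1-8 — v1–v1.2 printed «p. 18»), (38) p. 23 (the linearisation `V̄(∂P) ≈ exp Σ L^{−d}(…)` whose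
REMAINDER is what §2 bounds), B11 (5) p. 278 (the Wilson weight, via `T4AveragingDeficitWall.wt`) — marked
`[cite: Balaban1985Averaging, …]` as context, not as hypotheses.  Source: T. Bałaban, *Averaging operations for
lattice gauge theories*, Commun. Math. Phys. **98** (1985) 17–51 [Balaban1985Averaging] («B7»); T. Bałaban, *Propagators
and renormalization transformations for lattice gauge theories. I*, Commun. Math. Phys. **95** (1984) 17–40
[Balaban1984PropagatorsI] («B5», (1.7) the tree contours); T. Bałaban, *The variational problem and background fields in
renormalization group method for lattice gauge theories*, Commun. Math. Phys. **102** (1985) 277–309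
[Balaban1985Variational] («B11», (5) the Wilson action).  Companions used BY NAME: `B7Prop1Explicit` (`hol`, `asum`,
`l1`, `boxVec`, `axialFn`, `gaugeAct`, `bavg`, `cplaq`, `Wcx`, `walk_linear`, `norm_mlog_sub_le`, `side_estimate`,
`norm_prod4_sub_one_sub_le`, `corner_cancellation`, `stokes`, `norm_avg_le`, `bond_log`, `Tside`, `expRem_le_sq`,
`cplaq_conj`, `bavg_gaugeAct`, `hol_gaugeAct_closed`, `mlog_units_conj`, `axial_bond_bound`, `axialFn_mem`,
`norm_units_conj_sub_one_le`, `l1_add_le`, `l1_neg`, `l1_zsmul_e`, `l1_boxVec_le`, `disp_plaqWord`, `U1`, …),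
`B7Prop2Explicit` (`unitaryUnits`, `mem_unitaryUnits`, `hol_mem_of`, `bavg_mem_unitaryUnits`, `norm_Wcx_sub_one_le`),
`MatrixLog` (`mlog`, `exp_mlog`, `norm_mlog_le_two_mul`), `MatrixNorms` (`abs_nReTr_le_opNorm`, `nhsNormSq_le_opNorm_sq`,
`card_mul_nhsNormSq`, `nhsNormSq_mul_le`, `nhsNorm_mul_le_nhsNorm_mul_opNorm`, `opNorm_mul_le`), `UnitaryModel` (`nReTr`,
`nReTr_conj`), `T4EMLTangentInjective` (`hs`, `hs_eq_sum`, `hs_self`, `hs_self_nonneg`, `hs_comm`, `hs_add_left/right`,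
`hs_sub_left/right`, `hs_smul_left/right`, `hs_sum_left/right`, `two_hs_le`, `hs_conj`, `hs_convex_sq`, `frame`,
`hs_frame`, `star_mlog_of_unitary`), `T4AveragingDeficitWall` (`wt`, `fhol`, `chol`, `deficit`, `flux`, `Ad`, `covGrad`,
`gradFluxSq`, `IsUnitaryCfg`, `SmallField`, `blockSites`, `blockWindow`, `Plane`, `Plaq`, and BY SHAPE ONLY
`DeficitDerivWall`, `dirL1`, `curlL1`, `curlSq`, `nbhd`, `bondSites`), `T4AveragingDeficitWallBoundary` (`IsPeriodicCfg`,
`periodBox`, `DeficitValueWallPer` and `ClaimBetaPer` (typed there, PROVED resp. REDUCED here), `cosRem`, `cosRem_nonneg`,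
`cosRem_le`, `one_sub_cos_eq`, `sum_blocks_eq`, `sum_periodBox_shift`, `blockSites_periodBox`, `card_periodBox`,
`zpow_sub_four_eq`, `stencilIdx`, `stencilOff`, `card_stencilIdx`, `sum_stencilIdx_eq`, `fdiff`, `gradSq`, `poincareConst`,
`stencil_poincare`, `lowerConst`); Mathlib (`Matrix.exp_diagonal`, `Matrix.exp_units_conj`, `Matrix.l2_opNorm_mul`,
`Matrix.l2_opNorm_conjTranspose`, `CStarRing.norm_of_mem_unitary`, `Unitary.star_mul_self_of_mem`, `Complex.sq_norm`).
-/

open scoped BigOperators Matrix ComplexConjugate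
open Complex (I)

namespace Literature.MathematicalPhysics.QuantumFieldTheory.Balaban1983to89

namespace T4AveragingDeficitNonAbelian

open scoped Matrix.Norms.L2Operator
open UnitaryModel MatrixNorms MatrixLog T4EMLTangentInjective

noncomputable section

/-! ## §1 Matrix facts: the Hilbert–Schmidt square against the operator norm, and the weight of `e^X` for skew `X` -/

section MatrixFacts

variable {n : Type*} [Fintype n] [DecidableEq n]

/-- `hs(X,X) ≤ N‖X‖²` (operator norm). [folklore] -/
theorem hs_self_le_card_mul_norm_sq (X : Matrix n n ℂ) :
    hs X X ≤ (Fintype.card n : ℝ) * ‖X‖ ^ 2 := by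
  rcases isEmpty_or_nonempty n with hn | hn
  · rw [hs_self]; simp
  rw [hs_self, ← card_mul_nhsNormSq]
  exact mul_le_mul_of_nonneg_left (nhsNormSq_le_opNorm_sq X) (Nat.cast_nonneg _)

omit [DecidableEq n] in
/-- `hs(X,Y) = N · Re tr(XᴴY)/N`. [folklore] -/
theorem hs_eq_card_mul_nReTr [Nonempty n] (X Y : Matrix n n ℂ) :
    hs X Y = (Fintype.card n : ℝ) * nReTr (Xᴴ * Y) := by
  have h : (Fintype.card n : ℝ) ≠ 0 := Nat.cast_ne_zero.mpr Fintype.card_ne_zero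
  rw [nReTr, mul_div_cancel₀ _ h]
  rfl

/-- `|hs(X,Y)| ≤ N‖X‖‖Y‖` (operator norms). [folklore] -/
theorem abs_hs_le (X Y : Matrix n n ℂ) :
    |hs X Y| ≤ (Fintype.card n : ℝ) * (‖X‖ * ‖Y‖) := by
  rcases isEmpty_or_nonempty n with hn | hn
  · rw [hs_eq_sum]; simp
  rw [hs_eq_card_mul_nReTr, abs_mul, abs_of_nonneg (Nat.cast_nonneg _)]
  refine mul_le_mul_of_nonneg_left ?_ (Nat.cast_nonneg _)
  calc |nReTr (Xᴴ * Y)| ≤ ‖Xᴴ * Y‖ := abs_nReTr_le_opNorm _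
    _ ≤ ‖Xᴴ‖ * ‖Y‖ := Matrix.l2_opNorm_mul _ _
    _ = ‖X‖ * ‖Y‖ := by rw [Matrix.l2_opNorm_conjTranspose]

/-- Perturbation of the Hilbert–Schmidt square: `hs(Θ+R, Θ+R) ≤ hs(Θ,Θ) + 2N‖Θ‖‖R‖ + N‖R‖²`. [folklore] -/
theorem hs_add_self_le (Θ R : Matrix n n ℂ) :
    hs (Θ + R) (Θ + R) ≤ hs Θ Θ + 2 * (Fintype.card n : ℝ) * (‖Θ‖ * ‖R‖)
      + (Fintype.card n : ℝ) * ‖R‖ ^ 2 := by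
  have h1 : hs (Θ + R) (Θ + R) = hs Θ Θ + 2 * hs Θ R + hs R R := by
    rw [hs_add_left, hs_add_right, hs_add_right, hs_comm R Θ]; ring
  have h2 := (abs_le.mp (abs_hs_le Θ R)).2
  have h3 := hs_self_le_card_mul_norm_sq R
  rw [h1]; linarith

omit [DecidableEq n] in
/-- JENSEN for the Hilbert–Schmidt square with arbitrary total weight: for `c_i ≥ 0` on a finset `s`,
`hs(Σ_s c_i a_i, Σ_s c_i a_i) ≤ (Σ_s c_i) · Σ_s c_i hs(a_i, a_i)`. [folklore] -/
theorem hs_sum_smul_sq_le {ι : Type*} (s : Finset ι) (c : ι → ℝ) (hc0 : ∀ i ∈ s, 0 ≤ c i)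
    (a : ι → Matrix n n ℂ) :
    hs (∑ i ∈ s, (c i : ℂ) • a i) (∑ i ∈ s, (c i : ℂ) • a i)
      ≤ (∑ i ∈ s, c i) * ∑ i ∈ s, c i * hs (a i) (a i) := by
  set S : ℝ := ∑ i ∈ s, c i with hSdef
  have hS0 : 0 ≤ S := Finset.sum_nonneg hc0
  rcases hS0.eq_or_lt with hS | hS
  · -- all weights vanish
    have hc : ∀ i ∈ s, c i = 0 := fun i hi =>
      (Finset.sum_eq_zero_iff_of_nonneg hc0).1 hS.symm i hi
    have h0 : ∑ i ∈ s, (c i : ℂ) • a i = 0 :=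
      Finset.sum_eq_zero fun i hi => by rw [hc i hi]; simp
    rw [h0, ← hS, zero_mul, hs_self]; simp
  · -- normalise the weights to total mass one and use `hs_convex_sq` on the subtype
    have hSne : S ≠ 0 := hS.ne'
    let c' : s → ℝ := fun i => c i / S
    have hc'0 : ∀ i, 0 ≤ c' i := fun i => div_nonneg (hc0 i i.2) hS0
    have hc'1 : ∑ i, c' i ≤ 1 := by
      have : ∑ i : s, c' i = (∑ i ∈ s, c i) / S := by
        rw [Finset.sum_div, ← Finset.sum_coe_sort s]
      rw [this, ← hSdef, div_self hSne]
    have hJ := hs_convex_sq c' hc'0 hc'1 (fun i : s => a i)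
    have hsum : ∑ i : s, (c' i : ℂ) • a i = ((S⁻¹ : ℝ) : ℂ) • ∑ i ∈ s, (c i : ℂ) • a i := by
      rw [Finset.smul_sum, ← Finset.sum_coe_sort s]
      refine Finset.sum_congr rfl fun i _ => ?_
      rw [smul_smul, ← Complex.ofReal_mul]
      congr 2
      show c i / S = S⁻¹ * c i
      rw [div_eq_inv_mul]
    have hrhs : ∑ i : s, c' i * hs (a i) (a i) = S⁻¹ * ∑ i ∈ s, c i * hs (a i) (a i) := by
      rw [Finset.mul_sum, ← Finset.sum_coe_sort s]
      refine Finset.sum_congr rfl fun i _ => ?_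
      show c i / S * _ = _
      rw [div_eq_inv_mul, mul_assoc]
    rw [hsum, hrhs, hs_smul_left, hs_smul_right] at hJ
    have hJ' : S⁻¹ * (S⁻¹ * hs (∑ i ∈ s, (c i : ℂ) • a i) (∑ i ∈ s, (c i : ℂ) • a i))
        ≤ S⁻¹ * ∑ i ∈ s, c i * hs (a i) (a i) := hJ
    have hpos : 0 < S⁻¹ := inv_pos.mpr hS
    have hJ'' := le_of_mul_le_mul_left hJ' hpos
    calc hs (∑ i ∈ s, (c i : ℂ) • a i) (∑ i ∈ s, (c i : ℂ) • a i)
          = S * (S⁻¹ * hs (∑ i ∈ s, (c i : ℂ) • a i) (∑ i ∈ s, (c i : ℂ) • a i)) := by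
            rw [← mul_assoc, mul_inv_cancel₀ hSne, one_mul]
      _ ≤ S * ∑ i ∈ s, c i * hs (a i) (a i) := mul_le_mul_of_nonneg_left hJ'' hS0

/-- The weight `1 − Re tr e^X / N` of the exponential of a SKEW-HERMITIAN matrix in a unitary frame:
`X = U diag(−iθ) U⋆` gives `1 − Re tr e^X/N = (1/N) Σ_a (1 − cos θ_a)` and `hs(X,X) = Σ_a θ_a²`. [folklore] -/
theorem weight_exp_frame [Nonempty n] {X : Matrix n n ℂ} (hX : Xᴴ = -X) :
    ∃ θ : n → ℝ, (∀ a, |θ a| ≤ ‖X‖) ∧ hs X X = ∑ a, θ a ^ 2 ∧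
      1 - nReTr (NormedSpace.exp X) = (∑ a, (1 - Real.cos (θ a))) / Fintype.card n := by
  obtain ⟨U, θ, hU1, hU2, hXe, hθ⟩ := frame hX
  refine ⟨θ, hθ, ?_, ?_⟩
  · rw [hXe, hs_frame hU1]
    have hdiag : ∀ a b : n, (star ((Matrix.diagonal fun a => -I * (θ a : ℂ)) a b) *
        (Matrix.diagonal fun a => -I * (θ a : ℂ)) a b).re = if a = b then θ a ^ 2 else 0 := by
      intro a b
      by_cases hab : a = b
      · subst hab
        rw [if_pos rfl, Matrix.diagonal_apply_eq]
        have : star (-I * (θ a : ℂ)) * (-I * (θ a : ℂ)) = ((θ a ^ 2 : ℝ) : ℂ) := by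
          rw [Complex.star_def, map_mul, map_neg, Complex.conj_I, Complex.conj_ofReal]
          push_cast
          ring_nf
          rw [Complex.I_sq]; ring
        rw [this, Complex.ofReal_re]
      · rw [if_neg hab, Matrix.diagonal_apply_ne _ hab]; simp
    simp_rw [hdiag]
    simp [Finset.sum_ite_eq]
  · -- `e^X = U e^{diag} U⋆`, trace cyclicity, `Re e^{−iθ} = cos θ`
    set u : (Matrix n n ℂ)ˣ := ⟨U, star U, hU2, hU1⟩ with hudef
    have hXu : X = (u : Matrix n n ℂ) * Matrix.diagonal (fun a => -I * (θ a : ℂ)) *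
        ((u⁻¹ : (Matrix n n ℂ)ˣ) : Matrix n n ℂ) := hXe
    have hfun : NormedSpace.exp (fun a => -I * (θ a : ℂ)) = fun a => Complex.exp (-I * (θ a : ℂ)) := by
      rw [Pi.exp_def]
      funext a
      exact (congr_fun Complex.exp_eq_exp_ℂ _).symm
    have hexp : NormedSpace.exp X = (u : Matrix n n ℂ) *
        Matrix.diagonal (fun a => Complex.exp (-I * (θ a : ℂ))) * ((u⁻¹ : (Matrix n n ℂ)ˣ) : Matrix n n ℂ) := by
      rw [hXu, Matrix.exp_units_conj, Matrix.exp_diagonal, hfun]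
    have htr : (NormedSpace.exp X).trace = ∑ a, Complex.exp (-I * (θ a : ℂ)) := by
      rw [hexp, Matrix.trace_mul_cycle, Units.inv_mul, Matrix.one_mul, Matrix.trace_diagonal]
    have hc : (Fintype.card n : ℝ) ≠ 0 := Nat.cast_ne_zero.mpr Fintype.card_ne_zero
    rw [nReTr, htr, Complex.re_sum]
    have hcos : ∀ a, (Complex.exp (-I * (θ a : ℂ))).re = Real.cos (θ a) := fun a => by
      rw [show -I * (θ a : ℂ) = ((-θ a : ℝ) : ℂ) * I by push_cast; ring, Complex.exp_ofReal_mul_I_re,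
        Real.cos_neg]
    simp_rw [hcos]
    rw [eq_div_iff hc, sub_mul, one_mul, div_mul_cancel₀ _ hc, Finset.sum_sub_distrib]
    simp

open T4AveragingDeficitWallBoundary (cosRem cosRem_nonneg cosRem_le one_sub_cos_eq)

/-- UPPER weight bound: `1 − Re tr e^X/N ≤ hs(X,X)/(2N)` for skew-Hermitian `X` (`1 − cos θ ≤ θ²/2`). [folklore] -/
theorem one_sub_nReTr_exp_le [Nonempty n] {X : Matrix n n ℂ} (hX : Xᴴ = -X) :
    1 - nReTr (NormedSpace.exp X) ≤ hs X X / (2 * Fintype.card n) := by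
  obtain ⟨θ, -, hhs, hw⟩ := weight_exp_frame hX
  have hc : (0 : ℝ) < Fintype.card n := Nat.cast_pos.mpr Fintype.card_pos
  rw [hw, hhs, div_le_div_iff₀ hc (by positivity)]
  have h : ∀ a, 1 - Real.cos (θ a) ≤ θ a ^ 2 / 2 := fun a => by
    rw [one_sub_cos_eq]; linarith [cosRem_nonneg (θ a)]
  calc (∑ a, (1 - Real.cos (θ a))) * (2 * Fintype.card n)
        ≤ (∑ a, θ a ^ 2 / 2) * (2 * Fintype.card n) :=
          mul_le_mul_of_nonneg_right (Finset.sum_le_sum fun a _ => h a) (by positivity)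
    _ = (∑ a, θ a ^ 2) * Fintype.card n := by rw [← Finset.sum_div]; ring

/-- LOWER weight bound: `hs(X,X)/(2N) − (5/96)‖X‖²·hs(X,X)/N ≤ 1 − Re tr e^X/N` for skew-Hermitian `X` with
`‖X‖ ≤ 1` (`1 − cos θ ≥ θ²/2 − (5/96)θ⁴` on `|θ| ≤ 1`, `T4AveragingDeficitWallBoundary.cosRem_le`). [folklore] -/
theorem hs_sub_quartic_le_one_sub_nReTr_exp [Nonempty n] {X : Matrix n n ℂ} (hX : Xᴴ = -X) (hX1 : ‖X‖ ≤ 1) :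
    hs X X / (2 * Fintype.card n) - 5 / 96 * ‖X‖ ^ 2 * (hs X X / Fintype.card n)
      ≤ 1 - nReTr (NormedSpace.exp X) := by
  obtain ⟨θ, hθ, hhs, hw⟩ := weight_exp_frame hX
  have hc : (0 : ℝ) < Fintype.card n := Nat.cast_pos.mpr Fintype.card_pos
  have hθ1 : ∀ a, |θ a| ≤ 1 := fun a => (hθ a).trans hX1
  have h : ∀ a, θ a ^ 2 / 2 - 5 / 96 * ‖X‖ ^ 2 * θ a ^ 2 ≤ 1 - Real.cos (θ a) := fun a => by
    rw [one_sub_cos_eq]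
    have h4 : θ a ^ 4 ≤ ‖X‖ ^ 2 * θ a ^ 2 := by
      have h2 : θ a ^ 2 ≤ ‖X‖ ^ 2 := by
        rw [← sq_abs (θ a)]; exact pow_le_pow_left₀ (abs_nonneg _) (hθ a) 2
      nlinarith [sq_nonneg (θ a)]
    linarith [cosRem_le (hθ1 a)]
  have hsum := Finset.sum_le_sum fun a (_ : a ∈ Finset.univ) => h a
  rw [hw, hhs, le_div_iff₀ hc]
  calc ((∑ a, θ a ^ 2) / (2 * Fintype.card n) - 5 / 96 * ‖X‖ ^ 2 * ((∑ a, θ a ^ 2) / Fintype.card n))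
        * Fintype.card n = ∑ a, (θ a ^ 2 / 2 - 5 / 96 * ‖X‖ ^ 2 * θ a ^ 2) := by
        rw [Finset.sum_sub_distrib, ← Finset.sum_div, ← Finset.mul_sum]
        field_simp
    _ ≤ ∑ a, (1 - Real.cos (θ a)) := hsum

end MatrixFacts

/-! ## §2 The axial-gauge flux linearisation of the `L`-plaquette variable (the `(bch)` binder for the average (42))

Setting of `B7Prop1Explicit.prop1_core` (any complete normed `ℂ`-algebra `𝔸` with `‖1‖ = 1`): a configuration `V₀`
in the axial gauge at `y = z + Le_μ + Le_ν`, i.e. `|V₀(b) − 1| ≤ |b₋ − y|₁·α₀` near `y`, with (44)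
`|V₀(∂p) − 1| ≤ α₀` for the `(μν)`-plaquettes, and `512(d+1)(d+4)L²α₀ ≤ 1`. -/

section Linearisation

open NormedSpace Finset B7Prop1Explicit

variable {d : ℕ}

local notation "Site" => B7Prop1Explicit.Site

variable {𝔸 : Type*} [NormedRing 𝔸] [NormOneClass 𝔸] [NormedAlgebra ℂ 𝔸] [CompleteSpace 𝔸]

/-- The PLAIN block average of the fine fluxes over the stencil of the coarse plaquette `(z; μν)`:
`Θ := Σ_{x ∈ B(z)} L^{−d} Σ_{i,j<L} log V(∂p_{x + ie_μ + je_ν})` — the linear term of (38) p. 23 written, in the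
axial gauge, through the plaquette variables (Stokes (48)). [cite: Balaban1985Averaging, (38) p.23, (48) p.25] -/
def fluxAvg (L : ℕ) (V : Site d → Fin d → 𝔸ˣ) (z : Site d) (μ ν : Fin d) : 𝔸 :=
  ∑ r : Fin d → Fin L, ((L : ℝ) ^ d)⁻¹ • ∑ i ∈ Finset.range L, ∑ j ∈ Finset.range L,
    MatrixLog.mlog ((hol V (z + boxVec L r + (i : ℤ) • e μ + (j : ℤ) • e ν) (plaqWord μ ν) : 𝔸ˣ) : 𝔸)

set_option maxHeartbeats 800000 in
omit [NormOneClass 𝔸] in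
/-- **The flux linearisation of `V̄₀(∂P)` in the axial gauge** (the remainder of (38)/(50) one order further than
`prop1_core`): with `θ = 8(d+1)(d+4)L²α₀ ≤ 1/64`,
`‖log V̄₀(∂P) − Θ‖ ≤ 300 θ²`, `‖Θ‖ ≤ 2L²α₀`, `‖V̄₀(∂P) − 1‖ ≤ 4θ`, `‖log V̄₀(∂P)‖ ≤ 5θ`,
where `Θ = fluxAvg L V₀ z μ ν`.  Proof = the printed second-order control (47)–(50) (side estimates, corner
cancellation (48), Stokes (48)), then per plaquette `‖A(∂p) − log V₀(∂p)‖ ≤ ρ(4a) + ρ(2α₀)` (`walk_linear`,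
`norm_mlog_sub_le`) and `‖log W − (W − 1)‖ ≤ ρ(2‖W − 1‖)` for `W = V̄₀(∂P)`. [cite: Balaban1985Averaging, (38) p.23, (47)–(50) p.25] -/
theorem fluxLinearisation (L : ℕ) (hL : 1 ≤ L) (z y : Site d) {μ ν : Fin d}
    (hy : y = z + (L : ℤ) • e μ + (L : ℤ) • e ν) (V₀ : Site d → Fin d → 𝔸ˣ) {α₀ : ℝ} (hα₀ : 0 ≤ α₀)
    (hsmall : 512 * (d + 1) * (d + 4) * (L : ℝ) ^ 2 * α₀ ≤ 1)
    (h44 : ∀ x, ‖((hol V₀ x (plaqWord μ ν) : 𝔸ˣ) : 𝔸) - 1‖ ≤ α₀)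
    (hbond : ∀ x κ, l1 (x - y) ≤ (2 * d + 4) * L + 4 → ‖((V₀ x κ : 𝔸ˣ) : 𝔸) - 1‖ ≤ l1 (x - y) * α₀) :
    ‖MatrixLog.mlog ((cplaq L (bavg L V₀) z μ ν : 𝔸ˣ) : 𝔸) - fluxAvg L V₀ z μ ν‖
        ≤ 300 * (8 * (d + 1) * (d + 4) * (L : ℝ) ^ 2 * α₀) ^ 2 ∧
      ‖fluxAvg L V₀ z μ ν‖ ≤ 2 * (L : ℝ) ^ 2 * α₀ ∧
      ‖((cplaq L (bavg L V₀) z μ ν : 𝔸ˣ) : 𝔸) - 1‖ ≤ 4 * (8 * (d + 1) * (d + 4) * (L : ℝ) ^ 2 * α₀) ∧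
      ‖MatrixLog.mlog ((cplaq L (bavg L V₀) z μ ν : 𝔸ˣ) : 𝔸)‖
        ≤ 5 * (8 * (d + 1) * (d + 4) * (L : ℝ) ^ 2 * α₀) := by
  have hd : 1 ≤ d := μ.pos
  -- the constants (as in `prop1_core`)
  set R : ℕ := (2 * d + 4) * L + 4 with hRdef
  set a : ℝ := 4 * (d + 4) * L * α₀ with hadef
  set θ : ℝ := 8 * (d + 1) * (d + 4) * (L : ℝ) ^ 2 * α₀ with hθdef
  have hLr : (1 : ℝ) ≤ L := by exact_mod_cast hL
  have hdr : (1 : ℝ) ≤ d := by exact_mod_cast hd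
  have ha : 0 ≤ a := by positivity
  have hθ0 : 0 ≤ θ := by positivity
  have hθ1 : θ ≤ 1 / 64 := by
    have : 64 * θ = 512 * (d + 1) * (d + 4) * (L : ℝ) ^ 2 * α₀ := by rw [hθdef]; ring
    linarith
  have haθ : 4 * a ≤ θ := by
    have e1 : θ - 4 * a = 8 * ((d : ℝ) + 4) * L * α₀ * ((d + 1) * L - 2) := by rw [hθdef, hadef]; ring
    have e2 : 0 ≤ 8 * ((d : ℝ) + 4) * L * α₀ * ((d + 1) * L - 2) :=
      mul_nonneg (by positivity) (by nlinarith [mul_nonneg (sub_nonneg.mpr hdr) (by positivity : (0 : ℝ) ≤ L)])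
    linarith
  have ha1 : a ≤ 1 := by linarith
  have hθsq : θ ^ 2 ≤ θ / 64 := by
    calc θ ^ 2 = θ * θ := sq θ
      _ ≤ θ * (1 / 64) := mul_le_mul_of_nonneg_left hθ1 hθ0
      _ = θ / 64 := by ring
  have hθ3 : θ ^ 3 ≤ θ ^ 2 / 64 := by
    calc θ ^ 3 = θ ^ 2 * θ := by ring
      _ ≤ θ ^ 2 * (1 / 64) := mul_le_mul_of_nonneg_left hθ1 (sq_nonneg θ)
      _ = θ ^ 2 / 64 := by ring
  have hθ4 : θ ^ 4 ≤ θ ^ 2 / 64 := by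
    calc θ ^ 4 = θ ^ 3 * θ := by ring
      _ ≤ (θ ^ 2 / 64) * (1 / 64) := mul_le_mul hθ3 hθ1 hθ0 (by positivity)
      _ ≤ θ ^ 2 / 64 := by linarith [sq_nonneg θ]
  have hL2α : (L : ℝ) ^ 2 * α₀ ≤ θ / 80 := by
    have e1 : θ - 80 * ((L : ℝ) ^ 2 * α₀) = 8 * ((d + 1) * (d + 4) - 10) * ((L : ℝ) ^ 2 * α₀) := by
      rw [hθdef]; ring
    have e2 : (0 : ℝ) ≤ 8 * ((d + 1) * (d + 4) - 10) * ((L : ℝ) ^ 2 * α₀) :=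
      mul_nonneg (mul_nonneg (by norm_num) (by nlinarith)) (by positivity)
    linarith
  have hα₀θ : α₀ ≤ θ / 80 := by
    have : α₀ ≤ (L : ℝ) ^ 2 * α₀ := by
      have h1 : (1 : ℝ) ≤ (L : ℝ) ^ 2 := by nlinarith
      nlinarith
    linarith
  have hα₀h : α₀ ≤ 1 / 2 := by linarith
  have hRa : ((R : ℕ) : ℝ) * α₀ ≤ a / 2 := by
    have e1 : a / 2 - ((R : ℕ) : ℝ) * α₀ = 4 * ((L : ℝ) - 1) * α₀ := by rw [hRdef, hadef]; push_cast; ring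
    have e2 : 0 ≤ 4 * ((L : ℝ) - 1) * α₀ := mul_nonneg (mul_nonneg (by norm_num) (by linarith)) hα₀
    linarith
  -- the bond field
  have hb : ∀ x κ, l1 (x - y) ≤ R → ‖((V₀ x κ : 𝔸ˣ) : 𝔸) - 1‖ ≤ a / 2 := fun x κ hx =>
    (hbond x κ hx).trans ((mul_le_mul_of_nonneg_right (by exact_mod_cast hx) hα₀).trans hRa)
  have hVA := bond_log y R ha1 hb
  set A : Site d → Fin d → 𝔸 := fun x κ => MatrixLog.mlog ((V₀ x κ : 𝔸ˣ) : 𝔸) with hAdef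
  -- the four sides
  have hθN : ((2 * (d * L) + L + L : ℕ) : ℝ) * a ≤ θ := le_of_eq (by rw [hadef, hθdef]; push_cast; ring)
  have hRexp : R = 2 * (d * L) + 4 * L + 4 := by rw [hRdef]; ring
  have hzy : l1 (z - y) ≤ 2 * L := by
    rw [hy, show z - (z + (L : ℤ) • e μ + (L : ℤ) • e ν) = -((L : ℤ) • e μ + (L : ℤ) • e ν) by abel, l1_neg]
    refine (l1_add_le _ _).trans ?_
    rw [l1_zsmul_e, l1_zsmul_e, Int.natAbs_natCast]; omega
  have hzμy : l1 (z + (L : ℤ) • e μ - y) ≤ 2 * L := by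
    rw [hy, show z + (L : ℤ) • e μ - (z + (L : ℤ) • e μ + (L : ℤ) • e ν) = -((L : ℤ) • e ν) by abel, l1_neg,
      l1_zsmul_e, Int.natAbs_natCast]; omega
  have hzνy : l1 (z + (L : ℤ) • e ν - y) ≤ 2 * L := by
    rw [hy, show z + (L : ℤ) • e ν - (z + (L : ℤ) • e μ + (L : ℤ) • e ν) = -((L : ℤ) • e μ) by abel, l1_neg,
      l1_zsmul_e, Int.natAbs_natCast]; omega
  have hside : ∀ q κ, l1 (q - y) ≤ 2 * L →
      ‖((bavg L V₀ q κ : 𝔸ˣ) : 𝔸) - 1‖ ≤ 2 * θ ∧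
      ‖((bavg L V₀ q κ : 𝔸ˣ) : 𝔸) - 1 - Tside L A q κ‖ ≤ 50 * θ ^ 2 ∧
      ‖(((bavg L V₀ q κ)⁻¹ : 𝔸ˣ) : 𝔸) - 1‖ ≤ 2 * θ ∧
      ‖(((bavg L V₀ q κ)⁻¹ : 𝔸ˣ) : 𝔸) - 1 - (-Tside L A q κ)‖ ≤ 50 * θ ^ 2 ∧
      ∀ r : Fin d → Fin L, ‖((Wcx L V₀ q κ (boxVec L r) : 𝔸ˣ) : 𝔸) - 1‖ ≤ 2 * θ := fun q κ hq =>
    side_estimate V₀ A y R ha hVA L hL q κ (by rw [hRexp]; omega) hθN hθ0 hθ1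
  obtain ⟨f1, e1, -, -, -⟩ := hside z μ hzy
  obtain ⟨f2, e2, -, -, -⟩ := hside (z + (L : ℤ) • e μ) ν hzμy
  obtain ⟨-, -, f3, e3, -⟩ := hside (z + (L : ℤ) • e ν) μ hzνy
  obtain ⟨-, -, f4, e4, -⟩ := hside z ν hzy
  have hP := norm_prod4_sub_one_sub_le (by positivity) f1 f2 f3 f4 e1 e2 e3 e4
  -- (48): the first-order terms add up to `T := Σ_x L^{−d} A(∂(p′)_x)`
  set T : 𝔸 := ∑ r : Fin d → Fin L, ((L : ℝ) ^ d)⁻¹ • asum A (z + boxVec L r) (rectWord L L μ ν) with hTdef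
  have hTsum : Tside L A z μ + Tside L A (z + (L : ℤ) • e μ) ν + -Tside L A (z + (L : ℤ) • e ν) μ
      + -Tside L A z ν = T := by
    simp only [hTdef, Tside, ← Finset.sum_neg_distrib, ← Finset.sum_add_distrib, ← smul_neg, ← smul_add]
    refine Finset.sum_congr rfl fun r _ => ?_
    rw [← corner_cancellation]
    congr 1
    abel
  -- the plaquettes of the stencil lie in the region of control
  have hRst : ∀ (r : Fin d → Fin L) (i j : ℕ), i < L → j < L →
      l1 (z + boxVec L r + (i : ℤ) • e μ + (j : ℤ) • e ν - y) + 4 ≤ R := fun r i j hi hj => by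
    have h1 := l1_add_le (z - y) (boxVec L r + (i : ℤ) • e μ + (j : ℤ) • e ν)
    have h2 := (l1_add_le (boxVec L r + (i : ℤ) • e μ) ((j : ℤ) • e ν))
    have h3 := (l1_add_le (boxVec L r) ((i : ℤ) • e μ))
    have h4 := l1_boxVec_le L r
    rw [l1_zsmul_e, Int.natAbs_natCast] at h2 h3
    rw [show z - y + (boxVec L r + (i : ℤ) • e μ + (j : ℤ) • e ν)
      = z + boxVec L r + (i : ℤ) • e μ + (j : ℤ) • e ν - y by abel] at h1
    rw [hRexp]; omega
  -- per plaquette: `‖A(∂p) − log V₀(∂p)‖ ≤ ρ(4a) + ρ(2α₀)` and `‖log V₀(∂p)‖ ≤ 2α₀`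
  have hplaq : ∀ (r : Fin d → Fin L), ∀ i ∈ Finset.range L, ∀ j ∈ Finset.range L,
      ‖asum A (z + boxVec L r + (i : ℤ) • e μ + (j : ℤ) • e ν) (plaqWord μ ν)
        - MatrixLog.mlog ((hol V₀ (z + boxVec L r + (i : ℤ) • e μ + (j : ℤ) • e ν) (plaqWord μ ν) : 𝔸ˣ) : 𝔸)‖
        ≤ expRem (4 * a) + expRem (2 * α₀) ∧
      ‖MatrixLog.mlog ((hol V₀ (z + boxVec L r + (i : ℤ) • e μ + (j : ℤ) • e ν) (plaqWord μ ν) : 𝔸ˣ) : 𝔸)‖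
        ≤ 2 * α₀ := by
    intro r i hi j hj
    rw [Finset.mem_range] at hi hj
    set x : Site d := z + boxVec L r + (i : ℤ) • e μ + (j : ℤ) • e ν with hxdef
    set W : 𝔸 := ((hol V₀ x (plaqWord μ ν) : 𝔸ˣ) : 𝔸) with hWdef
    obtain ⟨_, h2⟩ := walk_linear V₀ A y R ha hVA (plaqWord μ ν) x (hRst r i j hi hj)
    have hl : ((plaqWord μ ν).length : ℝ) = 4 := by simp [plaqWord]
    rw [hl] at h2
    have hW1 : ‖W - 1‖ ≤ 1 / 2 := (h44 x).trans hα₀h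
    have h3 : ‖MatrixLog.mlog W - (W - 1)‖ ≤ expRem (2 * α₀) :=
      (norm_mlog_sub_le hW1).trans (expRem_mono (by positivity) (by linarith [h44 x]))
    refine ⟨?_, (MatrixLog.norm_mlog_le_two_mul hW1).trans (by linarith [h44 x])⟩
    calc ‖asum A x (plaqWord μ ν) - MatrixLog.mlog W‖
          = ‖-(W - 1 - asum A x (plaqWord μ ν)) - (MatrixLog.mlog W - (W - 1))‖ := by
            congr 1; abel
      _ ≤ ‖-(W - 1 - asum A x (plaqWord μ ν))‖ + ‖MatrixLog.mlog W - (W - 1)‖ := norm_sub_le _ _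
      _ ≤ expRem (4 * a) + expRem (2 * α₀) := by rw [norm_neg]; exact add_le_add h2 h3
  -- Stokes: `T − Θ` is an average of `L²` plaquette defects
  have hρ1 : (L : ℝ) ^ 2 * expRem (4 * a) ≤ θ ^ 2 := by
    have h1 : expRem (4 * a) ≤ (4 * a) ^ 2 := expRem_le_sq (by positivity) (by linarith)
    have h2 : θ ^ 2 - (L : ℝ) ^ 2 * (4 * a) ^ 2 = 64 * ((d + 4) * (L : ℝ) ^ 2 * α₀) ^ 2 * ((d + 1) ^ 2 - 4) := by
      rw [hθdef, hadef]; ring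
    have h3 : 0 ≤ 64 * ((d + 4) * (L : ℝ) ^ 2 * α₀) ^ 2 * (((d : ℝ) + 1) ^ 2 - 4) :=
      mul_nonneg (by positivity) (by nlinarith)
    have h4 := mul_le_mul_of_nonneg_left h1 (by positivity : (0 : ℝ) ≤ (L : ℝ) ^ 2)
    linarith
  have hρ2 : (L : ℝ) ^ 2 * expRem (2 * α₀) ≤ θ ^ 2 := by
    have h1 : expRem (2 * α₀) ≤ (2 * α₀) ^ 2 := expRem_le_sq (by positivity) (by linarith)
    have h4 := mul_le_mul_of_nonneg_left h1 (by positivity : (0 : ℝ) ≤ (L : ℝ) ^ 2)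
    have h5 : (L : ℝ) ^ 2 * (2 * α₀) ^ 2 = 4 * ((L : ℝ) ^ 2 * α₀) * α₀ := by ring
    have h6 : 4 * ((L : ℝ) ^ 2 * α₀) * α₀ ≤ 4 * (θ / 80) * (θ / 80) :=
      mul_le_mul (mul_le_mul_of_nonneg_left hL2α (by norm_num)) hα₀θ hα₀ (by positivity)
    have h7 : 4 * (θ / 80) * (θ / 80) = θ ^ 2 / 1600 := by ring
    have h8 := sq_nonneg θ
    linarith
  have hTΘ : ‖T - fluxAvg L V₀ z μ ν‖ ≤ 2 * θ ^ 2 := by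
    have hdiff : T - fluxAvg L V₀ z μ ν = ∑ r : Fin d → Fin L, ((L : ℝ) ^ d)⁻¹ •
        ∑ i ∈ Finset.range L, ∑ j ∈ Finset.range L,
          (asum A (z + boxVec L r + (i : ℤ) • e μ + (j : ℤ) • e ν) (plaqWord μ ν)
            - MatrixLog.mlog ((hol V₀ (z + boxVec L r + (i : ℤ) • e μ + (j : ℤ) • e ν) (plaqWord μ ν) : 𝔸ˣ) : 𝔸)) := by
      rw [hTdef, fluxAvg, ← Finset.sum_sub_distrib]
      refine Finset.sum_congr rfl fun r _ => ?_
      rw [← smul_sub, stokes, ← Finset.sum_sub_distrib]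
      congr 1
      refine Finset.sum_congr rfl fun i _ => ?_
      rw [← Finset.sum_sub_distrib]
    rw [hdiff]
    refine norm_avg_le L hL _ fun r => ?_
    calc _ ≤ ∑ i ∈ Finset.range L, ‖∑ j ∈ Finset.range L,
            (asum A (z + boxVec L r + (i : ℤ) • e μ + (j : ℤ) • e ν) (plaqWord μ ν)
              - MatrixLog.mlog ((hol V₀ (z + boxVec L r + (i : ℤ) • e μ + (j : ℤ) • e ν) (plaqWord μ ν) : 𝔸ˣ) : 𝔸))‖ :=
          norm_sum_le _ _
      _ ≤ ∑ i ∈ Finset.range L, ∑ j ∈ Finset.range L,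
            ‖asum A (z + boxVec L r + (i : ℤ) • e μ + (j : ℤ) • e ν) (plaqWord μ ν)
              - MatrixLog.mlog ((hol V₀ (z + boxVec L r + (i : ℤ) • e μ + (j : ℤ) • e ν) (plaqWord μ ν) : 𝔸ˣ) : 𝔸)‖ :=
          Finset.sum_le_sum fun i _ => norm_sum_le _ _
      _ ≤ ∑ i ∈ Finset.range L, ∑ j ∈ Finset.range L, (expRem (4 * a) + expRem (2 * α₀)) :=
          Finset.sum_le_sum fun i hi => Finset.sum_le_sum fun j hj => (hplaq r i hi j hj).1
      _ = (L : ℝ) ^ 2 * expRem (4 * a) + (L : ℝ) ^ 2 * expRem (2 * α₀) := by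
          rw [Finset.sum_const, Finset.sum_const, Finset.card_range, nsmul_eq_mul, nsmul_eq_mul]; ring
      _ ≤ 2 * θ ^ 2 := by linarith
  -- `‖Θ‖ ≤ 2L²α₀`
  have hΘ : ‖fluxAvg L V₀ z μ ν‖ ≤ 2 * (L : ℝ) ^ 2 * α₀ := by
    refine norm_avg_le L hL _ fun r => ?_
    calc _ ≤ ∑ i ∈ Finset.range L, ‖∑ j ∈ Finset.range L,
            MatrixLog.mlog ((hol V₀ (z + boxVec L r + (i : ℤ) • e μ + (j : ℤ) • e ν) (plaqWord μ ν) : 𝔸ˣ) : 𝔸)‖ :=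
          norm_sum_le _ _
      _ ≤ ∑ i ∈ Finset.range L, ∑ j ∈ Finset.range L,
            ‖MatrixLog.mlog ((hol V₀ (z + boxVec L r + (i : ℤ) • e μ + (j : ℤ) • e ν) (plaqWord μ ν) : 𝔸ˣ) : 𝔸)‖ :=
          Finset.sum_le_sum fun i _ => norm_sum_le _ _
      _ ≤ ∑ i ∈ Finset.range L, ∑ j ∈ Finset.range L, 2 * α₀ :=
          Finset.sum_le_sum fun i hi => Finset.sum_le_sum fun j hj => (hplaq r i hi j hj).2
      _ = 2 * (L : ℝ) ^ 2 * α₀ := by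
          rw [Finset.sum_const, Finset.sum_const, Finset.card_range, nsmul_eq_mul, nsmul_eq_mul]; ring
  -- collecting: `‖W̄ − 1 − Θ‖ ≤ 227θ²`, `‖W̄ − 1‖ ≤ 4θ`
  set Wbar : 𝔸 := ((cplaq L (bavg L V₀) z μ ν : 𝔸ˣ) : 𝔸) with hWbar
  have hcp : Wbar = ((bavg L V₀ z μ : 𝔸ˣ) : 𝔸)
      * ((bavg L V₀ (z + (L : ℤ) • e μ) ν : 𝔸ˣ) : 𝔸) * (((bavg L V₀ (z + (L : ℤ) • e ν) μ)⁻¹ : 𝔸ˣ) : 𝔸)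
      * (((bavg L V₀ z ν)⁻¹ : 𝔸ˣ) : 𝔸) := by simp only [hWbar, cplaq, Units.val_mul]
  rw [hTsum, ← hcp] at hP
  have hWT : ‖Wbar - 1 - T‖ ≤ 225 * θ ^ 2 := by
    refine hP.trans ?_
    have : 4 * (50 * θ ^ 2) + (2 * θ) ^ 2 * (6 + 4 * (2 * θ) + (2 * θ) ^ 2)
        = 224 * θ ^ 2 + 32 * θ ^ 3 + 16 * θ ^ 4 := by ring
    rw [this]; linarith [sq_nonneg θ]
  have hWΘ : ‖Wbar - 1 - fluxAvg L V₀ z μ ν‖ ≤ 227 * θ ^ 2 := by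
    calc ‖Wbar - 1 - fluxAvg L V₀ z μ ν‖ = ‖(Wbar - 1 - T) + (T - fluxAvg L V₀ z μ ν)‖ := by
          congr 1; abel
      _ ≤ ‖Wbar - 1 - T‖ + ‖T - fluxAvg L V₀ z μ ν‖ := norm_add_le _ _
      _ ≤ 227 * θ ^ 2 := by linarith
  have hW1 : ‖Wbar - 1‖ ≤ 4 * θ := by
    calc ‖Wbar - 1‖ = ‖(Wbar - 1 - fluxAvg L V₀ z μ ν) + fluxAvg L V₀ z μ ν‖ := by rw [sub_add_cancel]
      _ ≤ ‖Wbar - 1 - fluxAvg L V₀ z μ ν‖ + ‖fluxAvg L V₀ z μ ν‖ := norm_add_le _ _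
      _ ≤ 227 * θ ^ 2 + 2 * (L : ℝ) ^ 2 * α₀ := add_le_add hWΘ hΘ
      _ ≤ 4 * θ := by linarith
  -- the logarithm of `W̄`
  have hW1h : ‖Wbar - 1‖ ≤ 1 / 2 := by linarith
  have hlogW : ‖MatrixLog.mlog Wbar - (Wbar - 1)‖ ≤ 64 * θ ^ 2 := by
    refine (norm_mlog_sub_le hW1h).trans ?_
    refine (expRem_mono (by positivity) (by linarith : 2 * ‖Wbar - 1‖ ≤ 8 * θ)).trans ?_
    refine (expRem_le_sq (by positivity) (by linarith)).trans ?_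
    exact le_of_eq (by ring)
  have hmain : ‖MatrixLog.mlog Wbar - fluxAvg L V₀ z μ ν‖ ≤ 300 * θ ^ 2 := by
    calc ‖MatrixLog.mlog Wbar - fluxAvg L V₀ z μ ν‖
          = ‖(MatrixLog.mlog Wbar - (Wbar - 1)) + (Wbar - 1 - fluxAvg L V₀ z μ ν)‖ := by congr 1; abel
      _ ≤ ‖MatrixLog.mlog Wbar - (Wbar - 1)‖ + ‖Wbar - 1 - fluxAvg L V₀ z μ ν‖ := norm_add_le _ _
      _ ≤ 300 * θ ^ 2 := by linarith [sq_nonneg θ]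
  refine ⟨hmain, hΘ, hW1, ?_⟩
  calc ‖MatrixLog.mlog Wbar‖ = ‖(MatrixLog.mlog Wbar - fluxAvg L V₀ z μ ν) + fluxAvg L V₀ z μ ν‖ := by
        rw [sub_add_cancel]
    _ ≤ ‖MatrixLog.mlog Wbar - fluxAvg L V₀ z μ ν‖ + ‖fluxAvg L V₀ z μ ν‖ := norm_add_le _ _
    _ ≤ 300 * θ ^ 2 + 2 * (L : ℝ) ^ 2 * α₀ := add_le_add hmain hΘ
    _ ≤ 5 * θ := by linarith

end Linearisation

/-! ## §3 The coarse plaquette weight in the axial gauge: the weight of `exp X`, Jensen on the flux average, and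
the cross term `hs(Θ, X − Θ)` (the ONLY place where the non-abelian remainder of (38) enters, in the `a³` slot) -/

section CoarsePlaquette

open NormedSpace Finset B7Prop1Explicit B7Prop2Explicit
open T4AveragingDeficitWall (wt)

variable {d : ℕ} {n : Type*} [Fintype n] [DecidableEq n] [Nonempty n]

local notation "𝕄" => Matrix n n ℂ
local notation "Site" => B7Prop1Explicit.Site

omit [Nonempty n] in
/-- **JENSEN FOR THE FLUX AVERAGE** `Θ = Σ_{x ∈ B(P)} L^{−d} Σ_{p′ ⊂ P_x} F₀(p′)` (`L^{d+2}` terms of weight `L^{−d}`,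
total weight `L²`): `hs(Θ, Θ) ≤ L²·L^{−d}·Σ hs(F₀, F₀)`. [folklore] -/
theorem hs_fluxAvg_le (L : ℕ) (hL : 1 ≤ L) (V : Site d → Fin d → 𝕄ˣ) (z : Site d) (μ ν : Fin d) :
    hs (fluxAvg L V z μ ν) (fluxAvg L V z μ ν)
      ≤ (L : ℝ) ^ 2 * ((L : ℝ) ^ d)⁻¹ * ∑ r : Fin d → Fin L, ∑ i ∈ range L, ∑ j ∈ range L,
          hs (mlog ((hol V (z + boxVec L r + (i : ℤ) • e μ + (j : ℤ) • e ν) (plaqWord μ ν) : 𝕄ˣ) : 𝕄))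
            (mlog ((hol V (z + boxVec L r + (i : ℤ) • e μ + (j : ℤ) • e ν) (plaqWord μ ν) : 𝕄ˣ) : 𝕄)) := by
  set c : ℝ := ((L : ℝ) ^ d)⁻¹ with hc
  have hL0 : (0 : ℝ) < L := by exact_mod_cast (by omega : 0 < L)
  have hc0 : 0 ≤ c := by rw [hc]; positivity
  set F : (Fin d → Fin L) × (ℕ × ℕ) → 𝕄 := fun p =>
    mlog ((hol V (z + boxVec L p.1 + (p.2.1 : ℤ) • e μ + (p.2.2 : ℤ) • e ν) (plaqWord μ ν) : 𝕄ˣ) : 𝕄) with hF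
  set s : Finset ((Fin d → Fin L) × (ℕ × ℕ)) := univ ×ˢ (range L ×ˢ range L) with hs_
  have hΘ : fluxAvg L V z μ ν = ∑ p ∈ s, (((fun _ => c) p : ℝ) : ℂ) • F p := by
    rw [hs_, Finset.sum_product]
    unfold fluxAvg
    refine Finset.sum_congr rfl fun r _ => ?_
    rw [← Complex.coe_smul, Finset.sum_product, Finset.smul_sum]
    refine Finset.sum_congr rfl fun i _ => ?_
    rw [Finset.smul_sum]
  have hJ := hs_sum_smul_sq_le s (fun _ => c) (fun _ _ => hc0) F
  rw [← hΘ] at hJ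
  have hcard : (s.card : ℝ) = (L : ℝ) ^ d * ((L : ℝ) * L) := by
    rw [hs_, Finset.card_product, Finset.card_product, Finset.card_univ, Fintype.card_fun, Fintype.card_fin,
      Fintype.card_fin, Finset.card_range]
    push_cast
    ring
  have hw : ∑ _p ∈ s, c = (L : ℝ) ^ 2 := by
    rw [Finset.sum_const, nsmul_eq_mul, hcard, hc]
    field_simp
  have hsum : ∑ p ∈ s, c * hs (F p) (F p) = c * ∑ r : Fin d → Fin L, ∑ i ∈ range L, ∑ j ∈ range L,
      hs (mlog ((hol V (z + boxVec L r + (i : ℤ) • e μ + (j : ℤ) • e ν) (plaqWord μ ν) : 𝕄ˣ) : 𝕄))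
        (mlog ((hol V (z + boxVec L r + (i : ℤ) • e μ + (j : ℤ) • e ν) (plaqWord μ ν) : 𝕄ˣ) : 𝕄)) := by
    rw [← Finset.mul_sum, hs_, Finset.sum_product]
    congr 1
    refine Finset.sum_congr rfl fun r _ => ?_
    rw [Finset.sum_product]
  rw [hw, hsum] at hJ
  simpa only [mul_assoc] using hJ

set_option maxHeartbeats 400000 in
/-- **THE COARSE PLAQUETTE WEIGHT IN THE AXIAL GAUGE, BOUNDED BY THE FINE FLUXES OF ITS STENCIL PLUS `a³`**:
under the hypotheses of `fluxLinearisation` for a `U(N)`-valued `V₀` whose coarse plaquette variable `W̄ = V̄₀(∂P)`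
is unitary, with `θ = 8(d+1)(d+4)L²α₀` and `F₀(p′) = log V₀(∂p′)`,
`1 − Re tr W̄ ≤ (L²·L^{−d}/2N)·Σ_{x ∈ B(P), p′ ⊂ P_x} hs(F₀(p′), F₀(p′)) + 711·θ³`.
Chain: `W̄ = exp X`, `X = log W̄` skew (B7 (22)–(23)); `1 − Re tr e^X ≤ hs(X,X)/2N` (spectral, `1 − cos t ≤ t²/2`);
`hs(X,X) ≤ hs(Θ,Θ) + 2N‖Θ‖‖X − Θ‖ + N‖X − Θ‖²` with `‖Θ‖ ≤ θ/40`, `‖X − Θ‖ ≤ 300θ²` (`fluxLinearisation`) —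
the cross term is the `a³` slot; Jensen (`hs_fluxAvg_le`). [folklore] -/
theorem wt_cplaq_axial_le (L : ℕ) (hL : 1 ≤ L) (z y : Site d) {μ ν : Fin d}
    (hy : y = z + (L : ℤ) • e μ + (L : ℤ) • e ν) (V₀ : Site d → Fin d → 𝕄ˣ) {α₀ : ℝ} (hα₀ : 0 ≤ α₀)
    (hsmall : 512 * (d + 1) * (d + 4) * (L : ℝ) ^ 2 * α₀ ≤ 1)
    (h44 : ∀ x, ‖((hol V₀ x (plaqWord μ ν) : 𝕄ˣ) : 𝕄) - 1‖ ≤ α₀)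
    (hbond : ∀ x κ, l1 (x - y) ≤ (2 * d + 4) * L + 4 → ‖((V₀ x κ : 𝕄ˣ) : 𝕄) - 1‖ ≤ l1 (x - y) * α₀)
    (hWu : cplaq L (bavg L V₀) z μ ν ∈ unitaryUnits 𝕄) :
    wt (cplaq L (bavg L V₀) z μ ν)
      ≤ (L : ℝ) ^ 2 * ((L : ℝ) ^ d)⁻¹ / (2 * Fintype.card n) *
          ∑ r : Fin d → Fin L, ∑ i ∈ range L, ∑ j ∈ range L,
            hs (mlog ((hol V₀ (z + boxVec L r + (i : ℤ) • e μ + (j : ℤ) • e ν) (plaqWord μ ν) : 𝕄ˣ) : 𝕄))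
              (mlog ((hol V₀ (z + boxVec L r + (i : ℤ) • e μ + (j : ℤ) • e ν) (plaqWord μ ν) : 𝕄ˣ) : 𝕄))
        + 711 * (8 * (d + 1) * (d + 4) * (L : ℝ) ^ 2 * α₀) ^ 3 := by
  have hd : 1 ≤ d := μ.pos
  obtain ⟨hR, hΘ, hW1, -⟩ := fluxLinearisation L hL z y hy V₀ hα₀ hsmall h44 hbond
  set θ : ℝ := 8 * (d + 1) * (d + 4) * (L : ℝ) ^ 2 * α₀ with hθdef
  have hLr : (1 : ℝ) ≤ L := by exact_mod_cast hL
  have hdr : (1 : ℝ) ≤ d := by exact_mod_cast hd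
  have hθ0 : 0 ≤ θ := by positivity
  have hθ1 : θ ≤ 1 / 64 := by
    have : 64 * θ = 512 * (d + 1) * (d + 4) * (L : ℝ) ^ 2 * α₀ := by rw [hθdef]; ring
    linarith
  set N : ℝ := (Fintype.card n : ℝ) with hNdef
  have hN : 0 < N := by rw [hNdef]; exact_mod_cast Fintype.card_pos
  set W : 𝕄 := ((cplaq L (bavg L V₀) z μ ν : 𝕄ˣ) : 𝕄) with hWdef
  set Θ : 𝕄 := fluxAvg L V₀ z μ ν with hΘdef
  set X : 𝕄 := mlog W with hXdef
  -- `W̄` is unitary and within `4θ ≤ 1/16` of `1`: `X = log W̄` is skew and `exp X = W̄`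
  have hWU : W ∈ Matrix.unitaryGroup n ℂ := mem_unitaryUnits.mp hWu
  have hW1' : ‖W - 1‖ < 1 / 2 := by linarith
  have hXskew : Xᴴ = -X := by
    have h := star_mlog_of_unitary hWU hW1'
    rwa [Matrix.star_eq_conjTranspose] at h
  have hexp : NormedSpace.exp X = W := exp_mlog (by linarith)
  -- the weight of `exp X`
  have h1 : wt (cplaq L (bavg L V₀) z μ ν) = 1 - nReTr (NormedSpace.exp X) := by
    rw [hexp, hWdef, T4AveragingDeficitWall.wt]
  have h2 := one_sub_nReTr_exp_le hXskew
  -- `hs(X, X)` against `hs(Θ, Θ)` and the cross term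
  have h3 : hs X X ≤ hs Θ Θ + 2 * N * (‖Θ‖ * ‖X - Θ‖) + N * ‖X - Θ‖ ^ 2 := by
    have := hs_add_self_le Θ (X - Θ)
    rwa [add_sub_cancel] at this
  have h4 := hs_fluxAvg_le L hL V₀ z μ ν
  -- the cross term is `O(θ³)`
  have hΘ' : ‖Θ‖ ≤ θ / 40 := by
    have e1 : θ / 40 - 2 * (L : ℝ) ^ 2 * α₀ = (L : ℝ) ^ 2 * α₀ * (((d : ℝ) - 1) * (d + 6)) / 5 := by
      rw [hθdef]; ring
    have e2 : 0 ≤ (L : ℝ) ^ 2 * α₀ * (((d : ℝ) - 1) * (d + 6)) / 5 := by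
      have : 0 ≤ ((d : ℝ) - 1) * (d + 6) := mul_nonneg (by linarith) (by positivity)
      positivity
    linarith
  have hRn : 0 ≤ ‖X - Θ‖ := norm_nonneg _
  have hcross : 2 * N * (‖Θ‖ * ‖X - Θ‖) + N * ‖X - Θ‖ ^ 2 ≤ 2 * N * (711 * θ ^ 3) := by
    have c1 : ‖Θ‖ * ‖X - Θ‖ ≤ (θ / 40) * (300 * θ ^ 2) := mul_le_mul hΘ' hR hRn (by positivity)
    have c2 : ‖X - Θ‖ ^ 2 ≤ (300 * θ ^ 2) ^ 2 := pow_le_pow_left₀ hRn hR 2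
    have hθ4 : θ ^ 4 ≤ θ ^ 3 / 64 := by
      calc θ ^ 4 = θ ^ 3 * θ := by ring
        _ ≤ θ ^ 3 * (1 / 64) := mul_le_mul_of_nonneg_left hθ1 (by positivity)
        _ = θ ^ 3 / 64 := by ring
    have c3 : 2 * N * (‖Θ‖ * ‖X - Θ‖) ≤ 2 * N * ((θ / 40) * (300 * θ ^ 2)) :=
      mul_le_mul_of_nonneg_left c1 (by positivity)
    have c4 : N * ‖X - Θ‖ ^ 2 ≤ N * (300 * θ ^ 2) ^ 2 := mul_le_mul_of_nonneg_left c2 hN.le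
    have e3 : 2 * N * ((θ / 40) * (300 * θ ^ 2)) = 15 * (N * θ ^ 3) := by ring
    have e4 : N * (300 * θ ^ 2) ^ 2 = 90000 * (N * θ ^ 4) := by ring
    have e5 : 2 * N * (711 * θ ^ 3) = 1422 * (N * θ ^ 3) := by ring
    have c5 : N * θ ^ 4 ≤ N * (θ ^ 3 / 64) := mul_le_mul_of_nonneg_left hθ4 hN.le
    have c6 : 0 ≤ N * θ ^ 3 := mul_nonneg hN.le (pow_nonneg hθ0 3)
    rw [e5]
    rw [e3] at c3
    rw [e4] at c4
    linarith
  have hXX : hs X X ≤ (L : ℝ) ^ 2 * ((L : ℝ) ^ d)⁻¹ * (∑ r : Fin d → Fin L, ∑ i ∈ range L, ∑ j ∈ range L,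
      hs (mlog ((hol V₀ (z + boxVec L r + (i : ℤ) • e μ + (j : ℤ) • e ν) (plaqWord μ ν) : 𝕄ˣ) : 𝕄))
        (mlog ((hol V₀ (z + boxVec L r + (i : ℤ) • e μ + (j : ℤ) • e ν) (plaqWord μ ν) : 𝕄ˣ) : 𝕄)))
      + 2 * N * (711 * θ ^ 3) := by linarith
  rw [h1]
  refine h2.trans ?_
  refine (div_le_div_of_nonneg_right hXX (by positivity)).trans (le_of_eq ?_)
  have hN0 : N ≠ 0 := hN.ne'
  rw [add_div, mul_div_assoc, mul_comm (2 * N) (711 * θ ^ 3), mul_div_cancel_right₀ _ (mul_ne_zero two_ne_zero hN0)]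
  ring

end CoarsePlaquette

/-! ## §4 The torus assembly: the gauge step (45), the fine weights from below, the periodic covering identity, and
`𝓓 ≤ upperConst·a³·M^d` on the full period window (the UPPER HALF of β′-per for general `U(N)`-valued data) -/

section Torus

open NormedSpace Finset B7Prop1Explicit B7Prop2Explicit
open T4AveragingDeficitWall hiding Site
open T4AveragingDeficitWallBoundary (IsPeriodicCfg periodBox blockSites_periodBox sum_blocks_eq sum_periodBox_shift
  card_periodBox zpow_sub_four_eq)

variable {d : ℕ} {n : Type*} [Fintype n] [DecidableEq n] [Nonempty n]

local notation "𝕄" => Matrix n n ℂ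
local notation "Site" => B7Prop1Explicit.Site

omit [Nonempty n] in
/-- Parallel transport (9) of a periodic configuration is periodic in the base point. [folklore] -/
theorem hol_add_period {V : Site d → Fin d → 𝕄ˣ} {P : ℤ} (hV : IsPeriodicCfg V P) (κ : Fin d) :
    ∀ (w : List (Letter d)) (x : Site d), hol V (x + P • e κ) w = hol V x w
  | [], x => by simp
  | l :: w, x => by
    have hstep : stepHol V (x + P • e κ) l = stepHol V x l := by
      unfold stepHol
      split_ifs
      · exact hV x κ l.1
      · rw [add_right_comm, hV]
    rw [hol_cons, hol_cons, hstep, add_right_comm, hol_add_period hV κ w (x + l.vec)]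

/-- The smallness regime `512(d+1)(d+4)L²a ≤ 1` forces `a ≤ 1/512`. [folklore] -/
theorem small_a_le {L : ℕ} (hL : 1 ≤ L) (hd : 1 ≤ d) {a : ℝ} (ha : 0 ≤ a)
    (hsmall : 512 * (d + 1) * (d + 4) * (L : ℝ) ^ 2 * a ≤ 1) : a ≤ 1 / 512 := by
  have hLr : (1 : ℝ) ≤ L := by exact_mod_cast hL
  have hdr : (1 : ℝ) ≤ d := by exact_mod_cast hd
  have hA : (1 : ℝ) ≤ (d : ℝ) + 1 := by linarith
  have hB : (1 : ℝ) ≤ (d : ℝ) + 4 := by linarith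
  have hC : (1 : ℝ) ≤ (L : ℝ) ^ 2 := one_le_pow₀ hLr
  have h1 : (1 : ℝ) ≤ ((d : ℝ) + 1) * ((d : ℝ) + 4) * (L : ℝ) ^ 2 :=
    one_le_mul_of_one_le_of_one_le (one_le_mul_of_one_le_of_one_le hA hB) hC
  have h2 : 512 * a * 1 ≤ 512 * a * (((d : ℝ) + 1) * ((d : ℝ) + 4) * (L : ℝ) ^ 2) :=
    mul_le_mul_of_nonneg_left h1 (by positivity)
  have e : 512 * a * (((d : ℝ) + 1) * ((d : ℝ) + 4) * (L : ℝ) ^ 2) = 512 * (d + 1) * (d + 4) * (L : ℝ) ^ 2 * a := by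
    ring
  rw [e] at h2
  linarith

/-- **THE FINE WEIGHT FROM BELOW** (B11 (5) against the flux): for a `U(N)`-valued `V` with `|V(∂p′) − 1| ≤ a ≤ 1/4`,
`hs(F, F)/2N − (5/6)a⁴ ≤ 1 − Re tr V(∂p′)`, `F = log V(∂p′)` (spectral: `1 − cos t ≥ t²/2 − (5/96)t⁴·…`, `|F| ≤ 2a`).
[folklore] -/
theorem wt_fhol_ge {V : Site d → Fin d → 𝕄ˣ} (hV : IsUnitaryCfg V) {a : ℝ} (ha1 : a ≤ 1 / 4)
    (p : T4AveragingDeficitWall.Plaq d)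
    (hp : ‖((fhol V p : 𝕄ˣ) : 𝕄) - 1‖ ≤ a) :
    hs (flux V p) (flux V p) / (2 * Fintype.card n) - 5 / 6 * a ^ 4 ≤ wt (fhol V p) := by
  have ha0 : 0 ≤ a := (norm_nonneg _).trans hp
  set N : ℝ := (Fintype.card n : ℝ) with hNdef
  have hN : 0 < N := by rw [hNdef]; exact_mod_cast Fintype.card_pos
  set W : 𝕄 := ((fhol V p : 𝕄ˣ) : 𝕄) with hWdef
  have hfu : fhol V p ∈ unitaryUnits 𝕄 := hol_mem_of hV _ _
  have hWU : W ∈ Matrix.unitaryGroup n ℂ := mem_unitaryUnits.mp hfu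
  have hW1 : ‖W - 1‖ < 1 / 2 := by linarith
  have hXdef : flux V p = mlog W := rfl
  have hXskew : (flux V p)ᴴ = -flux V p := by
    have h := star_mlog_of_unitary hWU hW1
    rwa [Matrix.star_eq_conjTranspose, ← hXdef] at h
  have hXn : ‖flux V p‖ ≤ 2 * a := by
    rw [hXdef]
    exact (norm_mlog_le_two_mul (by linarith)).trans (by linarith)
  have hX1 : ‖flux V p‖ ≤ 1 := by linarith
  have hexp : NormedSpace.exp (flux V p) = W := by rw [hXdef]; exact exp_mlog (by linarith)
  have hlow := hs_sub_quartic_le_one_sub_nReTr_exp hXskew hX1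
  rw [hexp] at hlow
  have hwt : wt (fhol V p) = 1 - nReTr W := rfl
  rw [hwt]
  -- the quartic correction
  have hq1 : hs (flux V p) (flux V p) / N ≤ ‖flux V p‖ ^ 2 := by
    rw [div_le_iff₀ hN, mul_comm]
    exact hs_self_le_card_mul_norm_sq _
  have hq2 : ‖flux V p‖ ^ 2 ≤ 4 * a ^ 2 := by nlinarith [norm_nonneg (flux V p)]
  have hq0 : 0 ≤ hs (flux V p) (flux V p) / N := div_nonneg (hs_self_nonneg _) hN.le
  have hq : 5 / 96 * ‖flux V p‖ ^ 2 * (hs (flux V p) (flux V p) / N) ≤ 5 / 6 * a ^ 4 := by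
    have : ‖flux V p‖ ^ 2 * (hs (flux V p) (flux V p) / N) ≤ (4 * a ^ 2) * (4 * a ^ 2) :=
      mul_le_mul hq2 (hq1.trans hq2) hq0 (by positivity)
    nlinarith
  have h2N : hs (flux V p) (flux V p) / (2 * (Fintype.card n : ℝ)) = hs (flux V p) (flux V p) / (2 * N) := rfl
  linarith

/-- **THE COARSE WEIGHT OF `V̄(∂P)` FOR A GENERAL `U(N)`-VALUED SMALL-FIELD CONFIGURATION**: for `y ∈ ℤ^d` and a plane
`π = (μ,ν)`, `1 − Re tr V̄(∂P_{Ly,π}) ≤ (L²·L^{−d}/2N)·Σ_{x ∈ B(Ly), i,j < L} hs(F(x + ie_μ + je_ν; π), same) + 711θ³`,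
`θ = 8(d+1)(d+4)L²a`.  Proof: pass to the axial gauge at `Ly + Le_μ + Le_ν` ((45): `bavg_gaugeAct`, `cplaq_conj`;
`Re tr` is conjugation invariant), apply `wt_cplaq_axial_le`, and pull the fluxes back by (11) (`mlog_units_conj`,
`hs_conj`). [cite: Balaban1985Averaging, (45) p.24, (11) p.19] -/
theorem wt_chol_le (L : ℕ) (hL : 1 ≤ L) {V : Site d → Fin d → 𝕄ˣ} (hV : IsUnitaryCfg V) {a : ℝ} (ha : 0 ≤ a)
    (hsmall : 512 * (d + 1) * (d + 4) * (L : ℝ) ^ 2 * a ≤ 1) (hVa : SmallField V a) (y : Site d) (π : Plane d) :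
    wt (chol L V (y, π))
      ≤ (L : ℝ) ^ 2 * ((L : ℝ) ^ d)⁻¹ / (2 * Fintype.card n) *
          ∑ r : Fin d → Fin L, ∑ i ∈ range L, ∑ j ∈ range L,
            hs (flux V ((L : ℤ) • y + boxVec L r + (i : ℤ) • e π.1.1 + (j : ℤ) • e π.1.2, π))
              (flux V ((L : ℤ) • y + boxVec L r + (i : ℤ) • e π.1.1 + (j : ℤ) • e π.1.2, π))
        + 711 * (8 * (d + 1) * (d + 4) * (L : ℝ) ^ 2 * a) ^ 3 := by
  -- the paper's `U(N) ⊂ M_N(ℂ)` as a C⋆-algebra (all fields are the `L²`-operator-norm instances in scope)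
  letI : CStarAlgebra 𝕄 := {}
  set μ : Fin d := π.1.1 with hμdef
  set ν : Fin d := π.1.2 with hνdef
  have hμν : μ ≠ ν := ne_of_lt π.2
  have hd : 1 ≤ d := μ.pos
  set z : Site d := (L : ℤ) • y with hzdef
  set yc : Site d := z + (L : ℤ) • e μ + (L : ℤ) • e ν with hycdef
  set u : Site d → 𝕄ˣ := axialFn V yc with hudef
  set V₀ : Site d → Fin d → 𝕄ˣ := gaugeAct u V with hV₀def
  have ha1 : a ≤ 1 / 4 := (small_a_le hL hd ha hsmall).trans (by norm_num)
  have hU : ∀ x κ, V x κ ∈ U1 𝕄 := fun x κ =>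
    ⟨(CStarRing.norm_of_mem_unitary (hV x κ)).le,
      (CStarRing.norm_of_mem_unitary ((unitaryUnits 𝕄).inv_mem (hV x κ))).le⟩
  have huU : ∀ x, u x ∈ U1 𝕄 := fun x => axialFn_mem hU yc x
  have huu : ∀ x, u x ∈ unitaryUnits 𝕄 := fun x => hol_mem_of hV _ _
  have h44₀ : ∀ x, ‖((hol V₀ x (plaqWord μ ν) : 𝕄ˣ) : 𝕄) - 1‖ ≤ a := fun x => by
    rw [hV₀def, hol_gaugeAct_closed _ _ _ _ (disp_plaqWord μ ν), Units.val_mul, Units.val_mul]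
    exact (norm_units_conj_sub_one_le (huU x) _).trans (hVa x μ ν hμν)
  have hbond : ∀ x κ, l1 (x - yc) ≤ (2 * d + 4) * L + 4 → ‖((V₀ x κ : 𝕄ˣ) : 𝕄) - 1‖ ≤ l1 (x - yc) * a :=
    fun x κ _ => axial_bond_bound V hU yc hVa ha x κ
  -- the loop variables of (42) for `V`: within `2θ ≤ 1/32`
  have hWle : ∀ (q : Site d) (κ : Fin d) (r : Fin d → Fin L),
      ‖((Wcx L V q κ (boxVec L r) : 𝕄ˣ) : 𝕄) - 1‖ ≤ 1 / 4 := fun q κ r =>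
    (norm_Wcx_sub_one_le L hL V hU ha hsmall hVa q κ r).trans (by linarith)
  have hWlt : ∀ (q : Site d) (κ : Fin d) (r : Fin d → Fin L),
      ‖((Wcx L V q κ (boxVec L r) : 𝕄ˣ) : 𝕄) - 1‖ < 1 := fun q κ r => by linarith [hWle q κ r]
  -- (45) on the four sides and on the coarse plaquette variable
  have hcov : ∀ (q : Site d) (κ : Fin d), bavg L V₀ q κ = u q * bavg L V q κ * (u (q + (L : ℤ) • e κ))⁻¹ :=
    fun q κ => by rw [hV₀def]; exact bavg_gaugeAct L huU V q κ (hWlt q κ)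
  have hconj : cplaq L (bavg L V₀) z μ ν = u z * cplaq L (bavg L V) z μ ν * (u z)⁻¹ :=
    cplaq_conj L u (bavg L V) (bavg L V₀) z μ ν (hcov z μ) (hcov _ ν) (hcov _ μ) (hcov z ν)
  -- unitarity of `V̄(∂P)` and of its axial-gauge conjugate
  have hbu : ∀ (q : Site d) (κ : Fin d), bavg L V q κ ∈ unitaryUnits 𝕄 := fun q κ =>
    bavg_mem_unitaryUnits (fun x κ' => hV x κ') L q κ (hWle q κ)
  have hcholu : cplaq L (bavg L V) z μ ν ∈ unitaryUnits 𝕄 := by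
    unfold cplaq
    exact mul_mem (mul_mem (mul_mem (hbu _ _) (hbu _ _)) (inv_mem (hbu _ _))) (inv_mem (hbu _ _))
  have hWu : cplaq L (bavg L V₀) z μ ν ∈ unitaryUnits 𝕄 := by
    rw [hconj]
    exact mul_mem (mul_mem (huu z) hcholu) (inv_mem (huu z))
  -- §3 in the axial gauge
  have key := wt_cplaq_axial_le L hL z yc rfl V₀ ha hsmall h44₀ hbond hWu
  -- the weight is conjugation invariant
  have hwt : wt (chol L V (y, π)) = wt (cplaq L (bavg L V₀) z μ ν) := by
    show wt (cplaq L (bavg L V) z μ ν) = _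
    rw [hconj, T4AveragingDeficitWall.wt, T4AveragingDeficitWall.wt, Units.val_mul, Units.val_mul,
      nReTr_conj (Units.inv_mul (u z))]
  -- the fluxes pull back by (11): `F₀(x) = u(x) F(x) u(x)⁻¹`, `hs` is `Ad`-invariant
  have hF : ∀ x : Site d,
      hs (mlog ((hol V₀ x (plaqWord μ ν) : 𝕄ˣ) : 𝕄)) (mlog ((hol V₀ x (plaqWord μ ν) : 𝕄ˣ) : 𝕄))
        = hs (flux V (x, π)) (flux V (x, π)) := by
    intro x
    have hx1 : ‖((hol V x (plaqWord μ ν) : 𝕄ˣ) : 𝕄) - 1‖ < 1 := by linarith [hVa x μ ν hμν]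
    have hsu : star ((u x : 𝕄ˣ) : 𝕄) * ((u x : 𝕄ˣ) : 𝕄) = 1 :=
      Unitary.star_mul_self_of_mem (mem_unitaryUnits.mp (huu x))
    have hstar : (((u x)⁻¹ : 𝕄ˣ) : 𝕄) = star ((u x : 𝕄ˣ) : 𝕄) := Units.inv_eq_of_mul_eq_one_left hsu
    rw [hV₀def, hol_gaugeAct_closed _ _ _ _ (disp_plaqWord μ ν), Units.val_mul, Units.val_mul,
      mlog_units_conj (huU x) hx1, hstar, hs_conj hsu]
    rfl
  have hS : (∑ r : Fin d → Fin L, ∑ i ∈ range L, ∑ j ∈ range L,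
        hs (mlog ((hol V₀ (z + boxVec L r + (i : ℤ) • e μ + (j : ℤ) • e ν) (plaqWord μ ν) : 𝕄ˣ) : 𝕄))
          (mlog ((hol V₀ (z + boxVec L r + (i : ℤ) • e μ + (j : ℤ) • e ν) (plaqWord μ ν) : 𝕄ˣ) : 𝕄)))
      = ∑ r : Fin d → Fin L, ∑ i ∈ range L, ∑ j ∈ range L,
          hs (flux V (z + boxVec L r + (i : ℤ) • e μ + (j : ℤ) • e ν, π))
            (flux V (z + boxVec L r + (i : ℤ) • e μ + (j : ℤ) • e ν, π)) :=
    Finset.sum_congr rfl fun r _ => Finset.sum_congr rfl fun i _ => Finset.sum_congr rfl fun j _ => hF _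
  rw [hwt, ← hS]
  exact key

omit [Nonempty n] in
/-- **THE PERIODIC COVERING IDENTITY**: for `g` of period `LM`, summing `g` over the `L^{d+2}` stencil corners
`Ly + r + ie_μ + je_ν` of every coarse plaquette base `y ∈ [0,M)^d` counts every fine site of `[0,LM)^d` exactly `L²`
times (block tiling + wrap-around). [folklore] -/
theorem sum_stencil_periodBox (L M : ℕ) (hL : 1 ≤ L) (hM : 1 ≤ M) {g : Site d → ℝ}
    (hg : ∀ (x : Site d) (κ : Fin d), g (x + ((L * M : ℕ) : ℤ) • e κ) = g x) (μ ν : Fin d) :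
    ∑ y ∈ periodBox M, ∑ r : Fin d → Fin L, ∑ i ∈ range L, ∑ j ∈ range L,
        g ((L : ℤ) • y + boxVec L r + (i : ℤ) • e μ + (j : ℤ) • e ν)
      = (L : ℝ) ^ 2 * ∑ x ∈ blockSites L (periodBox M), g x := by
  have hLM : 1 ≤ L * M := Nat.one_le_iff_ne_zero.mpr (Nat.mul_ne_zero (by omega) (by omega))
  have h1 := sum_blocks_eq L hL (periodBox M)
    (fun x => ∑ i ∈ range L, ∑ j ∈ range L, g (x + (i : ℤ) • e μ + (j : ℤ) • e ν))
  rw [h1, Finset.sum_comm]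
  have h2 : ∀ i ∈ range L, ∑ x ∈ blockSites L (periodBox M), ∑ j ∈ range L, g (x + (i : ℤ) • e μ + (j : ℤ) • e ν)
      = (L : ℝ) * ∑ x ∈ blockSites L (periodBox M), g x := by
    intro i _
    rw [Finset.sum_comm]
    have h3 : ∀ j ∈ range L, ∑ x ∈ blockSites L (periodBox M), g (x + (i : ℤ) • e μ + (j : ℤ) • e ν)
        = ∑ x ∈ blockSites L (periodBox M), g x := by
      intro j _
      rw [blockSites_periodBox L M hL]
      have := sum_periodBox_shift (L * M) hLM hg ((i : ℤ) • e μ + (j : ℤ) • e ν)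
      simpa only [add_assoc] using this
    rw [Finset.sum_congr rfl h3, Finset.sum_const, Finset.card_range, nsmul_eq_mul]
  rw [Finset.sum_congr rfl h2, Finset.sum_const, Finset.card_range, nsmul_eq_mul]
  ring

variable (d) in
/-- The constant of the upper half of β′-per: `#planes · (711·512·(d+1)³(d+4)³·L^{d+2} + L^d)`. [folklore] -/
def upperConst (L : ℕ) : ℝ :=
  (Fintype.card (Plane d) : ℝ) * (364032 * ((d : ℝ) + 1) ^ 3 * ((d : ℝ) + 4) ^ 3 * (L : ℝ) ^ (d + 2) + (L : ℝ) ^ d)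

omit [Fintype n] [DecidableEq n] [Nonempty n] in
/-- `0 ≤ upperConst d L`. [folklore] -/
theorem upperConst_nonneg (L : ℕ) : 0 ≤ upperConst d L := by
  unfold upperConst; positivity

set_option maxHeartbeats 400000 in
/-- **THE UPPER HALF OF β′-per FOR GENERAL `U(N)`-VALUED DATA, kernel-checked**: for `L, M ≥ 1`, every `U(N)`-valued
`V` of period `LM` with (44) `|V(∂p′) − 1| ≤ a` and `512(d+1)(d+4)L²a ≤ 1`, the averaging deficit of the Wilson action
on the full period window (the toroidal action difference `L^{d−4}·A(V̄) − A(V)` of `DeficitValueWallPer`) satisfies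
`𝓓 ≤ upperConst(d,L) · a³ · M^d` — NO positive part of order `a` or `a²`; the `a³` comes ONLY from the cross term
`hs(Θ, log V̄₀(∂P) − Θ)` of §3 (the non-abelian remainder of (38) paired with the mean flux) and the quartic weight
corrections.  The lower (covariant Poincaré) half is `deficit_torus_ge` (§8, v1.1); two-sided: `abs_deficit_torus_le`. [folklore] -/
theorem deficit_torus_le (L M : ℕ) (hL : 1 ≤ L) (hM : 1 ≤ M) {V : Site d → Fin d → 𝕄ˣ} (hV : IsUnitaryCfg V)
    (hP : IsPeriodicCfg V ((L : ℤ) * M)) {a : ℝ} (ha : 0 ≤ a)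
    (hsmall : 512 * (d + 1) * (d + 4) * (L : ℝ) ^ 2 * a ≤ 1) (hVa : SmallField V a) :
    deficit L V (blockWindow L (periodBox M)) ≤ upperConst d L * a ^ 3 * (M : ℝ) ^ d := by
  set N : ℝ := (Fintype.card n : ℝ) with hNdef
  have hN : 0 < N := by rw [hNdef]; exact_mod_cast Fintype.card_pos
  have hL0 : (0 : ℝ) < L := by exact_mod_cast (by omega : 0 < L)
  have hLr : (1 : ℝ) ≤ L := by exact_mod_cast hL
  set θ : ℝ := 8 * (d + 1) * (d + 4) * (L : ℝ) ^ 2 * a with hθdef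
  have hθ0 : 0 ≤ θ := by positivity
  have hcardB : ((blockSites L (periodBox (d := d) M)).card : ℝ) = ((L : ℝ) * M) ^ d := by
    rw [blockSites_periodBox L M hL, card_periodBox]; push_cast; ring
  have hcardY : ((periodBox (d := d) M).card : ℝ) = (M : ℝ) ^ d := by
    rw [card_periodBox]; push_cast; ring
  have hzpow : (L : ℝ) ^ ((d : ℤ) - 4) = (L : ℝ) ^ d / (L : ℝ) ^ 4 := zpow_sub_four_eq L hL
  -- the per-plane estimate
  have hplane : ∀ π : Plane d,
      (L : ℝ) ^ ((d : ℤ) - 4) * ∑ y ∈ periodBox M, wt (chol L V (y, π))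
          - ∑ x ∈ blockSites L (periodBox M), wt (fhol V (x, π))
        ≤ (364032 * ((d : ℝ) + 1) ^ 3 * ((d : ℝ) + 4) ^ 3 * (L : ℝ) ^ (d + 2) + (L : ℝ) ^ d)
            * a ^ 3 * (M : ℝ) ^ d := by
    intro π
    have hμν : π.1.1 ≠ π.1.2 := ne_of_lt π.2
    have hd : 1 ≤ d := π.1.1.pos
    have ha1 : a ≤ 1 / 4 := (small_a_le hL hd ha hsmall).trans (by norm_num)
    have ha1' : a ≤ 1 := by linarith
    set q : Site d → ℝ := fun x => hs (flux V (x, π)) (flux V (x, π)) with hqdef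
    have hq0 : ∀ x, 0 ≤ q x := fun x => hs_self_nonneg _
    -- periodicity of `q`
    have hqper : ∀ (x : Site d) (κ : Fin d), q (x + ((L * M : ℕ) : ℤ) • e κ) = q x := by
      intro x κ
      have hh : hol V (x + ((L * M : ℕ) : ℤ) • e κ) (plaqWord π.1.1 π.1.2) = hol V x (plaqWord π.1.1 π.1.2) := by
        have := hol_add_period hP κ (plaqWord π.1.1 π.1.2) x
        push_cast at this ⊢
        exact this
      simp only [hqdef, flux, fhol, hh]
    set Q : ℝ := ∑ x ∈ blockSites L (periodBox M), q x with hQdef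
    -- coarse side
    set C₁ : ℝ := (L : ℝ) ^ 2 * ((L : ℝ) ^ d)⁻¹ / (2 * N) with hC₁def
    have hcoarse : ∑ y ∈ periodBox M, wt (chol L V (y, π))
        ≤ C₁ * ((L : ℝ) ^ 2 * Q) + (M : ℝ) ^ d * (711 * θ ^ 3) := by
      have hcov := sum_stencil_periodBox L M hL hM hqper π.1.1 π.1.2
      calc ∑ y ∈ periodBox M, wt (chol L V (y, π))
          ≤ ∑ y ∈ periodBox M, (C₁ * ∑ r : Fin d → Fin L, ∑ i ∈ range L, ∑ j ∈ range L,
                q ((L : ℤ) • y + boxVec L r + (i : ℤ) • e π.1.1 + (j : ℤ) • e π.1.2) + 711 * θ ^ 3) :=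
            Finset.sum_le_sum fun y _ => wt_chol_le L hL hV ha hsmall hVa y π
        _ = C₁ * ((L : ℝ) ^ 2 * Q) + (M : ℝ) ^ d * (711 * θ ^ 3) := by
            rw [Finset.sum_add_distrib, ← Finset.mul_sum, hcov, Finset.sum_const, nsmul_eq_mul, hcardY]
    -- fine side
    have hfine : Q / (2 * N) - ((L : ℝ) * M) ^ d * (5 / 6 * a ^ 4)
        ≤ ∑ x ∈ blockSites L (periodBox M), wt (fhol V (x, π)) := by
      calc Q / (2 * N) - ((L : ℝ) * M) ^ d * (5 / 6 * a ^ 4)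
          = ∑ x ∈ blockSites L (periodBox M), (q x / (2 * N) - 5 / 6 * a ^ 4) := by
            rw [Finset.sum_sub_distrib, Finset.sum_const, nsmul_eq_mul, hcardB, hQdef, Finset.sum_div]
        _ ≤ ∑ x ∈ blockSites L (periodBox M), wt (fhol V (x, π)) :=
            Finset.sum_le_sum fun x _ => wt_fhol_ge hV ha1 (x, π) (hVa x π.1.1 π.1.2 hμν)
    -- the `Q`-terms cancel exactly: `L^{d−4}·C₁·L² = 1/2N`
    have hcancel : (L : ℝ) ^ ((d : ℤ) - 4) * (C₁ * ((L : ℝ) ^ 2 * Q)) = Q / (2 * N) := by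
      rw [hzpow, hC₁def]
      field_simp
    -- the two error terms
    have hθ3 : (L : ℝ) ^ ((d : ℤ) - 4) * ((M : ℝ) ^ d * (711 * θ ^ 3))
        = 364032 * ((d : ℝ) + 1) ^ 3 * ((d : ℝ) + 4) ^ 3 * (L : ℝ) ^ (d + 2) * a ^ 3 * (M : ℝ) ^ d := by
      rw [hzpow, hθdef, pow_add]
      field_simp
      ring
    have ha4 : ((L : ℝ) * M) ^ d * (5 / 6 * a ^ 4) ≤ (L : ℝ) ^ d * a ^ 3 * (M : ℝ) ^ d := by
      rw [mul_pow]
      have : 5 / 6 * a ^ 4 ≤ a ^ 3 := by nlinarith [pow_nonneg ha 3]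
      have hLM0 : 0 ≤ (L : ℝ) ^ d * (M : ℝ) ^ d := by positivity
      nlinarith
    have hzp0 : 0 ≤ (L : ℝ) ^ ((d : ℤ) - 4) := by rw [hzpow]; positivity
    have step : (L : ℝ) ^ ((d : ℤ) - 4) * ∑ y ∈ periodBox M, wt (chol L V (y, π))
        ≤ Q / (2 * N) + 364032 * ((d : ℝ) + 1) ^ 3 * ((d : ℝ) + 4) ^ 3 * (L : ℝ) ^ (d + 2) * a ^ 3 * (M : ℝ) ^ d := by
      calc (L : ℝ) ^ ((d : ℤ) - 4) * ∑ y ∈ periodBox M, wt (chol L V (y, π))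
          ≤ (L : ℝ) ^ ((d : ℤ) - 4) * (C₁ * ((L : ℝ) ^ 2 * Q) + (M : ℝ) ^ d * (711 * θ ^ 3)) :=
            mul_le_mul_of_nonneg_left hcoarse hzp0
        _ = Q / (2 * N) + 364032 * ((d : ℝ) + 1) ^ 3 * ((d : ℝ) + 4) ^ 3 * (L : ℝ) ^ (d + 2) * a ^ 3 * (M : ℝ) ^ d := by
            rw [mul_add, hcancel, hθ3]
    nlinarith [step, hfine, ha4]
  -- summing the planes
  unfold deficit blockWindow coarseAction fineAction
  simp only []
  rw [Finset.sum_product_right, Finset.sum_product_right, Finset.mul_sum, ← Finset.sum_sub_distrib]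
  refine (Finset.sum_le_sum fun π _ => hplane π).trans (le_of_eq ?_)
  rw [Finset.sum_const, Finset.card_univ, nsmul_eq_mul, upperConst]
  ring

/-- **… IN THE SHAPE OF `DeficitValueWallPer`, ONE-SIDED**: `𝓓 ≤ upperConst·(‖∇_V F‖²_{ℓ²(blocks)} + a³M^d)` — the
flux-gradient term is not even needed for the upper half (it is `≥ 0`).  The absolute value is `abs_deficit_torus_le`
and `DeficitValueWallPer` itself is `deficitValueWallPer_holds` (§8, v1.1). [folklore] -/
theorem deficit_torus_le_wallShape (L M : ℕ) (hL : 1 ≤ L) (hM : 1 ≤ M) {V : Site d → Fin d → 𝕄ˣ}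
    (hV : IsUnitaryCfg V) (hP : IsPeriodicCfg V ((L : ℤ) * M)) {a : ℝ} (ha : 0 ≤ a)
    (hsmall : 512 * (d + 1) * (d + 4) * (L : ℝ) ^ 2 * a ≤ 1) (hVa : SmallField V a) :
    deficit L V (blockWindow L (periodBox M))
      ≤ upperConst d L * (gradFluxSq V (blockSites L (periodBox M)) + a ^ 3 * (M : ℝ) ^ d) := by
  refine (deficit_torus_le L M hL hM hV hP ha hsmall hVa).trans ?_
  have hg : 0 ≤ gradFluxSq V (blockSites L (periodBox (d := d) M)) := by
    unfold gradFluxSq; positivity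
  have hC := upperConst_nonneg (d := d) L
  nlinarith [mul_nonneg hC hg]

end Torus

/-! ## §5 Matrix facts II: multiplication against the operator norm, the `Ad`-defect, the parallelogram bound, the
pair-variance identity and the coordinate form of the Hilbert–Schmidt square -/

section MatrixFactsII

open T4AveragingDeficitWall (Ad)
open B7Prop2Explicit (unitaryUnits mem_unitaryUnits)

variable {n : Type*} [Fintype n] [DecidableEq n]

local notation "𝕄" => Matrix n n ℂ

omit [DecidableEq n] in
/-- The parallelogram bound `hs(A+B, A+B) ≤ 2hs(A,A) + 2hs(B,B)`. [folklore] -/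
theorem hs_add_self_le_two (A B : 𝕄) : hs (A + B) (A + B) ≤ 2 * hs A A + 2 * hs B B := by
  have h := two_hs_le A B
  rw [hs_add_left, hs_add_right, hs_add_right, hs_comm A B]
  linarith

omit [DecidableEq n] in
/-- `hs(X,X) = N · nhsNormSq X`. [folklore] -/
theorem hs_self_eq_card_mul_nhsNormSq [Nonempty n] (X : 𝕄) :
    hs X X = (Fintype.card n : ℝ) * nhsNormSq X := by
  rw [hs_self, ← card_mul_nhsNormSq]

/-- Left multiplication against the operator norm: `hs(AY, AY) ≤ ‖A‖²·hs(Y, Y)`. [folklore] -/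
theorem hs_mul_left_le (A Y : 𝕄) : hs (A * Y) (A * Y) ≤ ‖A‖ ^ 2 * hs Y Y := by
  rcases isEmpty_or_nonempty n with hn | hn
  · simp [hs_self]
  rw [hs_self_eq_card_mul_nhsNormSq, hs_self_eq_card_mul_nhsNormSq]
  have h := nhsNormSq_mul_le A Y
  have hN : (0 : ℝ) ≤ Fintype.card n := Nat.cast_nonneg _
  calc (Fintype.card n : ℝ) * nhsNormSq (A * Y) ≤ Fintype.card n * (‖A‖ ^ 2 * nhsNormSq Y) :=
        mul_le_mul_of_nonneg_left h hN
    _ = ‖A‖ ^ 2 * (Fintype.card n * nhsNormSq Y) := by ring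

/-- Right multiplication against the operator norm: `hs(YA, YA) ≤ hs(Y, Y)·‖A‖²`. [folklore] -/
theorem hs_mul_right_le (Y A : 𝕄) : hs (Y * A) (Y * A) ≤ hs Y Y * ‖A‖ ^ 2 := by
  rcases isEmpty_or_nonempty n with hn | hn
  · simp [hs_self]
  rw [hs_self_eq_card_mul_nhsNormSq, hs_self_eq_card_mul_nhsNormSq, ← nhsNorm_sq, ← nhsNorm_sq]
  have h := nhsNorm_mul_le_nhsNorm_mul_opNorm Y A
  have h0 := nhsNorm_nonneg (Y * A)
  have h1 : nhsNorm (Y * A) ^ 2 ≤ (nhsNorm Y * ‖A‖) ^ 2 := pow_le_pow_left₀ h0 h 2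
  have hN : (0 : ℝ) ≤ Fintype.card n := Nat.cast_nonneg _
  calc (Fintype.card n : ℝ) * nhsNorm (Y * A) ^ 2 ≤ Fintype.card n * (nhsNorm Y * ‖A‖) ^ 2 :=
        mul_le_mul_of_nonneg_left h1 hN
    _ = Fintype.card n * nhsNorm Y ^ 2 * ‖A‖ ^ 2 := by ring

/-- `‖u⁻¹ − 1‖ ≤ ‖u − 1‖` for a unit with `‖u⁻¹‖ ≤ 1` (`u⁻¹ − 1 = u⁻¹(1 − u)`). [folklore] -/
theorem norm_units_inv_sub_one_le {u : 𝕄ˣ} (hu : ‖((u⁻¹ : 𝕄ˣ) : 𝕄)‖ ≤ 1) :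
    ‖((u⁻¹ : 𝕄ˣ) : 𝕄) - 1‖ ≤ ‖(u : 𝕄) - 1‖ := by
  have e : ((u⁻¹ : 𝕄ˣ) : 𝕄) - 1 = ((u⁻¹ : 𝕄ˣ) : 𝕄) * (1 - (u : 𝕄)) := by
    rw [mul_sub, mul_one, Units.inv_mul]
  rw [e]
  calc ‖((u⁻¹ : 𝕄ˣ) : 𝕄) * (1 - (u : 𝕄))‖ ≤ ‖((u⁻¹ : 𝕄ˣ) : 𝕄)‖ * ‖1 - (u : 𝕄)‖ := norm_mul_le _ _
    _ ≤ 1 * ‖1 - (u : 𝕄)‖ := mul_le_mul_of_nonneg_right hu (norm_nonneg _)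
    _ = ‖(u : 𝕄) - 1‖ := by rw [one_mul, norm_sub_rev]

/-- **THE `Ad`-DEFECT**: for a unit `u` with `‖u⁻¹‖ ≤ 1`, `hs(Ad_u Y − Y, same) ≤ 4‖u − 1‖²·hs(Y, Y)`
(`Ad_u Y − Y = (u − 1)·Y u⁻¹ + Y·(u⁻¹ − 1)`, `‖u⁻¹ − 1‖ ≤ ‖u − 1‖`). [folklore] -/
theorem hs_Ad_sub_self_le {u : 𝕄ˣ} (hu : ‖((u⁻¹ : 𝕄ˣ) : 𝕄)‖ ≤ 1) (Y : 𝕄) :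
    hs (Ad u Y - Y) (Ad u Y - Y) ≤ 4 * ‖(u : 𝕄) - 1‖ ^ 2 * hs Y Y := by
  have hdec : Ad u Y - Y = ((u : 𝕄) - 1) * (Y * ((u⁻¹ : 𝕄ˣ) : 𝕄)) + Y * (((u⁻¹ : 𝕄ˣ) : 𝕄) - 1) := by
    unfold Ad
    rw [sub_mul, one_mul, mul_sub, mul_one, mul_assoc]
    abel
  have hinv : ‖((u⁻¹ : 𝕄ˣ) : 𝕄) - 1‖ ≤ ‖(u : 𝕄) - 1‖ := norm_units_inv_sub_one_le hu
  have hY0 : 0 ≤ hs Y Y := hs_self_nonneg _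
  have hu1 : 0 ≤ ‖(u : 𝕄) - 1‖ := norm_nonneg _
  -- first piece
  have t1 : hs (((u : 𝕄) - 1) * (Y * ((u⁻¹ : 𝕄ˣ) : 𝕄))) (((u : 𝕄) - 1) * (Y * ((u⁻¹ : 𝕄ˣ) : 𝕄)))
      ≤ ‖(u : 𝕄) - 1‖ ^ 2 * hs Y Y := by
    refine (hs_mul_left_le _ _).trans (mul_le_mul_of_nonneg_left ?_ (sq_nonneg _))
    refine (hs_mul_right_le _ _).trans ?_
    have : ‖((u⁻¹ : 𝕄ˣ) : 𝕄)‖ ^ 2 ≤ 1 := by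
      have := pow_le_pow_left₀ (norm_nonneg _) hu 2
      simpa using this
    nlinarith
  -- second piece
  have t2 : hs (Y * (((u⁻¹ : 𝕄ˣ) : 𝕄) - 1)) (Y * (((u⁻¹ : 𝕄ˣ) : 𝕄) - 1)) ≤ ‖(u : 𝕄) - 1‖ ^ 2 * hs Y Y := by
    refine (hs_mul_right_le _ _).trans ?_
    have : ‖((u⁻¹ : 𝕄ˣ) : 𝕄) - 1‖ ^ 2 ≤ ‖(u : 𝕄) - 1‖ ^ 2 := pow_le_pow_left₀ (norm_nonneg _) hinv 2
    nlinarith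
  rw [hdec]
  refine (hs_add_self_le_two _ _).trans ?_
  linarith

/-- `Ad_{ab} = Ad_a ∘ Ad_b`. [folklore] -/
theorem Ad_mul (a b : 𝕄ˣ) (X : 𝕄) : Ad (a * b) X = Ad a (Ad b X) := by
  unfold Ad
  simp only [Units.val_mul, mul_inv_rev, mul_assoc]

/-- `Ad_a (X − Y) = Ad_a X − Ad_a Y`. [folklore] -/
theorem Ad_sub (a : 𝕄ˣ) (X Y : 𝕄) : Ad a (X - Y) = Ad a X - Ad a Y := by
  unfold Ad
  rw [mul_sub, sub_mul]

/-- `hs` is invariant under `Ad_u` for unitary `u`. [folklore] -/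
theorem hs_Ad_unitary {u : 𝕄ˣ} (hu : u ∈ unitaryUnits 𝕄) (X : 𝕄) : hs (Ad u X) (Ad u X) = hs X X := by
  have hsu : star (u : 𝕄) * (u : 𝕄) = 1 := Unitary.star_mul_self_of_mem (mem_unitaryUnits.mp hu)
  have hstar : ((u⁻¹ : 𝕄ˣ) : 𝕄) = star (u : 𝕄) := Units.inv_eq_of_mul_eq_one_left hsu
  unfold Ad
  rw [hstar, hs_conj hsu]

/-- Unitary units lie in the unit ball `U1` together with their inverses (`N ≥ 1`). [folklore] -/
theorem U1_of_unitaryUnits [Nonempty n] {u : 𝕄ˣ} (hu : u ∈ unitaryUnits 𝕄) : u ∈ B7Prop1Explicit.U1 𝕄 :=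
  ⟨(CStarRing.norm_of_mem_unitary (mem_unitaryUnits.mp hu)).le,
    (CStarRing.norm_of_mem_unitary (mem_unitaryUnits.mp ((unitaryUnits 𝕄).inv_mem hu))).le⟩

omit [DecidableEq n] in
/-- **THE PAIR-VARIANCE IDENTITY** for the Hilbert–Schmidt square (pure bilinearity):
`#s·Σ_k hs(Φ_k, Φ_k) − hs(Σ_k Φ_k, Σ_k Φ_k) = ½·Σ_{k,k'} hs(Φ_k − Φ_{k'}, Φ_k − Φ_{k'})`. [folklore] -/
theorem hs_pair_variance {ι : Type*} (s : Finset ι) (Φ : ι → 𝕄) :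
    (s.card : ℝ) * ∑ k ∈ s, hs (Φ k) (Φ k) - hs (∑ k ∈ s, Φ k) (∑ k ∈ s, Φ k)
      = 1 / 2 * ∑ k ∈ s, ∑ k' ∈ s, hs (Φ k - Φ k') (Φ k - Φ k') := by
  have h1 : ∀ k k', hs (Φ k - Φ k') (Φ k - Φ k') = hs (Φ k) (Φ k) - 2 * hs (Φ k) (Φ k') + hs (Φ k') (Φ k') := by
    intro k k'
    rw [hs_sub_left, hs_sub_right, hs_sub_right, hs_comm (Φ k) (Φ k')]
    ring
  have h2 : hs (∑ k ∈ s, Φ k) (∑ k ∈ s, Φ k) = ∑ k ∈ s, ∑ k' ∈ s, hs (Φ k) (Φ k') := by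
    rw [hs_sum_left]
    exact Finset.sum_congr rfl fun k _ => hs_sum_right s (Φ k) Φ
  simp_rw [h1]
  rw [h2]
  simp only [Finset.sum_add_distrib, Finset.sum_sub_distrib, Finset.sum_const, nsmul_eq_mul]
  simp only [← Finset.mul_sum]
  ring

omit [DecidableEq n] in
/-- The Hilbert–Schmidt square of a difference in real coordinates:
`hs(X − Y, X − Y) = Σ_{(a,b)} [(Re X_ab − Re Y_ab)² + (Im X_ab − Im Y_ab)²]`. [folklore] -/
theorem hs_sub_self_eq_coord (X Y : 𝕄) :
    hs (X - Y) (X - Y)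
      = ∑ c : n × n, (((X c.1 c.2).re - (Y c.1 c.2).re) ^ 2 + ((X c.1 c.2).im - (Y c.1 c.2).im) ^ 2) := by
  rw [hs_self, ← Fintype.sum_prod_type']
  refine Finset.sum_congr rfl fun c _ => ?_
  rw [Matrix.sub_apply, Complex.sq_norm, Complex.normSq_apply, Complex.sub_re, Complex.sub_im]
  ring

end MatrixFactsII

/-! ## §6 The covariant stencil Poincaré inequality: matrix-valued site functions coordinate-wise, the plain
forward differences of the axial-gauge flux against the covariant flux gradient, and the distance of the stencil
sites from the gauge centre -/

section StencilPoincareHS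

open Finset B7Prop1Explicit
open T4AveragingDeficitWall (Ad)
open B7Prop2Explicit (unitaryUnits mem_unitaryUnits)
open T4AveragingDeficitWallBoundary (stencilIdx stencilOff card_stencilIdx fdiff gradSq poincareConst
  poincareConst_nonneg stencil_poincare)

variable {d : ℕ} {n : Type*} [Fintype n] [DecidableEq n]

local notation "𝕄" => Matrix n n ℂ
local notation "Site" => B7Prop1Explicit.Site

omit [DecidableEq n] in
/-- **THE STENCIL POINCARÉ INEQUALITY FOR MATRIX-VALUED SITE FUNCTIONS** (Hilbert–Schmidt square, plain forward
differences): `Σ_{k,k'} hs(Φ(off k) − Φ(off k'), same) ≤ C_P(d,L)·Σ_k Σ_κ hs(Φ(off k + e_κ) − Φ(off k), same)` —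
the scalar `stencil_poincare` applied to each of the `2N²` real coordinates. [folklore] -/
theorem stencil_poincare_hs (L : ℕ) (hL : 1 ≤ L) (Φ : Site d → 𝕄) (μ ν : Fin d) :
    ∑ k ∈ stencilIdx d L, ∑ k' ∈ stencilIdx d L,
        hs (Φ (stencilOff L μ ν k) - Φ (stencilOff L μ ν k')) (Φ (stencilOff L μ ν k) - Φ (stencilOff L μ ν k'))
      ≤ poincareConst d L * ∑ k ∈ stencilIdx d L, ∑ κ : Fin d,
          hs (Φ (stencilOff L μ ν k + e κ) - Φ (stencilOff L μ ν k)) (Φ (stencilOff L μ ν k + e κ) - Φ (stencilOff L μ ν k)) := by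
  -- commuting the coordinate sum with the stencil sums
  have key3 : ∀ f : ((Fin d → Fin L) × (ℕ × ℕ)) → ((Fin d → Fin L) × (ℕ × ℕ)) → n × n → ℝ,
      ∑ k ∈ stencilIdx d L, ∑ k' ∈ stencilIdx d L, ∑ c : n × n, f k k' c
        = ∑ c : n × n, ∑ k ∈ stencilIdx d L, ∑ k' ∈ stencilIdx d L, f k k' c := by
    intro f
    calc ∑ k ∈ stencilIdx d L, ∑ k' ∈ stencilIdx d L, ∑ c : n × n, f k k' c
        = ∑ k ∈ stencilIdx d L, ∑ c : n × n, ∑ k' ∈ stencilIdx d L, f k k' c :=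
          Finset.sum_congr rfl fun k _ => Finset.sum_comm
      _ = ∑ c : n × n, ∑ k ∈ stencilIdx d L, ∑ k' ∈ stencilIdx d L, f k k' c := Finset.sum_comm
  have key2 : ∀ f : ((Fin d → Fin L) × (ℕ × ℕ)) → Fin d → n × n → ℝ,
      ∑ k ∈ stencilIdx d L, ∑ κ : Fin d, ∑ c : n × n, f k κ c
        = ∑ c : n × n, ∑ k ∈ stencilIdx d L, ∑ κ : Fin d, f k κ c := by
    intro f
    calc ∑ k ∈ stencilIdx d L, ∑ κ : Fin d, ∑ c : n × n, f k κ c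
        = ∑ k ∈ stencilIdx d L, ∑ c : n × n, ∑ κ : Fin d, f k κ c :=
          Finset.sum_congr rfl fun k _ => Finset.sum_comm
      _ = ∑ c : n × n, ∑ k ∈ stencilIdx d L, ∑ κ : Fin d, f k κ c := Finset.sum_comm
  simp_rw [hs_sub_self_eq_coord]
  rw [key3, key2, Finset.mul_sum]
  refine Finset.sum_le_sum fun c _ => ?_
  have h1 := stencil_poincare L hL (fun x => (Φ x c.1 c.2).re) μ ν
  have h2 := stencil_poincare L hL (fun x => (Φ x c.1 c.2).im) μ ν
  simp only [gradSq, fdiff] at h1 h2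
  simp only [Finset.sum_add_distrib, mul_add]
  exact add_le_add h1 h2

/-- The stencil sites are within `ℓ¹`-distance `(d+2)L` of the axial gauge centre `z + Le_μ + Le_ν`. [folklore] -/
theorem l1_stencil_sub_centre_le (L : ℕ) (z : Site d) (μ ν : Fin d) {k : (Fin d → Fin L) × (ℕ × ℕ)}
    (hk : k ∈ stencilIdx d L) :
    l1 (z + stencilOff L μ ν k - (z + (L : ℤ) • e μ + (L : ℤ) • e ν)) ≤ (d + 2) * L := by
  have hi : k.2.1 < L := by
    unfold stencilIdx at hk
    simp only [Finset.mem_product, Finset.mem_univ, Finset.mem_range, true_and] at hk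
    exact hk.1
  have hj : k.2.2 < L := by
    unfold stencilIdx at hk
    simp only [Finset.mem_product, Finset.mem_univ, Finset.mem_range, true_and] at hk
    exact hk.2
  have e1 : z + stencilOff L μ ν k - (z + (L : ℤ) • e μ + (L : ℤ) • e ν)
      = boxVec L k.1 + (((k.2.1 : ℤ) - L) • e μ + ((k.2.2 : ℤ) - L) • e ν) := by
    unfold stencilOff
    rw [sub_smul, sub_smul]
    abel
  rw [e1]
  refine (l1_add_le _ _).trans ?_
  have h1 := l1_boxVec_le (L := L) k.1
  have h2 : l1 (((k.2.1 : ℤ) - L) • e μ + ((k.2.2 : ℤ) - L) • e ν) ≤ L + L := by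
    refine (l1_add_le _ _).trans ?_
    rw [l1_zsmul_e, l1_zsmul_e]
    omega
  calc l1 (boxVec L k.1) + l1 (((k.2.1 : ℤ) - L) • e μ + ((k.2.2 : ℤ) - L) • e ν) ≤ d * L + (L + L) :=
        add_le_add h1 h2
    _ = (d + 2) * L := by ring

/-- **THE COVARIANT STEP**: plain forward differences of a gauge-transformed plaquette function against the covariant
gradient — for unitary `u`, `V` and `Φ = Ad_u F`, with `V^u(x,κ) = u(x)V(x,κ)u(x+e_κ)⁻¹` (B7 (8)):
`hs(Φ(x+e_κ) − Φ(x), same) ≤ 2·hs(Ad_{V(x,κ)}F(x+e_κ) − F(x), same) + 8·|V^u(x,κ) − 1|²·hs(F(x+e_κ), same)`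
(`u(x+e_κ) = V^u(x,κ)⁻¹u(x)V(x,κ)`, the `Ad`-defect, the parallelogram bound, unitary invariance of `hs`).
[cite: Balaban1985Averaging, (8) p.18] -/
theorem hs_fdiff_gauge_le [Nonempty n] {V : Site d → Fin d → 𝕄ˣ} (hV : T4AveragingDeficitWall.IsUnitaryCfg V)
    {u : Site d → 𝕄ˣ} (hu : ∀ x, u x ∈ unitaryUnits 𝕄) (F : Site d → 𝕄) (x : Site d) (κ : Fin d) :
    hs (Ad (u (x + e κ)) (F (x + e κ)) - Ad (u x) (F x)) (Ad (u (x + e κ)) (F (x + e κ)) - Ad (u x) (F x))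
      ≤ 2 * hs (Ad (V x κ) (F (x + e κ)) - F x) (Ad (V x κ) (F (x + e κ)) - F x)
        + 8 * ‖((gaugeAct u V x κ : 𝕄ˣ) : 𝕄) - 1‖ ^ 2 * hs (F (x + e κ)) (F (x + e κ)) := by
  set W : 𝕄ˣ := gaugeAct u V x κ with hWdef
  have hW : W = u x * V x κ * (u (x + e κ))⁻¹ := rfl
  have hux : u (x + e κ) = W⁻¹ * (u x * V x κ) := by rw [hW]; group
  set Y : 𝕄 := Ad (u x) (Ad (V x κ) (F (x + e κ))) with hYdef
  have hdec : Ad (u (x + e κ)) (F (x + e κ)) - Ad (u x) (F x)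
      = (Ad W⁻¹ Y - Y) + Ad (u x) (Ad (V x κ) (F (x + e κ)) - F x) := by
    rw [hux, Ad_mul, Ad_mul, Ad_sub]
    abel
  -- `W ∈ U1`: `‖W‖ ≤ 1`, `‖W⁻¹‖ ≤ 1`
  have hWU : W ∈ B7Prop1Explicit.U1 𝕄 :=
    gaugeAct_mem (fun x κ => U1_of_unitaryUnits (hV x κ)) (fun x => U1_of_unitaryUnits (hu x)) x κ
  have hWi : ‖(((W⁻¹)⁻¹ : 𝕄ˣ) : 𝕄)‖ ≤ 1 := by rw [inv_inv]; exact hWU.1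
  have hdef := hs_Ad_sub_self_le hWi Y
  have hinv : ‖((W⁻¹ : 𝕄ˣ) : 𝕄) - 1‖ ≤ ‖(W : 𝕄) - 1‖ := norm_units_inv_sub_one_le hWU.2
  have hY : hs Y Y = hs (F (x + e κ)) (F (x + e κ)) := by
    rw [hYdef, hs_Ad_unitary (hu x), hs_Ad_unitary (hV x κ)]
  have hG : hs (Ad (u x) (Ad (V x κ) (F (x + e κ)) - F x)) (Ad (u x) (Ad (V x κ) (F (x + e κ)) - F x))
      = hs (Ad (V x κ) (F (x + e κ)) - F x) (Ad (V x κ) (F (x + e κ)) - F x) := hs_Ad_unitary (hu x) _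
  have hF0 : 0 ≤ hs (F (x + e κ)) (F (x + e κ)) := hs_self_nonneg _
  have hsq : ‖((W⁻¹ : 𝕄ˣ) : 𝕄) - 1‖ ^ 2 ≤ ‖(W : 𝕄) - 1‖ ^ 2 := pow_le_pow_left₀ (norm_nonneg _) hinv 2
  rw [hdec]
  refine (hs_add_self_le_two _ _).trans ?_
  rw [hG]
  rw [hY] at hdef
  nlinarith [mul_le_mul_of_nonneg_right hsq hF0]

end StencilPoincareHS

/-! ## §7 The coarse plaquette weight from BELOW in the axial gauge, the fine weights from above, the variance form
of the flux average -/

section CoarseLower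

open NormedSpace Finset B7Prop1Explicit B7Prop2Explicit
open T4AveragingDeficitWall (wt Ad flux fhol chol covGrad IsUnitaryCfg SmallField)
open T4AveragingDeficitWallBoundary (stencilIdx stencilOff card_stencilIdx poincareConst poincareConst_nonneg)

variable {d : ℕ} {n : Type*} [Fintype n] [DecidableEq n] [Nonempty n]

local notation "𝕄" => Matrix n n ℂ
local notation "Site" => B7Prop1Explicit.Site

omit [Nonempty n] in
/-- The flux average as a flat sum over the stencil index set: `Θ = L^{−d}·Σ_k F(z + off k)`. [folklore] -/
theorem fluxAvg_eq_sum_idx (L : ℕ) (V : Site d → Fin d → 𝕄ˣ) (z : Site d) (μ ν : Fin d) :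
    fluxAvg L V z μ ν
      = ((((L : ℝ) ^ d)⁻¹ : ℝ) : ℂ) • ∑ k ∈ stencilIdx d L,
          mlog ((hol V (z + stencilOff L μ ν k) (plaqWord μ ν) : 𝕄ˣ) : 𝕄) := by
  unfold fluxAvg stencilIdx
  rw [Finset.smul_sum, Finset.sum_product]
  refine Finset.sum_congr rfl fun r _ => ?_
  rw [← Complex.coe_smul, Finset.smul_sum, Finset.sum_product]
  refine Finset.sum_congr rfl fun i _ => ?_
  rw [Finset.smul_sum]
  refine Finset.sum_congr rfl fun j _ => ?_
  simp only [stencilOff, add_assoc]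

omit [Nonempty n] in
/-- **THE VARIANCE FORM OF THE FLUX AVERAGE** (Jensen's slack made explicit):
`L^{2d}·hs(Θ, Θ) = L^{d+2}·Σ_k hs(F_k, F_k) − ½·Σ_{k,k'} hs(F_k − F_{k'}, same)`, `F_k = log V(∂p_{z + off k})`. [folklore] -/
theorem hs_fluxAvg_variance (L : ℕ) (hL : 1 ≤ L) (V : Site d → Fin d → 𝕄ˣ) (z : Site d) (μ ν : Fin d) :
    ((L : ℝ) ^ d) ^ 2 * hs (fluxAvg L V z μ ν) (fluxAvg L V z μ ν)
      = (L : ℝ) ^ (d + 2) * ∑ k ∈ stencilIdx d L,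
            hs (mlog ((hol V (z + stencilOff L μ ν k) (plaqWord μ ν) : 𝕄ˣ) : 𝕄))
              (mlog ((hol V (z + stencilOff L μ ν k) (plaqWord μ ν) : 𝕄ˣ) : 𝕄))
        - 1 / 2 * ∑ k ∈ stencilIdx d L, ∑ k' ∈ stencilIdx d L,
            hs (mlog ((hol V (z + stencilOff L μ ν k) (plaqWord μ ν) : 𝕄ˣ) : 𝕄)
                  - mlog ((hol V (z + stencilOff L μ ν k') (plaqWord μ ν) : 𝕄ˣ) : 𝕄))
              (mlog ((hol V (z + stencilOff L μ ν k) (plaqWord μ ν) : 𝕄ˣ) : 𝕄)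
                  - mlog ((hol V (z + stencilOff L μ ν k') (plaqWord μ ν) : 𝕄ˣ) : 𝕄)) := by
  have hL' : (0 : ℝ) < L := by exact_mod_cast (by omega : 0 < L)
  have hvar := hs_pair_variance (stencilIdx d L)
    (fun k => mlog ((hol V (z + stencilOff L μ ν k) (plaqWord μ ν) : 𝕄ˣ) : 𝕄))
  rw [card_stencilIdx] at hvar
  push_cast at hvar
  rw [fluxAvg_eq_sum_idx, hs_smul_left, hs_smul_right]
  have hLd : (L : ℝ) ^ d ≠ 0 := pow_ne_zero _ hL'.ne'
  field_simp
  linarith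

/-- **THE FINE WEIGHT FROM ABOVE**: `1 − Re tr V(∂p′) ≤ hs(F, F)/2N`, `F = log V(∂p′)` (`1 − cos t ≤ t²/2`). [folklore] -/
theorem wt_fhol_le {V : Site d → Fin d → 𝕄ˣ} (hV : IsUnitaryCfg V) {a : ℝ} (ha1 : a ≤ 1 / 4)
    (p : T4AveragingDeficitWall.Plaq d) (hp : ‖((fhol V p : 𝕄ˣ) : 𝕄) - 1‖ ≤ a) :
    wt (fhol V p) ≤ hs (flux V p) (flux V p) / (2 * Fintype.card n) := by
  set W : 𝕄 := ((fhol V p : 𝕄ˣ) : 𝕄) with hWdef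
  have hfu : fhol V p ∈ unitaryUnits 𝕄 := hol_mem_of hV _ _
  have hWU : W ∈ Matrix.unitaryGroup n ℂ := mem_unitaryUnits.mp hfu
  have hW1 : ‖W - 1‖ < 1 / 2 := by linarith
  have hXdef : flux V p = mlog W := rfl
  have hXskew : (flux V p)ᴴ = -flux V p := by
    have h := star_mlog_of_unitary hWU hW1
    rwa [Matrix.star_eq_conjTranspose, ← hXdef] at h
  have hexp : NormedSpace.exp (flux V p) = W := by rw [hXdef]; exact exp_mlog (by linarith)
  have h := one_sub_nReTr_exp_le hXskew
  rw [hexp] at h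
  exact h

set_option maxHeartbeats 400000 in
/-- **THE COARSE PLAQUETTE WEIGHT IN THE AXIAL GAUGE, FROM BELOW**: under the hypotheses of `wt_cplaq_axial_le`,
`hs(Θ, Θ)/2N − 9θ³ ≤ 1 − Re tr V̄₀(∂P)`, `θ = 8(d+1)(d+4)L²α₀`.  Chain: `1 − Re tr e^X ≥ hs(X,X)/2N − (5/96)|X|²·
hs(X,X)/N` (spectral, `|X| ≤ 5θ ≤ 1`), `hs(X,X) ≥ hs(Θ,Θ) − 2N|Θ||X − Θ|` (the cross term, `≤ 2N·7.5θ³`), the quartic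
correction `≤ 0.51θ³`. [folklore] -/
theorem wt_cplaq_axial_ge (L : ℕ) (hL : 1 ≤ L) (z y : Site d) {μ ν : Fin d}
    (hy : y = z + (L : ℤ) • e μ + (L : ℤ) • e ν) (V₀ : Site d → Fin d → 𝕄ˣ) {α₀ : ℝ} (hα₀ : 0 ≤ α₀)
    (hsmall : 512 * (d + 1) * (d + 4) * (L : ℝ) ^ 2 * α₀ ≤ 1)
    (h44 : ∀ x, ‖((hol V₀ x (plaqWord μ ν) : 𝕄ˣ) : 𝕄) - 1‖ ≤ α₀)
    (hbond : ∀ x κ, l1 (x - y) ≤ (2 * d + 4) * L + 4 → ‖((V₀ x κ : 𝕄ˣ) : 𝕄) - 1‖ ≤ l1 (x - y) * α₀)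
    (hWu : cplaq L (bavg L V₀) z μ ν ∈ unitaryUnits 𝕄) :
    hs (fluxAvg L V₀ z μ ν) (fluxAvg L V₀ z μ ν) / (2 * Fintype.card n)
        - 9 * (8 * (d + 1) * (d + 4) * (L : ℝ) ^ 2 * α₀) ^ 3
      ≤ wt (cplaq L (bavg L V₀) z μ ν) := by
  have hd : 1 ≤ d := μ.pos
  obtain ⟨hR, hΘ, hW1, hX5⟩ := fluxLinearisation L hL z y hy V₀ hα₀ hsmall h44 hbond
  set θ : ℝ := 8 * (d + 1) * (d + 4) * (L : ℝ) ^ 2 * α₀ with hθdef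
  have hLr : (1 : ℝ) ≤ L := by exact_mod_cast hL
  have hdr : (1 : ℝ) ≤ d := by exact_mod_cast hd
  have hθ0 : 0 ≤ θ := by positivity
  have hθ1 : θ ≤ 1 / 64 := by
    have : 64 * θ = 512 * (d + 1) * (d + 4) * (L : ℝ) ^ 2 * α₀ := by rw [hθdef]; ring
    linarith
  set N : ℝ := (Fintype.card n : ℝ) with hNdef
  have hN : 0 < N := by rw [hNdef]; exact_mod_cast Fintype.card_pos
  set W : 𝕄 := ((cplaq L (bavg L V₀) z μ ν : 𝕄ˣ) : 𝕄) with hWdef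
  set Θ : 𝕄 := fluxAvg L V₀ z μ ν with hΘdef
  set X : 𝕄 := mlog W with hXdef
  have hWU : W ∈ Matrix.unitaryGroup n ℂ := mem_unitaryUnits.mp hWu
  have hW1' : ‖W - 1‖ < 1 / 2 := by linarith
  have hXskew : Xᴴ = -X := by
    have h := star_mlog_of_unitary hWU hW1'
    rwa [Matrix.star_eq_conjTranspose] at h
  have hexp : NormedSpace.exp X = W := exp_mlog (by linarith)
  have hX1 : ‖X‖ ≤ 1 := by linarith
  have h1 : wt (cplaq L (bavg L V₀) z μ ν) = 1 - nReTr (NormedSpace.exp X) := by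
    rw [hexp, hWdef, T4AveragingDeficitWall.wt]
  have hlow := hs_sub_quartic_le_one_sub_nReTr_exp hXskew hX1
  -- the cross term from below
  set R : 𝕄 := X - Θ with hRdef
  have hXe : X = Θ + R := by rw [hRdef]; abel
  have hcross : hs Θ Θ - 2 * N * (‖Θ‖ * ‖R‖) ≤ hs X X := by
    have e1 : hs X X = hs Θ Θ + 2 * hs Θ R + hs R R := by
      rw [hXe, hs_add_left, hs_add_right, hs_add_right, hs_comm Θ R]; ring
    have e2 := (abs_le.mp (abs_hs_le Θ R)).1
    have e3 := hs_self_nonneg R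
    rw [e1]; linarith
  have hΘ' : ‖Θ‖ ≤ θ / 40 := by
    have e1 : θ / 40 - 2 * (L : ℝ) ^ 2 * α₀ = (L : ℝ) ^ 2 * α₀ * (((d : ℝ) - 1) * (d + 6)) / 5 := by
      rw [hθdef]; ring
    have e2 : 0 ≤ (L : ℝ) ^ 2 * α₀ * (((d : ℝ) - 1) * (d + 6)) / 5 := by
      have : 0 ≤ ((d : ℝ) - 1) * (d + 6) := mul_nonneg (by linarith) (by positivity)
      positivity
    linarith
  have hc1 : ‖Θ‖ * ‖R‖ ≤ (θ / 40) * (300 * θ ^ 2) := mul_le_mul hΘ' hR (norm_nonneg _) (by positivity)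
  -- the quartic correction
  have hq1 : hs X X / N ≤ ‖X‖ ^ 2 := by
    rw [div_le_iff₀ hN, mul_comm]; exact hs_self_le_card_mul_norm_sq _
  have hq2 : ‖X‖ ^ 2 ≤ 25 * θ ^ 2 := by nlinarith [norm_nonneg X]
  have hq0 : 0 ≤ hs X X / N := div_nonneg (hs_self_nonneg _) hN.le
  have hq : 5 / 96 * ‖X‖ ^ 2 * (hs X X / N) ≤ 5 / 96 * (625 * θ ^ 4) := by
    have : ‖X‖ ^ 2 * (hs X X / N) ≤ (25 * θ ^ 2) * (25 * θ ^ 2) :=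
      mul_le_mul hq2 (hq1.trans hq2) hq0 (by positivity)
    nlinarith
  have hθ4 : θ ^ 4 ≤ θ ^ 3 / 64 := by
    calc θ ^ 4 = θ ^ 3 * θ := by ring
      _ ≤ θ ^ 3 * (1 / 64) := mul_le_mul_of_nonneg_left hθ1 (by positivity)
      _ = θ ^ 3 / 64 := by ring
  -- divide the cross bound by `2N`
  have hdiv : hs Θ Θ / (2 * N) - ‖Θ‖ * ‖R‖ ≤ hs X X / (2 * N) := by
    have e : hs Θ Θ / (2 * N) - ‖Θ‖ * ‖R‖ = (hs Θ Θ - 2 * N * (‖Θ‖ * ‖R‖)) / (2 * N) := by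
      field_simp
    rw [e]
    exact div_le_div_of_nonneg_right hcross (by positivity)
  have h2N : hs Θ Θ / (2 * (Fintype.card n : ℝ)) = hs Θ Θ / (2 * N) := rfl
  have h2N' : hs X X / (2 * (Fintype.card n : ℝ)) = hs X X / (2 * N) := rfl
  rw [h1]
  rw [h2N'] at hlow
  have hθ3 : 0 ≤ θ ^ 3 := pow_nonneg hθ0 3
  nlinarith [hlow, hdiv, hc1, hq, hθ4, hθ3]

end CoarseLower

/-! ## §8 The lower half on the torus: the stencil flux-gradient bound in the axial gauge, the coarse plaquette from
below against the fine fluxes of its stencil, and `−𝓓 ≤ 2·C_low·‖∇_V F‖² + C·a³·M^d` -/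

section TorusLower

open NormedSpace Finset B7Prop1Explicit B7Prop2Explicit
open T4AveragingDeficitWall hiding Site
open T4AveragingDeficitWallBoundary (IsPeriodicCfg periodBox blockSites_periodBox sum_blocks_eq sum_periodBox_shift
  card_periodBox zpow_sub_four_eq stencilIdx stencilOff card_stencilIdx poincareConst poincareConst_nonneg
  sum_stencilIdx_eq lowerConst lowerConst_nonneg)

variable {d : ℕ} {n : Type*} [Fintype n] [DecidableEq n] [Nonempty n]

local notation "𝕄" => Matrix n n ℂ
local notation "Site" => B7Prop1Explicit.Site

omit [Fintype n] [DecidableEq n] [Nonempty n] in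
/-- Stencil sums, flat vs nested: `Σ_{k} g(z + off k) = Σ_r Σ_{i<L} Σ_{j<L} g(z + r + ie_μ + je_ν)`. [folklore] -/
theorem sum_stencil_eq (L : ℕ) (g : Site d → ℝ) (z : Site d) (μ ν : Fin d) :
    ∑ k ∈ stencilIdx d L, g (z + stencilOff L μ ν k)
      = ∑ r : Fin d → Fin L, ∑ i ∈ range L, ∑ j ∈ range L, g (z + boxVec L r + (i : ℤ) • e μ + (j : ℤ) • e ν) := by
  rw [← sum_stencilIdx_eq L (fun r i j => g (z + boxVec L r + (i : ℤ) • e μ + (j : ℤ) • e ν))]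
  refine Finset.sum_congr rfl fun k _ => ?_
  simp only [stencilOff, add_assoc]

set_option maxHeartbeats 800000 in
/-- **THE STENCIL FLUX-GRADIENT BOUND IN THE AXIAL GAUGE**: for a `U(N)`-valued small-field `V`, the coarse plaquette
based at `z = Ly` in the plane `π = (μ,ν)`, the axial gauge `u` centred at `z + Le_μ + Le_ν` and the gauge-transformed
fluxes `Φ(x) = log V^u(∂p_{x,π}) = Ad_{u(x)}F(x;π)`, the stencil pair variance is controlled by the COVARIANT flux
gradient: `Σ_{k,k'} hs(Φ(z+off k) − Φ(z+off k'), same) ≤ C_P·[2·Σ_kΣ_κ hs(∇_V F(z+off k,κ;π), same) + L^{d+2}·d·32(d+2)²L²N·a⁴]`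
(`stencil_poincare_hs`, `hs_fdiff_gauge_le`, the axial bond bound `|V^u(b) − 1| ≤ |b₋ − y_c|₁·a ≤ (d+2)L·a`,
`hs(F,F) ≤ N|F|² ≤ 4Na²`). [cite: Balaban1985Averaging, pp.24–25] -/
theorem stencil_grad_bound (L : ℕ) (hL : 1 ≤ L) {V : Site d → Fin d → 𝕄ˣ} (hV : IsUnitaryCfg V) {a : ℝ} (ha : 0 ≤ a)
    (ha1 : a ≤ 1 / 4) (hVa : SmallField V a) (y : Site d) (π : Plane d) :
    let z : Site d := (L : ℤ) • y
    let V₀ : Site d → Fin d → 𝕄ˣ := gaugeAct (axialFn V (z + (L : ℤ) • e π.1.1 + (L : ℤ) • e π.1.2)) V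
    ∑ k ∈ stencilIdx d L, ∑ k' ∈ stencilIdx d L,
        hs (mlog ((hol V₀ (z + stencilOff L π.1.1 π.1.2 k) (plaqWord π.1.1 π.1.2) : 𝕄ˣ) : 𝕄)
              - mlog ((hol V₀ (z + stencilOff L π.1.1 π.1.2 k') (plaqWord π.1.1 π.1.2) : 𝕄ˣ) : 𝕄))
          (mlog ((hol V₀ (z + stencilOff L π.1.1 π.1.2 k) (plaqWord π.1.1 π.1.2) : 𝕄ˣ) : 𝕄)
              - mlog ((hol V₀ (z + stencilOff L π.1.1 π.1.2 k') (plaqWord π.1.1 π.1.2) : 𝕄ˣ) : 𝕄))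
      ≤ poincareConst d L * (2 * ∑ k ∈ stencilIdx d L, ∑ κ : Fin d,
            hs (covGrad V (flux V) (z + stencilOff L π.1.1 π.1.2 k) κ π) (covGrad V (flux V) (z + stencilOff L π.1.1 π.1.2 k) κ π)
          + (L : ℝ) ^ (d + 2) * d * (32 * (((d : ℝ) + 2) * L) ^ 2 * Fintype.card n * a ^ 4)) := by
  intro z V₀
  letI : CStarAlgebra 𝕄 := {}
  set μ : Fin d := π.1.1 with hμdef
  set ν : Fin d := π.1.2 with hνdef
  have hμν : μ ≠ ν := ne_of_lt π.2
  set yc : Site d := z + (L : ℤ) • e μ + (L : ℤ) • e ν with hycdef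
  set u : Site d → 𝕄ˣ := axialFn V yc with hudef
  have hV₀def : V₀ = gaugeAct u V := rfl
  set N : ℝ := (Fintype.card n : ℝ) with hNdef
  have hN : 0 < N := by rw [hNdef]; exact_mod_cast Fintype.card_pos
  have hU : ∀ x κ, V x κ ∈ U1 𝕄 := fun x κ => U1_of_unitaryUnits (hV x κ)
  have huU : ∀ x, u x ∈ U1 𝕄 := fun x => axialFn_mem hU yc x
  have huu : ∀ x, u x ∈ unitaryUnits 𝕄 := fun x => hol_mem_of hV _ _
  -- the gauge-transformed fluxes are `Ad_u F`
  set Φ : Site d → 𝕄 := fun x => mlog ((hol V₀ x (plaqWord μ ν) : 𝕄ˣ) : 𝕄) with hΦdef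
  set F : Site d → 𝕄 := fun x => flux V (x, π) with hFdef
  have hΦ : ∀ x, Φ x = Ad (u x) (F x) := by
    intro x
    have hx1 : ‖((hol V x (plaqWord μ ν) : 𝕄ˣ) : 𝕄) - 1‖ < 1 := by linarith [hVa x μ ν hμν]
    simp only [hΦdef, hFdef]
    rw [hV₀def, hol_gaugeAct_closed _ _ _ _ (disp_plaqWord μ ν), Units.val_mul, Units.val_mul,
      mlog_units_conj (huU x) hx1]
    rfl
  -- the matrix stencil Poincaré inequality for `x ↦ Φ(z + x)`
  have hP := stencil_poincare_hs L hL (fun x => Φ (z + x)) μ ν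
  refine hP.trans (mul_le_mul_of_nonneg_left ?_ (poincareConst_nonneg d L))
  -- per stencil site and direction: the covariant step
  have hflux : ∀ x, hs (F x) (F x) ≤ N * (2 * a) ^ 2 := by
    intro x
    have hb : ‖((hol V x (plaqWord μ ν) : 𝕄ˣ) : 𝕄) - 1‖ ≤ a := hVa x μ ν hμν
    have hn : ‖F x‖ ≤ 2 * a := by
      simp only [hFdef, flux, fhol]
      exact (norm_mlog_le_two_mul (by linarith)).trans (by linarith)
    refine (hs_self_le_card_mul_norm_sq _).trans (mul_le_mul_of_nonneg_left ?_ hN.le)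
    exact pow_le_pow_left₀ (norm_nonneg _) hn 2
  have hstep : ∀ k ∈ stencilIdx d L, ∀ κ : Fin d,
      hs (Φ (z + (stencilOff L μ ν k + e κ)) - Φ (z + stencilOff L μ ν k))
          (Φ (z + (stencilOff L μ ν k + e κ)) - Φ (z + stencilOff L μ ν k))
        ≤ 2 * hs (covGrad V (flux V) (z + stencilOff L μ ν k) κ π) (covGrad V (flux V) (z + stencilOff L μ ν k) κ π)
          + 32 * (((d : ℝ) + 2) * L) ^ 2 * N * a ^ 4 := by
    intro k hk κ
    set x₀ : Site d := z + stencilOff L μ ν k with hx₀def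
    have e1 : z + (stencilOff L μ ν k + e κ) = x₀ + e κ := by rw [hx₀def, add_assoc]
    rw [e1, hΦ, hΦ]
    have h1 := hs_fdiff_gauge_le hV huu F x₀ κ
    have hcov : Ad (V x₀ κ) (F (x₀ + e κ)) - F x₀ = covGrad V (flux V) x₀ κ π := rfl
    rw [hcov] at h1
    refine h1.trans (add_le_add le_rfl ?_)
    -- the transport defect: `|V^u(x₀,κ) − 1| ≤ (d+2)L·a`, `hs(F,F) ≤ 4Na²`
    have hb1 : ‖((gaugeAct u V x₀ κ : 𝕄ˣ) : 𝕄) - 1‖ ≤ l1 (x₀ - yc) * a := by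
      rw [hudef]; exact axial_bond_bound V hU yc hVa ha x₀ κ
    have hl1 : (l1 (x₀ - yc) : ℝ) ≤ ((d : ℝ) + 2) * L := by
      have := l1_stencil_sub_centre_le L z μ ν hk
      rw [← hycdef, ← hx₀def] at this
      exact_mod_cast this
    have hb2 : ‖((gaugeAct u V x₀ κ : 𝕄ˣ) : 𝕄) - 1‖ ≤ ((d : ℝ) + 2) * L * a :=
      hb1.trans (mul_le_mul_of_nonneg_right hl1 ha)
    have hb3 : ‖((gaugeAct u V x₀ κ : 𝕄ˣ) : 𝕄) - 1‖ ^ 2 ≤ (((d : ℝ) + 2) * L * a) ^ 2 :=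
      pow_le_pow_left₀ (norm_nonneg _) hb2 2
    have hF' := hflux (x₀ + e κ)
    have hF0 : 0 ≤ hs (F (x₀ + e κ)) (F (x₀ + e κ)) := hs_self_nonneg _
    calc 8 * ‖((gaugeAct u V x₀ κ : 𝕄ˣ) : 𝕄) - 1‖ ^ 2 * hs (F (x₀ + e κ)) (F (x₀ + e κ))
        ≤ 8 * (((d : ℝ) + 2) * L * a) ^ 2 * (N * (2 * a) ^ 2) :=
          mul_le_mul (mul_le_mul_of_nonneg_left hb3 (by norm_num)) hF' hF0 (by positivity)
      _ = 32 * (((d : ℝ) + 2) * L) ^ 2 * N * a ^ 4 := by ring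
  calc ∑ k ∈ stencilIdx d L, ∑ κ : Fin d,
        hs (Φ (z + (stencilOff L μ ν k + e κ)) - Φ (z + stencilOff L μ ν k))
          (Φ (z + (stencilOff L μ ν k + e κ)) - Φ (z + stencilOff L μ ν k))
      ≤ ∑ k ∈ stencilIdx d L, ∑ κ : Fin d,
          (2 * hs (covGrad V (flux V) (z + stencilOff L μ ν k) κ π) (covGrad V (flux V) (z + stencilOff L μ ν k) κ π)
            + 32 * (((d : ℝ) + 2) * L) ^ 2 * N * a ^ 4) :=
        Finset.sum_le_sum fun k hk => Finset.sum_le_sum fun κ _ => hstep k hk κ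
    _ = 2 * ∑ k ∈ stencilIdx d L, ∑ κ : Fin d,
            hs (covGrad V (flux V) (z + stencilOff L μ ν k) κ π) (covGrad V (flux V) (z + stencilOff L μ ν k) κ π)
          + (L : ℝ) ^ (d + 2) * d * (32 * (((d : ℝ) + 2) * L) ^ 2 * N * a ^ 4) := by
        simp only [Finset.sum_add_distrib, Finset.sum_const, Finset.card_univ, Fintype.card_fin, nsmul_eq_mul,
          Finset.mul_sum, card_stencilIdx]
        push_cast
        ring

set_option maxHeartbeats 800000 in
/-- **THE COARSE PLAQUETTE FROM BELOW AGAINST THE FINE FLUXES OF ITS STENCIL** (general `U(N)`-valued small-field `V`,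
coarse plaquette `(y; π)`): with `c₁ = L^{d−4}`, `S = Σ_k hs(F(Ly + off k; π), same)`,
`(L^{−2}/2N)·S − L^{d−4}·(1 − Re tr V̄(∂P)) ≤ (L^{−d−4}/4N)·C_P·[2·Σ_kΣ_κ hs(∇_V F(Ly+off k,κ;π), same) + L^{d+2}d·32(d+2)²L²N a⁴]
+ L^{d−4}·9θ³` — the gauge step (45) to the axial gauge (`cplaq_conj`, `bavg_gaugeAct`), `wt_cplaq_axial_ge`, the variance
form `hs_fluxAvg_variance` (the fluxes pull back by (11), `hs` is `Ad`-invariant) and `stencil_grad_bound`.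
[cite: Balaban1985Averaging, (45) p.24, (11) p.19] -/
theorem coarse_ge_y (L : ℕ) (hL : 1 ≤ L) {V : Site d → Fin d → 𝕄ˣ} (hV : IsUnitaryCfg V) {a : ℝ} (ha : 0 ≤ a)
    (hsmall : 512 * (d + 1) * (d + 4) * (L : ℝ) ^ 2 * a ≤ 1) (hVa : SmallField V a) (y : Site d) (π : Plane d) :
    ((L : ℝ) ^ 2)⁻¹ / (2 * Fintype.card n) *
          ∑ k ∈ stencilIdx d L, hs (flux V ((L : ℤ) • y + stencilOff L π.1.1 π.1.2 k, π))
            (flux V ((L : ℤ) • y + stencilOff L π.1.1 π.1.2 k, π))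
        - (L : ℝ) ^ ((d : ℤ) - 4) * wt (chol L V (y, π))
      ≤ ((L : ℝ) ^ d)⁻¹ / (L : ℝ) ^ 4 / (4 * Fintype.card n) *
          (poincareConst d L * (2 * ∑ k ∈ stencilIdx d L, ∑ κ : Fin d,
              hs (covGrad V (flux V) ((L : ℤ) • y + stencilOff L π.1.1 π.1.2 k) κ π)
                (covGrad V (flux V) ((L : ℤ) • y + stencilOff L π.1.1 π.1.2 k) κ π)
            + (L : ℝ) ^ (d + 2) * d * (32 * (((d : ℝ) + 2) * L) ^ 2 * Fintype.card n * a ^ 4)))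
        + (L : ℝ) ^ ((d : ℤ) - 4) * (9 * (8 * (d + 1) * (d + 4) * (L : ℝ) ^ 2 * a) ^ 3) := by
  have hPB := stencil_grad_bound L hL hV ha ((small_a_le hL π.1.1.pos ha hsmall).trans (by norm_num)) hVa y π
  letI : CStarAlgebra 𝕄 := {}
  set μ : Fin d := π.1.1 with hμdef
  set ν : Fin d := π.1.2 with hνdef
  have hμν : μ ≠ ν := ne_of_lt π.2
  have hd : 1 ≤ d := μ.pos
  set z : Site d := (L : ℤ) • y with hzdef
  set yc : Site d := z + (L : ℤ) • e μ + (L : ℤ) • e ν with hycdef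
  set u : Site d → 𝕄ˣ := axialFn V yc with hudef
  set V₀ : Site d → Fin d → 𝕄ˣ := gaugeAct u V with hV₀def
  set N : ℝ := (Fintype.card n : ℝ) with hNdef
  have hN : 0 < N := by rw [hNdef]; exact_mod_cast Fintype.card_pos
  have hL0 : (0 : ℝ) < L := by exact_mod_cast (by omega : 0 < L)
  have ha1 : a ≤ 1 / 4 := (small_a_le hL hd ha hsmall).trans (by norm_num)
  have hU : ∀ x κ, V x κ ∈ U1 𝕄 := fun x κ => U1_of_unitaryUnits (hV x κ)
  have huU : ∀ x, u x ∈ U1 𝕄 := fun x => axialFn_mem hU yc x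
  have huu : ∀ x, u x ∈ unitaryUnits 𝕄 := fun x => hol_mem_of hV _ _
  have h44₀ : ∀ x, ‖((hol V₀ x (plaqWord μ ν) : 𝕄ˣ) : 𝕄) - 1‖ ≤ a := fun x => by
    rw [hV₀def, hol_gaugeAct_closed _ _ _ _ (disp_plaqWord μ ν), Units.val_mul, Units.val_mul]
    exact (norm_units_conj_sub_one_le (huU x) _).trans (hVa x μ ν hμν)
  have hbond : ∀ x κ, l1 (x - yc) ≤ (2 * d + 4) * L + 4 → ‖((V₀ x κ : 𝕄ˣ) : 𝕄) - 1‖ ≤ l1 (x - yc) * a :=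
    fun x κ _ => axial_bond_bound V hU yc hVa ha x κ
  have hWle : ∀ (q : Site d) (κ : Fin d) (r : Fin d → Fin L),
      ‖((Wcx L V q κ (boxVec L r) : 𝕄ˣ) : 𝕄) - 1‖ ≤ 1 / 4 := fun q κ r =>
    (norm_Wcx_sub_one_le L hL V hU ha hsmall hVa q κ r).trans (by linarith)
  have hWlt : ∀ (q : Site d) (κ : Fin d) (r : Fin d → Fin L),
      ‖((Wcx L V q κ (boxVec L r) : 𝕄ˣ) : 𝕄) - 1‖ < 1 := fun q κ r => by linarith [hWle q κ r]
  have hcov : ∀ (q : Site d) (κ : Fin d), bavg L V₀ q κ = u q * bavg L V q κ * (u (q + (L : ℤ) • e κ))⁻¹ :=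
    fun q κ => by rw [hV₀def]; exact bavg_gaugeAct L huU V q κ (hWlt q κ)
  have hconj : cplaq L (bavg L V₀) z μ ν = u z * cplaq L (bavg L V) z μ ν * (u z)⁻¹ :=
    cplaq_conj L u (bavg L V) (bavg L V₀) z μ ν (hcov z μ) (hcov _ ν) (hcov _ μ) (hcov z ν)
  have hbu : ∀ (q : Site d) (κ : Fin d), bavg L V q κ ∈ unitaryUnits 𝕄 := fun q κ =>
    bavg_mem_unitaryUnits (fun x κ' => hV x κ') L q κ (hWle q κ)
  have hcholu : cplaq L (bavg L V) z μ ν ∈ unitaryUnits 𝕄 := by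
    unfold cplaq
    exact mul_mem (mul_mem (mul_mem (hbu _ _) (hbu _ _)) (inv_mem (hbu _ _))) (inv_mem (hbu _ _))
  have hWu : cplaq L (bavg L V₀) z μ ν ∈ unitaryUnits 𝕄 := by
    rw [hconj]
    exact mul_mem (mul_mem (huu z) hcholu) (inv_mem (huu z))
  -- §7 in the axial gauge
  have key := wt_cplaq_axial_ge L hL z yc rfl V₀ ha hsmall h44₀ hbond hWu
  have hwt : wt (chol L V (y, π)) = wt (cplaq L (bavg L V₀) z μ ν) := by
    show wt (cplaq L (bavg L V) z μ ν) = _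
    rw [hconj, T4AveragingDeficitWall.wt, T4AveragingDeficitWall.wt, Units.val_mul, Units.val_mul,
      nReTr_conj (Units.inv_mul (u z))]
  -- the fluxes pull back by (11)
  have hF : ∀ x : Site d,
      hs (mlog ((hol V₀ x (plaqWord μ ν) : 𝕄ˣ) : 𝕄)) (mlog ((hol V₀ x (plaqWord μ ν) : 𝕄ˣ) : 𝕄))
        = hs (flux V (x, π)) (flux V (x, π)) := by
    intro x
    have hx1 : ‖((hol V x (plaqWord μ ν) : 𝕄ˣ) : 𝕄) - 1‖ < 1 := by linarith [hVa x μ ν hμν]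
    have hsu : star ((u x : 𝕄ˣ) : 𝕄) * ((u x : 𝕄ˣ) : 𝕄) = 1 :=
      Unitary.star_mul_self_of_mem (mem_unitaryUnits.mp (huu x))
    have hstar : (((u x)⁻¹ : 𝕄ˣ) : 𝕄) = star ((u x : 𝕄ˣ) : 𝕄) := Units.inv_eq_of_mul_eq_one_left hsu
    rw [hV₀def, hol_gaugeAct_closed _ _ _ _ (disp_plaqWord μ ν), Units.val_mul, Units.val_mul,
      mlog_units_conj (huU x) hx1, hstar, hs_conj hsu]
    rfl
  have hS : ∑ k ∈ stencilIdx d L,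
        hs (mlog ((hol V₀ (z + stencilOff L μ ν k) (plaqWord μ ν) : 𝕄ˣ) : 𝕄))
          (mlog ((hol V₀ (z + stencilOff L μ ν k) (plaqWord μ ν) : 𝕄ˣ) : 𝕄))
      = ∑ k ∈ stencilIdx d L, hs (flux V (z + stencilOff L μ ν k, π)) (flux V (z + stencilOff L μ ν k, π)) :=
    Finset.sum_congr rfl fun k _ => hF _
  -- the variance form
  have hvar := hs_fluxAvg_variance L hL V₀ z μ ν
  -- abbreviations
  set T : ℝ := hs (fluxAvg L V₀ z μ ν) (fluxAvg L V₀ z μ ν) with hTdef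
  set S : ℝ := ∑ k ∈ stencilIdx d L, hs (flux V (z + stencilOff L μ ν k, π)) (flux V (z + stencilOff L μ ν k, π))
    with hSdef
  set B : ℝ := poincareConst d L * (2 * ∑ k ∈ stencilIdx d L, ∑ κ : Fin d,
      hs (covGrad V (flux V) (z + stencilOff L μ ν k) κ π) (covGrad V (flux V) (z + stencilOff L μ ν k) κ π)
        + (L : ℝ) ^ (d + 2) * d * (32 * (((d : ℝ) + 2) * L) ^ 2 * N * a ^ 4)) with hBdef
  have h1 : (L : ℝ) ^ (d + 2) * S - 1 / 2 * B ≤ ((L : ℝ) ^ d) ^ 2 * T := by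
    rw [hTdef, hvar, hS]
    linarith [hPB]
  set c₁ : ℝ := (L : ℝ) ^ ((d : ℤ) - 4) with hc₁def
  have hzpow : c₁ = (L : ℝ) ^ d / (L : ℝ) ^ 4 := zpow_sub_four_eq L hL
  have hc₁ : 0 ≤ c₁ := by rw [hzpow]; positivity
  have hLd : ((L : ℝ) ^ d) ^ 2 ≠ 0 := by positivity
  have i1 : ((L : ℝ) ^ (d + 2) * S - 1 / 2 * B) / (((L : ℝ) ^ d) ^ 2 * (2 * N)) ≤ T / (2 * N) := by
    have e : T / (2 * N) = ((L : ℝ) ^ d) ^ 2 * T / (((L : ℝ) ^ d) ^ 2 * (2 * N)) := by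
      rw [mul_div_mul_left _ _ hLd]
    rw [e]
    exact div_le_div_of_nonneg_right h1 (by positivity)
  have i2 := mul_le_mul_of_nonneg_left i1 hc₁
  have e2 : c₁ * (((L : ℝ) ^ (d + 2) * S - 1 / 2 * B) / (((L : ℝ) ^ d) ^ 2 * (2 * N)))
      = ((L : ℝ) ^ 2)⁻¹ / (2 * N) * S - ((L : ℝ) ^ d)⁻¹ / (L : ℝ) ^ 4 / (4 * N) * B := by
    rw [hzpow, pow_add]
    field_simp
    ring
  rw [e2] at i2
  have key' : c₁ * (T / (2 * N)) - c₁ * (9 * (8 * (d + 1) * (d + 4) * (L : ℝ) ^ 2 * a) ^ 3)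
      ≤ c₁ * wt (chol L V (y, π)) := by
    rw [← mul_sub, hwt]
    exact mul_le_mul_of_nonneg_left key hc₁
  linarith

variable (d) in
/-- The `a³`-constant of the lower half of β′-per: `#planes · (9·512·(d+1)³(d+4)³·L^{d+2} + C_P·d·(d+2)²/64)`. [folklore] -/
def lowerConstNA (L : ℕ) : ℝ :=
  (Fintype.card (Plane d) : ℝ) * (4608 * ((d : ℝ) + 1) ^ 3 * ((d : ℝ) + 4) ^ 3 * (L : ℝ) ^ (d + 2)
    + poincareConst d L * d * ((d : ℝ) + 2) ^ 2 / 64)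

omit [Fintype n] [DecidableEq n] [Nonempty n] in
/-- `0 ≤ lowerConstNA d L`. [folklore] -/
theorem lowerConstNA_nonneg (L : ℕ) : 0 ≤ lowerConstNA d L := by
  unfold lowerConstNA; have := poincareConst_nonneg d L; positivity

set_option maxHeartbeats 800000 in
/-- **THE LOWER HALF OF β′-per FOR GENERAL `U(N)`-VALUED DATA, kernel-checked**: for `L, M ≥ 1`, every `U(N)`-valued
`V` of period `LM` with (44) `|V(∂p′) − 1| ≤ a` and `512(d+1)(d+4)L²a ≤ 1`,
`−𝓓 ≤ 2·C_low(d,L)·‖∇_V F‖²_{ℓ²([0,LM)^d)} + lowerConstNA(d,L)·a³·M^d` — the fine action exceeds `L^{d−4}×` the coarse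
one by at most the COVARIANT flux-gradient energy (the discrete Poincaré inequality on the `L^{d+2}`-point stencils, in
the axial gauge of each coarse plaquette, with the parallel-transport defect `O(L²a²)·hs(F,F) = O(a⁴)` of the gauge
comparison absorbed into the `a³`-term) plus `O(a³)` from the cubic remainder of (38) and the quartic weight
corrections.  Together with `deficit_torus_le` this is the two-sided value wall `DeficitValueWallPer`. [folklore] -/
theorem deficit_torus_ge (L M : ℕ) (hL : 1 ≤ L) (hM : 1 ≤ M) {V : Site d → Fin d → 𝕄ˣ} (hV : IsUnitaryCfg V)
    (hP : IsPeriodicCfg V ((L : ℤ) * M)) {a : ℝ} (ha : 0 ≤ a)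
    (hsmall : 512 * (d + 1) * (d + 4) * (L : ℝ) ^ 2 * a ≤ 1) (hVa : SmallField V a) :
    -deficit L V (blockWindow L (periodBox M))
      ≤ 2 * lowerConst d L * gradFluxSq V (blockSites L (periodBox M)) + lowerConstNA d L * a ^ 3 * (M : ℝ) ^ d := by
  set N : ℝ := (Fintype.card n : ℝ) with hNdef
  have hN : 0 < N := by rw [hNdef]; exact_mod_cast Fintype.card_pos
  have hL0 : (0 : ℝ) < L := by exact_mod_cast (by omega : 0 < L)
  set θ : ℝ := 8 * (d + 1) * (d + 4) * (L : ℝ) ^ 2 * a with hθdef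
  have hθ0 : 0 ≤ θ := by positivity
  have hcardY : ((periodBox (d := d) M).card : ℝ) = (M : ℝ) ^ d := by
    rw [card_periodBox]; push_cast; ring
  set c₁ : ℝ := (L : ℝ) ^ ((d : ℤ) - 4) with hc₁def
  have hzpow : c₁ = (L : ℝ) ^ d / (L : ℝ) ^ 4 := zpow_sub_four_eq L hL
  have hc₁ : 0 ≤ c₁ := by rw [hzpow]; positivity
  set c₂ : ℝ := ((L : ℝ) ^ 2)⁻¹ / (2 * N) with hc₂def
  set c₃ : ℝ := ((L : ℝ) ^ d)⁻¹ / (L : ℝ) ^ 4 / (4 * N) with hc₃def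
  have hc₃ : 0 ≤ c₃ := by positivity
  set CP : ℝ := poincareConst d L with hCPdef
  have hCP : 0 ≤ CP := poincareConst_nonneg d L
  set E : ℝ := (L : ℝ) ^ (d + 2) * d * (32 * (((d : ℝ) + 2) * L) ^ 2 * N * a ^ 4) with hEdef
  -- the per-plane estimate
  have hplane : ∀ π : Plane d,
      ∑ x ∈ blockSites L (periodBox M), wt (fhol V (x, π))
          - c₁ * ∑ y ∈ periodBox M, wt (chol L V (y, π))
        ≤ 2 * lowerConst d L * ∑ x ∈ blockSites L (periodBox M), ∑ κ : Fin d, ‖covGrad V (flux V) x κ π‖ ^ 2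
          + (4608 * ((d : ℝ) + 1) ^ 3 * ((d : ℝ) + 4) ^ 3 * (L : ℝ) ^ (d + 2) + CP * d * ((d : ℝ) + 2) ^ 2 / 64)
            * a ^ 3 * (M : ℝ) ^ d := by
    intro π
    have hμν : π.1.1 ≠ π.1.2 := ne_of_lt π.2
    have hd : 1 ≤ d := π.1.1.pos
    have ha512 : a ≤ 1 / 512 := small_a_le hL hd ha hsmall
    have ha1 : a ≤ 1 / 4 := ha512.trans (by norm_num)
    set q : Site d → ℝ := fun x => hs (flux V (x, π)) (flux V (x, π)) with hqdef
    set g : Site d → ℝ := fun x => ∑ κ : Fin d, hs (covGrad V (flux V) x κ π) (covGrad V (flux V) x κ π) with hgdef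
    -- periodicity of `q` and `g`
    have hholP : ∀ (x : Site d) (κ : Fin d),
        hol V (x + ((L * M : ℕ) : ℤ) • e κ) (plaqWord π.1.1 π.1.2) = hol V x (plaqWord π.1.1 π.1.2) := by
      intro x κ
      have := hol_add_period hP κ (plaqWord π.1.1 π.1.2) x
      push_cast at this ⊢
      exact this
    have hVP : ∀ (x : Site d) (κ κ' : Fin d), V (x + ((L * M : ℕ) : ℤ) • e κ') κ = V x κ := by
      intro x κ κ'
      have := hP x κ' κ
      push_cast at this ⊢
      exact this
    have hqper : ∀ (x : Site d) (κ : Fin d), q (x + ((L * M : ℕ) : ℤ) • e κ) = q x := by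
      intro x κ
      simp only [hqdef, flux, fhol, hholP]
    have hgper : ∀ (x : Site d) (κ' : Fin d), g (x + ((L * M : ℕ) : ℤ) • e κ') = g x := by
      intro x κ'
      have h2 : ∀ κ : Fin d, hol V (x + ((L * M : ℕ) : ℤ) • e κ' + e κ) (plaqWord π.1.1 π.1.2)
          = hol V (x + e κ) (plaqWord π.1.1 π.1.2) := by
        intro κ; rw [add_right_comm]; exact hholP _ _
      simp only [hgdef, covGrad, flux, fhol, hholP, h2, hVP]
    set Q : ℝ := ∑ x ∈ blockSites L (periodBox M), q x with hQdef
    set G : ℝ := ∑ x ∈ blockSites L (periodBox M), g x with hGdef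
    set G' : ℝ := ∑ x ∈ blockSites L (periodBox M), ∑ κ : Fin d, ‖covGrad V (flux V) x κ π‖ ^ 2 with hG'def
    -- `hs ≤ N·|·|²`
    have hGG' : G ≤ N * G' := by
      rw [hGdef, hG'def, Finset.mul_sum]
      refine Finset.sum_le_sum fun x _ => ?_
      rw [hgdef, Finset.mul_sum]
      exact Finset.sum_le_sum fun κ _ => hs_self_le_card_mul_norm_sq _
    -- the covering identities
    have hcovQ : ∑ y ∈ periodBox M, ∑ k ∈ stencilIdx d L, q ((L : ℤ) • y + stencilOff L π.1.1 π.1.2 k)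
        = (L : ℝ) ^ 2 * Q := by
      rw [Finset.sum_congr rfl fun y _ => sum_stencil_eq L q ((L : ℤ) • y) π.1.1 π.1.2]
      exact sum_stencil_periodBox L M hL hM hqper π.1.1 π.1.2
    have hcovG : ∑ y ∈ periodBox M, ∑ k ∈ stencilIdx d L, g ((L : ℤ) • y + stencilOff L π.1.1 π.1.2 k)
        = (L : ℝ) ^ 2 * G := by
      rw [Finset.sum_congr rfl fun y _ => sum_stencil_eq L g ((L : ℤ) • y) π.1.1 π.1.2]
      exact sum_stencil_periodBox L M hL hM hgper π.1.1 π.1.2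
    -- fine side from above
    have hfine : ∑ x ∈ blockSites L (periodBox M), wt (fhol V (x, π)) ≤ Q / (2 * N) := by
      calc ∑ x ∈ blockSites L (periodBox M), wt (fhol V (x, π))
          ≤ ∑ x ∈ blockSites L (periodBox M), q x / (2 * N) :=
            Finset.sum_le_sum fun x _ => wt_fhol_le hV ha1 (x, π) (hVa x π.1.1 π.1.2 hμν)
        _ = Q / (2 * N) := by rw [hQdef, Finset.sum_div]
    -- coarse side from below, summed over the coarse plaquettes of the plane
    have hy : ∀ y ∈ periodBox M,
        c₂ * ∑ k ∈ stencilIdx d L, q ((L : ℤ) • y + stencilOff L π.1.1 π.1.2 k) - c₁ * wt (chol L V (y, π))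
          ≤ c₃ * (CP * (2 * ∑ k ∈ stencilIdx d L, g ((L : ℤ) • y + stencilOff L π.1.1 π.1.2 k) + E))
            + c₁ * (9 * θ ^ 3) :=
      fun y _ => coarse_ge_y L hL hV ha hsmall hVa y π
    have hsum := Finset.sum_le_sum hy
    have lhs_eq : ∑ y ∈ periodBox M,
        (c₂ * ∑ k ∈ stencilIdx d L, q ((L : ℤ) • y + stencilOff L π.1.1 π.1.2 k) - c₁ * wt (chol L V (y, π)))
          = c₂ * ((L : ℝ) ^ 2 * Q) - c₁ * ∑ y ∈ periodBox M, wt (chol L V (y, π)) := by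
      rw [Finset.sum_sub_distrib, ← Finset.mul_sum, ← Finset.mul_sum, hcovQ]
    have rhs_eq : ∑ y ∈ periodBox M,
        (c₃ * (CP * (2 * ∑ k ∈ stencilIdx d L, g ((L : ℤ) • y + stencilOff L π.1.1 π.1.2 k) + E))
          + c₁ * (9 * θ ^ 3))
          = c₃ * (CP * (2 * ((L : ℝ) ^ 2 * G) + (M : ℝ) ^ d * E)) + (M : ℝ) ^ d * (c₁ * (9 * θ ^ 3)) := by
      rw [Finset.sum_add_distrib, ← Finset.mul_sum, ← Finset.mul_sum, Finset.sum_add_distrib, ← Finset.mul_sum,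
        hcovG, Finset.sum_const, Finset.sum_const, nsmul_eq_mul, nsmul_eq_mul, hcardY]
    rw [lhs_eq, rhs_eq] at hsum
    -- the `Q`-terms cancel exactly
    have hcancel : c₂ * ((L : ℝ) ^ 2 * Q) = Q / (2 * N) := by
      rw [hc₂def]; field_simp
    -- the gradient term: `c₃·C_P·2L²·G ≤ 2·C_low·G'`
    have hcoef : c₃ * (CP * (2 * ((L : ℝ) ^ 2 * (N * G')))) = 2 * lowerConst d L * G' := by
      rw [hc₃def, hCPdef, poincareConst, lowerConst, pow_add]
      field_simp
      ring
    have hgrad : c₃ * (CP * (2 * ((L : ℝ) ^ 2 * G))) ≤ 2 * lowerConst d L * G' := by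
      rw [← hcoef]
      have h0 : 0 ≤ c₃ * (CP * (2 * (L : ℝ) ^ 2)) := by positivity
      have := mul_le_mul_of_nonneg_left hGG' h0
      nlinarith [this]
    -- the transport-defect term: `c₃·C_P·M^d·E = M^d·8C_P·d(d+2)²·a⁴ ≤ M^d·C_P·d(d+2)²·a³/64`
    have hE : c₃ * (CP * ((M : ℝ) ^ d * E)) = (M : ℝ) ^ d * (8 * CP * d * ((d : ℝ) + 2) ^ 2 * a ^ 4) := by
      rw [hc₃def, hEdef, pow_add]
      field_simp
      ring
    have ha4 : 8 * CP * d * ((d : ℝ) + 2) ^ 2 * a ^ 4 ≤ CP * d * ((d : ℝ) + 2) ^ 2 / 64 * a ^ 3 := by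
      have h8 : 8 * a ^ 4 ≤ a ^ 3 / 64 := by nlinarith [pow_nonneg ha 3]
      have h0 : 0 ≤ CP * d * ((d : ℝ) + 2) ^ 2 := by positivity
      nlinarith [mul_le_mul_of_nonneg_left h8 h0]
    have hE' : c₃ * (CP * ((M : ℝ) ^ d * E)) ≤ (M : ℝ) ^ d * (CP * d * ((d : ℝ) + 2) ^ 2 / 64 * a ^ 3) := by
      rw [hE]
      exact mul_le_mul_of_nonneg_left ha4 (by positivity)
    -- the cubic term
    have hθ3 : (M : ℝ) ^ d * (c₁ * (9 * θ ^ 3))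
        = 4608 * ((d : ℝ) + 1) ^ 3 * ((d : ℝ) + 4) ^ 3 * (L : ℝ) ^ (d + 2) * a ^ 3 * (M : ℝ) ^ d := by
      rw [hzpow, hθdef, pow_add]
      field_simp
      ring
    have split : c₃ * (CP * (2 * ((L : ℝ) ^ 2 * G) + (M : ℝ) ^ d * E))
        = c₃ * (CP * (2 * ((L : ℝ) ^ 2 * G))) + c₃ * (CP * ((M : ℝ) ^ d * E)) := by ring
    rw [split] at hsum
    nlinarith [hsum, hfine, hcancel, hgrad, hE', hθ3]
  -- summing the planes
  have hdef : deficit L V (blockWindow L (periodBox M))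
      = ∑ π : Plane d, (c₁ * ∑ y ∈ periodBox M, wt (chol L V (y, π))
          - ∑ x ∈ blockSites L (periodBox M), wt (fhol V (x, π))) := by
    unfold deficit blockWindow coarseAction fineAction
    simp only []
    rw [Finset.sum_product_right, Finset.sum_product_right, Finset.mul_sum, ← Finset.sum_sub_distrib]
  have hG : ∑ π : Plane d, ∑ x ∈ blockSites L (periodBox M), ∑ κ : Fin d, ‖covGrad V (flux V) x κ π‖ ^ 2
      = gradFluxSq V (blockSites L (periodBox M)) := by
    unfold gradFluxSq
    rw [Finset.sum_comm]
    exact Finset.sum_congr rfl fun x _ => Finset.sum_comm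
  calc -deficit L V (blockWindow L (periodBox M))
      = ∑ π : Plane d, (∑ x ∈ blockSites L (periodBox M), wt (fhol V (x, π))
          - c₁ * ∑ y ∈ periodBox M, wt (chol L V (y, π))) := by
        rw [hdef, ← Finset.sum_neg_distrib]
        exact Finset.sum_congr rfl fun π _ => by ring
    _ ≤ ∑ π : Plane d, (2 * lowerConst d L * ∑ x ∈ blockSites L (periodBox M), ∑ κ : Fin d, ‖covGrad V (flux V) x κ π‖ ^ 2
          + (4608 * ((d : ℝ) + 1) ^ 3 * ((d : ℝ) + 4) ^ 3 * (L : ℝ) ^ (d + 2) + CP * d * ((d : ℝ) + 2) ^ 2 / 64)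
            * a ^ 3 * (M : ℝ) ^ d) := Finset.sum_le_sum fun π _ => hplane π
    _ = 2 * lowerConst d L * gradFluxSq V (blockSites L (periodBox M)) + lowerConstNA d L * a ^ 3 * (M : ℝ) ^ d := by
        rw [Finset.sum_add_distrib, ← Finset.mul_sum, hG, Finset.sum_const, Finset.card_univ, nsmul_eq_mul,
          lowerConstNA]
        ring

variable (d) in
/-- The constant of β′-per: `upperConst + 2·C_low + lowerConstNA`. [folklore] -/
def wallConstNA (L : ℕ) : ℝ := upperConst d L + 2 * lowerConst d L + lowerConstNA d L

omit [Fintype n] [DecidableEq n] [Nonempty n] in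
/-- `0 ≤ wallConstNA d L`. [folklore] -/
theorem wallConstNA_nonneg (L : ℕ) : 0 ≤ wallConstNA d L := by
  unfold wallConstNA
  have := upperConst_nonneg (d := d) L
  have := lowerConst_nonneg d L
  have := lowerConstNA_nonneg (d := d) L
  positivity

/-- **β′-per, TWO-SIDED, FOR GENERAL `U(N)`-VALUED DATA**: for `L, M ≥ 1`, every `U(N)`-valued `V` of period `LM`
with (44) and `512(d+1)(d+4)L²a ≤ 1`:
`|𝓓_{W([0,M)^d)}(V)| ≤ wallConstNA(d,L) · (‖∇_V F‖²_{ℓ²([0,LM)^d)} + a³·M^d)`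
(`deficit_torus_le` + `deficit_torus_ge`; the gradient term is `≥ 0`). [folklore] -/
theorem abs_deficit_torus_le (L M : ℕ) (hL : 1 ≤ L) (hM : 1 ≤ M) {V : Site d → Fin d → 𝕄ˣ} (hV : IsUnitaryCfg V)
    (hP : IsPeriodicCfg V ((L : ℤ) * M)) {a : ℝ} (ha : 0 ≤ a)
    (hsmall : 512 * (d + 1) * (d + 4) * (L : ℝ) ^ 2 * a ≤ 1) (hVa : SmallField V a) :
    |deficit L V (blockWindow L (periodBox M))|
      ≤ wallConstNA d L * (gradFluxSq V (blockSites L (periodBox M)) + a ^ 3 * (M : ℝ) ^ d) := by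
  have hup := deficit_torus_le L M hL hM hV hP ha hsmall hVa
  have hlo := deficit_torus_ge L M hL hM hV hP ha hsmall hVa
  have hg : 0 ≤ gradFluxSq V (blockSites L (periodBox (d := d) M)) := by
    unfold gradFluxSq; positivity
  have h1 := upperConst_nonneg (d := d) L
  have h2 := lowerConst_nonneg d L
  have h3 := lowerConstNA_nonneg (d := d) L
  have ha3 : 0 ≤ a ^ 3 * (M : ℝ) ^ d := by positivity
  rw [abs_le, wallConstNA]
  constructor
  · nlinarith [mul_nonneg h1 hg, mul_nonneg h1 ha3, mul_nonneg h3 hg, mul_nonneg h2 ha3]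
  · nlinarith [mul_nonneg h1 hg, mul_nonneg h2 hg, mul_nonneg h3 hg, mul_nonneg h2 ha3, mul_nonneg h3 ha3]

/-- **`DeficitValueWallPer d n L (wallConstNA d L) (1/(512(d+1)(d+4)L²))` HOLDS for every `L ≥ 1`** — the periodic
value wall β′-per of `T4AveragingDeficitWallBoundary` (typed there, and proved there on the ABELIAN image class only,
`deficit_imCfg_wallPer`) is a THEOREM for ALL `U(N)`-valued small-field periodic data: the typed conjunction
`ClaimBetaPer = β ∧ β′-per` thereby reduces to the derivative wall β = `DeficitDerivWall` ALONE (§9), which is NOT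
touched here and remains [analysis]. [folklore] -/
theorem deficitValueWallPer_holds (L : ℕ) (hL : 1 ≤ L) :
    T4AveragingDeficitWallBoundary.DeficitValueWallPer d n L (wallConstNA d L)
      (1 / (512 * ((d : ℝ) + 1) * ((d : ℝ) + 4) * (L : ℝ) ^ 2)) := by
  intro M hM V hV hP a ha ha₀ hVa
  have hpos : 0 < 512 * ((d : ℝ) + 1) * ((d : ℝ) + 4) * (L : ℝ) ^ 2 := by
    have hL0 : (0 : ℝ) < L := by exact_mod_cast (by omega : 0 < L)
    positivity
  have hsmall : 512 * (d + 1) * (d + 4) * (L : ℝ) ^ 2 * a ≤ 1 := by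
    have := (le_div_iff₀ hpos).mp ha₀
    linarith
  exact abs_deficit_torus_le L M hL hM hV hP ha hsmall hVa

end TorusLower

/-! ## §9 The reduction `ClaimBetaPer ⟺ β`: with β′-per a theorem, the typed conjunction β ∧ β′-per is the derivative
wall β alone (both typed walls are monotone in `C` and antitone in `a₀`) -/

section Reduction

open Filter
open T4AveragingDeficitWall hiding Site
open T4AveragingDeficitWallBoundary (IsPeriodicCfg periodBox DeficitValueWallPer ClaimBetaPer)

variable {d : ℕ} {n : Type*} [Fintype n] [DecidableEq n] [Nonempty n]

local notation "𝕄" => Matrix n n ℂ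
local notation "Site" => B7Prop1Explicit.Site

omit [Nonempty n] in
/-- The derivative wall β is monotone in `C` and antitone in `a₀`. [folklore] -/
theorem derivWall_mono {L : ℕ} {C C' a₀ a₀' : ℝ} {R : ℕ} (hC : C ≤ C') (ha₀ : a₀' ≤ a₀)
    (h : DeficitDerivWall d n L C a₀ R) : DeficitDerivWall d n L C' a₀' R := by
  intro V hV a ha haa hVa ψ S hψ hS
  refine (h V hV a ha (haa.trans ha₀) hVa ψ S hψ hS).mono fun W hW D hD => (hW D hD).trans ?_
  have h1 : 0 ≤ Real.sqrt (gradFluxSq V (nbhd R (bondSites S))) * Real.sqrt (curlSq V ψ (nbhd R (bondSites S))) :=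
    mul_nonneg (Real.sqrt_nonneg _) (Real.sqrt_nonneg _)
  have h2 : 0 ≤ dirL1 ψ (nbhd R (bondSites S)) := by unfold dirL1; positivity
  have h3 : 0 ≤ curlL1 V ψ (nbhd R (bondSites S)) := by unfold curlL1; positivity
  exact mul_le_mul_of_nonneg_right hC (by positivity)

omit [Nonempty n] in
/-- The periodic value wall β′-per is monotone in `C` and antitone in `a₀`. [folklore] -/
theorem valueWallPer_mono {L : ℕ} {C C' a₀ a₀' : ℝ} (hC : C ≤ C') (ha₀ : a₀' ≤ a₀)
    (h : DeficitValueWallPer d n L C a₀) : DeficitValueWallPer d n L C' a₀' := by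
  intro M hM V hV hP a ha haa hVa
  refine (h M hM V hV hP a ha (haa.trans ha₀) hVa).trans ?_
  have hg : 0 ≤ gradFluxSq V (blockSites L (periodBox (d := d) M)) := by unfold gradFluxSq; positivity
  exact mul_le_mul_of_nonneg_right hC (by positivity)

/-- **`ClaimBetaPer` FOLLOWS FROM THE DERIVATIVE WALL β ALONE** (`L ≥ 1`): given any `C ≥ 0`, `0 < a₀ ≤ 1`, `R` with
`DeficitDerivWall d N L C a₀ R`, the typed conjunction β ∧ β′-per holds with `C' = max(C, wallConstNA)`,
`a₀' = min(a₀, 1/(512(d+1)(d+4)L²))` — β′-per being the theorem `deficitValueWallPer_holds`.  β itself is NOT claimed. [folklore] -/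
theorem claimBetaPer_of_derivWall (L : ℕ) (hL : 1 ≤ L) {C a₀ : ℝ} {R : ℕ} (hC : 0 ≤ C) (ha₀ : 0 < a₀)
    (ha₁ : a₀ ≤ 1) (h : DeficitDerivWall d n L C a₀ R) : ClaimBetaPer d n L := by
  have hL0 : (0 : ℝ) < L := by exact_mod_cast (by omega : 0 < L)
  have hpos : 0 < 1 / (512 * ((d : ℝ) + 1) * ((d : ℝ) + 4) * (L : ℝ) ^ 2) := by positivity
  refine ⟨max C (wallConstNA d L), min a₀ (1 / (512 * ((d : ℝ) + 1) * ((d : ℝ) + 4) * (L : ℝ) ^ 2)), R,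
    hC.trans (le_max_left _ _), lt_min ha₀ hpos, (min_le_left _ _).trans ha₁,
    derivWall_mono (le_max_left _ _) (min_le_left _ _) h,
    valueWallPer_mono (le_max_right _ _) (min_le_right _ _) (deficitValueWallPer_holds L hL)⟩

/-- **`ClaimBetaPer ⟺ β`** (`L ≥ 1`): the periodic repair of `ClaimBeta` is EQUIVALENT to the bare existence of
derivative-wall constants `∃ C ≥ 0, 0 < a₀ ≤ 1, R, DeficitDerivWall d N L C a₀ R`.  Neither side is asserted. [folklore] -/
theorem claimBetaPer_iff_derivWall (L : ℕ) (hL : 1 ≤ L) :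
    ClaimBetaPer d n L ↔ ∃ C a₀ : ℝ, ∃ R : ℕ, 0 ≤ C ∧ 0 < a₀ ∧ a₀ ≤ 1 ∧ DeficitDerivWall d n L C a₀ R :=
  ⟨fun ⟨C, a₀, R, hC, ha₀, ha₁, hβ, _⟩ => ⟨C, a₀, R, hC, ha₀, ha₁, hβ⟩,
    fun ⟨_, _, _, hC, ha₀, ha₁, hβ⟩ => claimBetaPer_of_derivWall L hL hC ha₀ ha₁ hβ⟩

end Reduction

/-! ## §10 Block windows of `ℤ^d`: the LOCAL value wall β′-loc for general `U(N)`-valued data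

On a finite block window `W(Y)` (no periodicity) the quadratic bulk of the deficit no longer cancels exactly: the
stencil of a coarse plaquette near the edge of `Y` reaches `< 2L` sites beyond the blocks of `Y`, and the block
sites near the edge are covered fewer than `L²` times.  The mismatch is the telescoping sum
`L⁻²·Σ_{x ∈ B(Y)} Σ_{i,j<L} [hs F(x+ie_μ+je_ν) − hs F(x)]`, each step of which is a covariant difference
`hs(Ad_V F(z+e_κ)) − hs F(z) = 2hs(∇_V F, F) + hs(∇_V F, ∇_V F)`, of size `≤ N(4a|∇_V F| + |∇_V F|²)` — this is the
`a·‖∇_V F‖_{ℓ¹}` slot of the typed local wall `DeficitValueWallLoc` (the slot whose absence made the finite-window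
typing β′ false, `T4AveragingDeficitWallBoundary.not_deficitValueWall`). -/

section Local

open NormedSpace Finset B7Prop1Explicit B7Prop2Explicit
open T4AveragingDeficitWall hiding Site
open T4AveragingDeficitWallBoundary (sum_blocks_eq zpow_sub_four_eq stencilIdx stencilOff card_stencilIdx
  poincareConst poincareConst_nonneg sum_stencilIdx_eq lowerConst lowerConst_nonneg gradFluxL1 DeficitValueWallLoc)

variable {d : ℕ} {n : Type*} [Fintype n] [DecidableEq n] [Nonempty n]

local notation "𝕄" => Matrix n n ℂ
local notation "Site" => B7Prop1Explicit.Site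

omit [Fintype n] [DecidableEq n] [Nonempty n] in
/-- A shift by a lattice vector of sup-norm `≤ R` stays in the `R`-neighbourhood. [folklore] -/
private theorem add_mem_nbhd {T : Finset (Site d)} {x : Site d} (hx : x ∈ T) {R : ℕ} (v : Site d)
    (hv : ∀ i, |v i| ≤ (R : ℤ)) : x + v ∈ nbhd R T := by
  unfold nbhd T4AveragingDeficitWall.box
  rw [Finset.mem_biUnion]
  refine ⟨x, hx, ?_⟩
  rw [Finset.mem_Icc, Pi.le_def, Pi.le_def]
  refine ⟨fun i => ?_, fun i => ?_⟩
  · have := (abs_le.mp (hv i)).1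
    simp only [Pi.sub_apply, Pi.add_apply]; omega
  · have := (abs_le.mp (hv i)).2
    simp only [Pi.add_apply]; omega

omit [Fintype n] [DecidableEq n] [Nonempty n] in
/-- Summing a nonnegative function over a shifted copy of `T` (shift of sup-norm `≤ R`) is dominated by its sum over
the `R`-neighbourhood of `T`. [folklore] -/
private theorem sum_shift_le_nbhd (T : Finset (Site d)) {g : Site d → ℝ} (hg : ∀ z, 0 ≤ g z) {R : ℕ} (v : Site d)
    (hv : ∀ i, |v i| ≤ (R : ℤ)) : ∑ x ∈ T, g (x + v) ≤ ∑ z ∈ nbhd R T, g z := by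
  have h1 : ∑ x ∈ T, g (x + v) = ∑ z ∈ T.map (addRightEmbedding v), g z := by
    rw [Finset.sum_map]; rfl
  rw [h1]
  refine Finset.sum_le_sum_of_subset_of_nonneg (fun z hz => ?_) fun z _ _ => hg z
  rw [Finset.mem_map] at hz
  obtain ⟨x, hx, rfl⟩ := hz
  exact add_mem_nbhd hx v hv

omit [Fintype n] [DecidableEq n] [Nonempty n] in
/-- The sup-norm of `ie_μ + ke_ν` is `≤ i + k`. [folklore] -/
private theorem abs_shift2_apply_le (μ ν : Fin d) (i k : ℕ) (l : Fin d) :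
    |((i : ℤ) • e μ + (k : ℤ) • e ν) l| ≤ (i : ℤ) + k := by
  simp only [Pi.add_apply, Pi.smul_apply, e_apply, smul_eq_mul, mul_ite, mul_one, mul_zero]
  have h1 : (0 : ℤ) ≤ (if l = μ then (i : ℤ) else 0) := by split_ifs <;> omega
  have h2 : (0 : ℤ) ≤ (if l = ν then (k : ℤ) else 0) := by split_ifs <;> omega
  have h3 : (if l = μ then (i : ℤ) else 0) ≤ i := by split_ifs <;> omega
  have h4 : (if l = ν then (k : ℤ) else 0) ≤ k := by split_ifs <;> omega
  rw [abs_of_nonneg (by omega)]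
  omega

omit [Fintype n] [DecidableEq n] [Nonempty n] in
/-- The sup-norm of `ke_μ` is `≤ k`. [folklore] -/
private theorem abs_shift1_apply_le (μ : Fin d) (k : ℕ) (l : Fin d) : |((k : ℤ) • e μ) l| ≤ (k : ℤ) := by
  simp only [Pi.smul_apply, e_apply, smul_eq_mul, mul_ite, mul_one, mul_zero]
  split_ifs <;> simp

omit [Fintype n] [DecidableEq n] [Nonempty n] in
/-- ONE-LEG TELESCOPING: if `|g(z+e_κ) − g(z)| ≤ δ(z,κ)` with `δ ≥ 0`, then for `m ≤ L`,
`|g(x + me_μ) − g(x)| ≤ Σ_{k<L} δ(x + ke_μ, μ)`. [folklore] -/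
private theorem abs_sub_le_sum_steps (g : Site d → ℝ) (δ : Site d → Fin d → ℝ) (hδ0 : ∀ z κ, 0 ≤ δ z κ)
    (hδ : ∀ z κ, |g (z + e κ) - g z| ≤ δ z κ) (x : Site d) (μ : Fin d) {m L : ℕ} (hm : m ≤ L) :
    |g (x + (m : ℤ) • e μ) - g x| ≤ ∑ k ∈ range L, δ (x + (k : ℤ) • e μ) μ := by
  have htel := Finset.sum_range_sub (fun k : ℕ => g (x + (k : ℤ) • e μ)) m
  simp only [Nat.cast_zero, zero_smul, add_zero, Nat.cast_succ] at htel
  rw [← htel]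
  calc |∑ k ∈ range m, (g (x + ((k : ℤ) + 1) • e μ) - g (x + (k : ℤ) • e μ))|
      ≤ ∑ k ∈ range m, |g (x + ((k : ℤ) + 1) • e μ) - g (x + (k : ℤ) • e μ)| := Finset.abs_sum_le_sum_abs _ _
    _ ≤ ∑ k ∈ range m, δ (x + (k : ℤ) • e μ) μ := Finset.sum_le_sum fun k _ => by
        have : x + ((k : ℤ) + 1) • e μ = x + (k : ℤ) • e μ + e μ := by rw [add_smul, one_smul, add_assoc]
        rw [this]; exact hδ _ _
    _ ≤ ∑ k ∈ range L, δ (x + (k : ℤ) • e μ) μ :=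
        Finset.sum_le_sum_of_subset_of_nonneg (Finset.range_mono hm) fun k _ _ => hδ0 _ _

omit [Fintype n] [DecidableEq n] [Nonempty n] in
/-- **THE TELESCOPING BOUND FOR THE STENCIL MISMATCH**: if `|g(z+e_κ) − g(z)| ≤ δ(z,κ)` (`δ ≥ 0`), then
`Σ_{x∈T} Σ_{i,j<L} |g(x + ie_μ + je_ν) − g(x)| ≤ 2L³ · Σ_{z ∈ N_R(T)} Σ_κ δ(z,κ)` for `R ≥ 2L` — each difference is a
staircase of `< 2L` steps, each step lies within sup-distance `< 2L` of `T`, multiplicities `≤ L³`. [folklore] -/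
private theorem sum_shift2_abs_le (T : Finset (Site d)) (g : Site d → ℝ) (δ : Site d → Fin d → ℝ)
    (hδ0 : ∀ z κ, 0 ≤ δ z κ) (hδ : ∀ z κ, |g (z + e κ) - g z| ≤ δ z κ) (L R : ℕ) (hLR : 2 * L ≤ R)
    (μ ν : Fin d) :
    ∑ x ∈ T, ∑ i ∈ range L, ∑ j ∈ range L, |g (x + (i : ℤ) • e μ + (j : ℤ) • e ν) - g x|
      ≤ 2 * (L : ℝ) ^ 3 * ∑ z ∈ nbhd R T, ∑ κ : Fin d, δ z κ := by
  set S : ℝ := ∑ z ∈ nbhd R T, ∑ κ : Fin d, δ z κ with hSdef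
  have hSκ : ∀ κ : Fin d, ∑ z ∈ nbhd R T, δ z κ ≤ S := fun κ => by
    rw [hSdef]
    exact Finset.sum_le_sum fun z _ => Finset.single_le_sum (fun κ' _ => hδ0 z κ') (Finset.mem_univ κ)
  have hv1 : ∀ (i k : ℕ), i ∈ range L → k ∈ range L → ∀ l, |((i : ℤ) • e μ + (k : ℤ) • e ν) l| ≤ (R : ℤ) := by
    intro i k hi hk l
    have hi' := Finset.mem_range.mp hi
    have hk' := Finset.mem_range.mp hk
    refine (abs_shift2_apply_le μ ν i k l).trans ?_
    omega
  have hv2 : ∀ k : ℕ, k ∈ range L → ∀ l, |((k : ℤ) • e μ) l| ≤ (R : ℤ) := by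
    intro k hk l
    have hk' := Finset.mem_range.mp hk
    refine (abs_shift1_apply_le μ k l).trans ?_
    omega
  -- pointwise: two legs
  have hpt : ∀ x ∈ T, ∀ i ∈ range L, ∀ j ∈ range L,
      |g (x + (i : ℤ) • e μ + (j : ℤ) • e ν) - g x|
        ≤ ∑ k ∈ range L, δ (x + (i : ℤ) • e μ + (k : ℤ) • e ν) ν + ∑ k ∈ range L, δ (x + (k : ℤ) • e μ) μ := by
    intro x _ i hi j hj
    have h1 := abs_sub_le_sum_steps g δ hδ0 hδ (x + (i : ℤ) • e μ) ν (Finset.mem_range.mp hj).le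
    have h2 := abs_sub_le_sum_steps g δ hδ0 hδ x μ (L := L) (Finset.mem_range.mp hi).le
    rw [← sub_add_sub_cancel (g (x + (i : ℤ) • e μ + (j : ℤ) • e ν)) (g (x + (i : ℤ) • e μ)) (g x)]
    exact (abs_add_le _ _).trans (add_le_add h1 h2)
  -- the ν-legs: multiplicity `L` (free index `j`), each shifted copy of `T` inside `N_R(T)`
  have hA : ∑ x ∈ T, ∑ i ∈ range L, ∑ k ∈ range L, δ (x + (i : ℤ) • e μ + (k : ℤ) • e ν) ν
      ≤ (L : ℝ) ^ 2 * S := by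
    calc ∑ x ∈ T, ∑ i ∈ range L, ∑ k ∈ range L, δ (x + (i : ℤ) • e μ + (k : ℤ) • e ν) ν
        = ∑ i ∈ range L, ∑ k ∈ range L, ∑ x ∈ T, δ (x + ((i : ℤ) • e μ + (k : ℤ) • e ν)) ν := by
          rw [Finset.sum_comm]
          refine Finset.sum_congr rfl fun i _ => ?_
          rw [Finset.sum_comm]
          refine Finset.sum_congr rfl fun k _ => Finset.sum_congr rfl fun x _ => ?_
          rw [add_assoc]
      _ ≤ ∑ i ∈ range L, ∑ k ∈ range L, S :=
          Finset.sum_le_sum fun i hi => Finset.sum_le_sum fun k hk =>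
            (sum_shift_le_nbhd T (fun z => hδ0 z ν) _ (hv1 i k hi hk)).trans (hSκ ν)
      _ = (L : ℝ) ^ 2 * S := by
          rw [Finset.sum_const, Finset.card_range, Finset.sum_const, Finset.card_range, smul_smul, nsmul_eq_mul]
          push_cast; ring
  -- the μ-legs: multiplicity `L²` (free indices `i, j`)
  have hB : ∑ x ∈ T, ∑ k ∈ range L, δ (x + (k : ℤ) • e μ) μ ≤ (L : ℝ) * S := by
    calc ∑ x ∈ T, ∑ k ∈ range L, δ (x + (k : ℤ) • e μ) μ
        = ∑ k ∈ range L, ∑ x ∈ T, δ (x + (k : ℤ) • e μ) μ := Finset.sum_comm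
      _ ≤ ∑ k ∈ range L, S :=
          Finset.sum_le_sum fun k hk => (sum_shift_le_nbhd T (fun z => hδ0 z μ) _ (hv2 k hk)).trans (hSκ μ)
      _ = (L : ℝ) * S := by rw [Finset.sum_const, Finset.card_range, nsmul_eq_mul]
  have hper : ∀ x : Site d, ∑ i ∈ range L, ∑ j ∈ range L,
      (∑ k ∈ range L, δ (x + (i : ℤ) • e μ + (k : ℤ) • e ν) ν + ∑ k ∈ range L, δ (x + (k : ℤ) • e μ) μ)
        = (L : ℝ) * ∑ i ∈ range L, ∑ k ∈ range L, δ (x + (i : ℤ) • e μ + (k : ℤ) • e ν) ν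
          + (L : ℝ) ^ 2 * ∑ k ∈ range L, δ (x + (k : ℤ) • e μ) μ := by
    intro x
    simp only [Finset.sum_add_distrib, Finset.sum_const, Finset.card_range, nsmul_eq_mul, Finset.mul_sum]
    ring
  calc ∑ x ∈ T, ∑ i ∈ range L, ∑ j ∈ range L, |g (x + (i : ℤ) • e μ + (j : ℤ) • e ν) - g x|
      ≤ ∑ x ∈ T, ∑ i ∈ range L, ∑ j ∈ range L,
          (∑ k ∈ range L, δ (x + (i : ℤ) • e μ + (k : ℤ) • e ν) ν + ∑ k ∈ range L, δ (x + (k : ℤ) • e μ) μ) :=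
        Finset.sum_le_sum fun x hx => Finset.sum_le_sum fun i hi => Finset.sum_le_sum fun j hj =>
          hpt x hx i hi j hj
    _ = (L : ℝ) * ∑ x ∈ T, ∑ i ∈ range L, ∑ k ∈ range L, δ (x + (i : ℤ) • e μ + (k : ℤ) • e ν) ν
        + (L : ℝ) ^ 2 * ∑ x ∈ T, ∑ k ∈ range L, δ (x + (k : ℤ) • e μ) μ := by
        rw [Finset.sum_congr rfl fun x _ => hper x, Finset.sum_add_distrib, ← Finset.mul_sum, ← Finset.mul_sum]
    _ ≤ (L : ℝ) * ((L : ℝ) ^ 2 * S) + (L : ℝ) ^ 2 * ((L : ℝ) * S) := by gcongr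
    _ = 2 * (L : ℝ) ^ 3 * S := by ring

omit [Nonempty n] in
/-- (44) in the logarithm: `|F(x;π)| ≤ 2a` whenever `|V(∂p′) − 1| ≤ a ≤ 1/4`. [folklore] -/
private theorem norm_flux_le {V : Site d → Fin d → 𝕄ˣ} {a : ℝ} (ha1 : a ≤ 1 / 4) (hVa : SmallField V a)
    (x : Site d) (π : Plane d) : ‖flux V (x, π)‖ ≤ 2 * a := by
  have h44 : ‖((fhol V (x, π) : 𝕄ˣ) : 𝕄) - 1‖ ≤ a := hVa x π.1.1 π.1.2 (ne_of_lt π.2)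
  show ‖mlog ((fhol V (x, π) : 𝕄ˣ) : 𝕄)‖ ≤ 2 * a
  exact (norm_mlog_le_two_mul (by linarith)).trans (by linarith)

/-- **THE COVARIANT STEP OF THE FLUX ENERGY**: for `U(N)`-valued `V` with (44), `a ≤ 1/4`,
`|hs(F(z+e_κ)) − hs(F(z))| ≤ N·(4a·|∇_V F(z,κ;π)| + |∇_V F(z,κ;π)|²)` — `hs` is `Ad`-invariant, so
`hs(F(z+e_κ)) = hs(F(z) + ∇_V F) = hs(F(z)) + 2hs(∇_V F, F(z)) + hs(∇_V F, ∇_V F)`. [cite: Balaban1985Averaging, (44) p.24, (45) p.24, (11) p.19] -/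
theorem abs_hs_flux_step_le {V : Site d → Fin d → 𝕄ˣ} (hV : IsUnitaryCfg V) {a : ℝ} (ha1 : a ≤ 1 / 4)
    (hVa : SmallField V a) (z : Site d) (κ : Fin d) (π : Plane d) :
    |hs (flux V (z + e κ, π)) (flux V (z + e κ, π)) - hs (flux V (z, π)) (flux V (z, π))|
      ≤ (Fintype.card n : ℝ) * (4 * a * ‖covGrad V (flux V) z κ π‖ + ‖covGrad V (flux V) z κ π‖ ^ 2) := by
  set N : ℝ := (Fintype.card n : ℝ) with hNdef
  set D : 𝕄 := covGrad V (flux V) z κ π with hDdef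
  set B : 𝕄 := flux V (z, π) with hBdef
  have hA : Ad (V z κ) (flux V (z + e κ, π)) = B + D := by
    rw [hDdef, covGrad, hBdef]; abel
  have h1 : hs (flux V (z + e κ, π)) (flux V (z + e κ, π)) = hs (B + D) (B + D) := by
    rw [← hA, hs_Ad_unitary (hV z κ)]
  have hexp : hs (B + D) (B + D) = hs B B + 2 * hs D B + hs D D := by
    rw [hs_add_left, hs_add_right, hs_add_right, hs_comm B D]; ring
  have hBn : ‖B‖ ≤ 2 * a := norm_flux_le ha1 hVa z π
  have hcross : |hs D B| ≤ N * (‖D‖ * ‖B‖) := abs_hs_le D B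
  have hDD : hs D D ≤ N * ‖D‖ ^ 2 := hs_self_le_card_mul_norm_sq D
  have hDD0 : 0 ≤ hs D D := hs_self_nonneg D
  rw [h1, hexp]
  have hre : hs B B + 2 * hs D B + hs D D - hs B B = 2 * hs D B + hs D D := by ring
  rw [hre]
  calc |2 * hs D B + hs D D| ≤ |2 * hs D B| + |hs D D| := abs_add_le _ _
    _ = 2 * |hs D B| + hs D D := by rw [abs_mul, abs_two, abs_of_nonneg hDD0]
    _ ≤ 2 * (N * (‖D‖ * ‖B‖)) + N * ‖D‖ ^ 2 := by gcongr
    _ ≤ 2 * (N * (‖D‖ * (2 * a))) + N * ‖D‖ ^ 2 := by gcongr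
    _ = N * (4 * a * ‖D‖ + ‖D‖ ^ 2) := by ring

/-- `#B(Y) = L^d · #Y`. [folklore] -/
private theorem card_blockSites_eq (L : ℕ) (hL : 1 ≤ L) (Y : Finset (Site d)) :
    ((blockSites L Y).card : ℝ) = (L : ℝ) ^ d * Y.card := by
  have h := sum_blocks_eq L hL Y (fun _ => (1 : ℝ))
  simp only [Finset.sum_const, Finset.card_univ, Fintype.card_fun, Fintype.card_fin, mul_one, nsmul_eq_mul] at h
  rw [← h]; push_cast; ring

set_option maxHeartbeats 400000 in
/-- **THE STENCIL MISMATCH OF A BLOCK WINDOW** (per plane `π = (μ,ν)`): for `U(N)`-valued `V` with (44), `a ≤ 1/4`,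
`|L⁻²·Σ_{y∈Y} Σ_{r,i,j} hs F(Ly+r+ie_μ+je_ν) − Σ_{x∈B(Y)} hs F(x)|
   ≤ 2LN · Σ_{z ∈ N_{2L}(B(Y))} Σ_κ (4a·|∇_V F(z,κ;π)| + |∇_V F(z,κ;π)|²)`
(block tiling `sum_blocks_eq` + the telescoping bound `sum_shift2_abs_le` with the covariant step
`abs_hs_flux_step_le`).  On a torus the left side vanishes (`sum_stencil_periodBox`). [cite: Balaban1985Averaging, (42) p.23, (44) p.24] -/
theorem stencil_mismatch_abs_le (L : ℕ) (hL : 1 ≤ L) {V : Site d → Fin d → 𝕄ˣ} (hV : IsUnitaryCfg V) {a : ℝ}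
    (ha1 : a ≤ 1 / 4) (hVa : SmallField V a) (Y : Finset (Site d)) (π : Plane d) :
    |((L : ℝ) ^ 2)⁻¹ * ∑ y ∈ Y, ∑ r : Fin d → Fin L, ∑ i ∈ range L, ∑ j ∈ range L,
          hs (flux V ((L : ℤ) • y + boxVec L r + (i : ℤ) • e π.1.1 + (j : ℤ) • e π.1.2, π))
            (flux V ((L : ℤ) • y + boxVec L r + (i : ℤ) • e π.1.1 + (j : ℤ) • e π.1.2, π))
        - ∑ x ∈ blockSites L Y, hs (flux V (x, π)) (flux V (x, π))|
      ≤ 2 * L * (Fintype.card n : ℝ) * ∑ z ∈ nbhd (2 * L) (blockSites L Y), ∑ κ : Fin d,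
          (4 * a * ‖covGrad V (flux V) z κ π‖ + ‖covGrad V (flux V) z κ π‖ ^ 2) := by
  set N : ℝ := (Fintype.card n : ℝ) with hNdef
  have hL0 : (0 : ℝ) < L := by exact_mod_cast (by omega : 0 < L)
  set q : Site d → ℝ := fun x => hs (flux V (x, π)) (flux V (x, π)) with hqdef
  set δ : Site d → Fin d → ℝ := fun z κ => N * (4 * a * ‖covGrad V (flux V) z κ π‖ + ‖covGrad V (flux V) z κ π‖ ^ 2)
    with hδdef
  have ha0 : 0 ≤ a := by
    have := hVa 0 π.1.1 π.1.2 (ne_of_lt π.2)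
    exact (norm_nonneg _).trans this
  have hδ0 : ∀ z κ, 0 ≤ δ z κ := fun z κ => by rw [hδdef]; positivity
  have hδ : ∀ z κ, |q (z + e κ) - q z| ≤ δ z κ := fun z κ => abs_hs_flux_step_le hV ha1 hVa z κ π
  have h1 := sum_blocks_eq L hL Y
    (fun x => ∑ i ∈ range L, ∑ j ∈ range L, q (x + (i : ℤ) • e π.1.1 + (j : ℤ) • e π.1.2))
  have hQ : ∑ x ∈ blockSites L Y, q x
      = ((L : ℝ) ^ 2)⁻¹ * ∑ x ∈ blockSites L Y, ∑ i ∈ range L, ∑ j ∈ range L, q x := by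
    simp only [Finset.sum_const, Finset.card_range, nsmul_eq_mul, ← Finset.mul_sum]
    field_simp
  have htel := sum_shift2_abs_le (blockSites L Y) q δ hδ0 hδ L (2 * L) le_rfl π.1.1 π.1.2
  change |((L : ℝ) ^ 2)⁻¹ * ∑ y ∈ Y, ∑ r : Fin d → Fin L, ∑ i ∈ range L, ∑ j ∈ range L,
      q ((L : ℤ) • y + boxVec L r + (i : ℤ) • e π.1.1 + (j : ℤ) • e π.1.2) - ∑ x ∈ blockSites L Y, q x|
    ≤ 2 * L * N * ∑ z ∈ nbhd (2 * L) (blockSites L Y), ∑ κ : Fin d,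
        (4 * a * ‖covGrad V (flux V) z κ π‖ + ‖covGrad V (flux V) z κ π‖ ^ 2)
  rw [h1, hQ, ← mul_sub, ← Finset.sum_sub_distrib, abs_mul, abs_of_nonneg (by positivity)]
  have hin : ∀ x ∈ blockSites L Y,
      ∑ i ∈ range L, ∑ j ∈ range L, q (x + (i : ℤ) • e π.1.1 + (j : ℤ) • e π.1.2)
        - ∑ i ∈ range L, ∑ j ∈ range L, q x
        = ∑ i ∈ range L, ∑ j ∈ range L, (q (x + (i : ℤ) • e π.1.1 + (j : ℤ) • e π.1.2) - q x) := by
    intro x _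
    rw [← Finset.sum_sub_distrib]
    exact Finset.sum_congr rfl fun i _ => by rw [← Finset.sum_sub_distrib]
  rw [Finset.sum_congr rfl hin]
  have habs : |∑ x ∈ blockSites L Y, ∑ i ∈ range L, ∑ j ∈ range L,
        (q (x + (i : ℤ) • e π.1.1 + (j : ℤ) • e π.1.2) - q x)|
      ≤ ∑ x ∈ blockSites L Y, ∑ i ∈ range L, ∑ j ∈ range L,
        |q (x + (i : ℤ) • e π.1.1 + (j : ℤ) • e π.1.2) - q x| := by
    refine (Finset.abs_sum_le_sum_abs _ _).trans (Finset.sum_le_sum fun x _ => ?_)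
    refine (Finset.abs_sum_le_sum_abs _ _).trans (Finset.sum_le_sum fun i _ => ?_)
    exact Finset.abs_sum_le_sum_abs _ _
  have hδsum : ∑ z ∈ nbhd (2 * L) (blockSites L Y), ∑ κ : Fin d, δ z κ
      = N * ∑ z ∈ nbhd (2 * L) (blockSites L Y), ∑ κ : Fin d,
          (4 * a * ‖covGrad V (flux V) z κ π‖ + ‖covGrad V (flux V) z κ π‖ ^ 2) := by
    rw [hδdef, Finset.mul_sum]
    exact Finset.sum_congr rfl fun z _ => by rw [Finset.mul_sum]
  rw [hδsum] at htel
  have hS0 : 0 ≤ ∑ z ∈ nbhd (2 * L) (blockSites L Y), ∑ κ : Fin d,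
      (4 * a * ‖covGrad V (flux V) z κ π‖ + ‖covGrad V (flux V) z κ π‖ ^ 2) := by positivity
  calc ((L : ℝ) ^ 2)⁻¹ * |∑ x ∈ blockSites L Y, ∑ i ∈ range L, ∑ j ∈ range L,
          (q (x + (i : ℤ) • e π.1.1 + (j : ℤ) • e π.1.2) - q x)|
      ≤ ((L : ℝ) ^ 2)⁻¹ * (2 * (L : ℝ) ^ 3 * (N * ∑ z ∈ nbhd (2 * L) (blockSites L Y), ∑ κ : Fin d,
          (4 * a * ‖covGrad V (flux V) z κ π‖ + ‖covGrad V (flux V) z κ π‖ ^ 2))) :=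
        mul_le_mul_of_nonneg_left (habs.trans htel) (by positivity)
    _ = 2 * L * N * ∑ z ∈ nbhd (2 * L) (blockSites L Y), ∑ κ : Fin d,
          (4 * a * ‖covGrad V (flux V) z κ π‖ + ‖covGrad V (flux V) z κ π‖ ^ 2) := by
        field_simp

set_option maxHeartbeats 800000 in
/-- **THE UPPER HALF OF β′-loc, per plane**: for `U(N)`-valued `V` with (44) and `512(d+1)(d+4)L²a ≤ 1`, every finite
`Y ⊂ ℤ^d` and plane `π`,
`L^{d−4}·Σ_{y∈Y} wt(V̄(∂P_{y,π})) − Σ_{x∈B(Y)} wt(V(∂p_{x,π}))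
   ≤ L·Σ_{z∈N_{2L}(B(Y))} Σ_κ (4a·|∇_V F(z,κ;π)| + |∇_V F(z,κ;π)|²) + (364032(d+1)³(d+4)³L^{d+2} + L^d)·a³·#Y`
(`wt_chol_le`, `wt_fhol_ge`, and the stencil mismatch `stencil_mismatch_abs_le` in place of the periodic covering). [folklore] -/
private theorem plane_blockWindow_le (L : ℕ) (hL : 1 ≤ L) {V : Site d → Fin d → 𝕄ˣ} (hV : IsUnitaryCfg V) {a : ℝ}
    (ha : 0 ≤ a) (hsmall : 512 * (d + 1) * (d + 4) * (L : ℝ) ^ 2 * a ≤ 1) (hVa : SmallField V a)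
    (Y : Finset (Site d)) (π : Plane d) :
    (L : ℝ) ^ ((d : ℤ) - 4) * ∑ y ∈ Y, wt (chol L V (y, π)) - ∑ x ∈ blockSites L Y, wt (fhol V (x, π))
      ≤ (L : ℝ) * ∑ z ∈ nbhd (2 * L) (blockSites L Y), ∑ κ : Fin d,
            (4 * a * ‖covGrad V (flux V) z κ π‖ + ‖covGrad V (flux V) z κ π‖ ^ 2)
        + (364032 * ((d : ℝ) + 1) ^ 3 * ((d : ℝ) + 4) ^ 3 * (L : ℝ) ^ (d + 2) + (L : ℝ) ^ d)
            * a ^ 3 * Y.card := by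
  set N : ℝ := (Fintype.card n : ℝ) with hNdef
  have hN : 0 < N := by rw [hNdef]; exact_mod_cast Fintype.card_pos
  have hL0 : (0 : ℝ) < L := by exact_mod_cast (by omega : 0 < L)
  set θ : ℝ := 8 * (d + 1) * (d + 4) * (L : ℝ) ^ 2 * a with hθdef
  have hθ0 : 0 ≤ θ := by positivity
  have hzpow : (L : ℝ) ^ ((d : ℤ) - 4) = (L : ℝ) ^ d / (L : ℝ) ^ 4 := zpow_sub_four_eq L hL
  have hμν : π.1.1 ≠ π.1.2 := ne_of_lt π.2
  have hd : 1 ≤ d := π.1.1.pos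
  have ha1 : a ≤ 1 / 4 := (small_a_le hL hd ha hsmall).trans (by norm_num)
  have hcardB := card_blockSites_eq (d := d) L hL Y
  set q : Site d → ℝ := fun x => hs (flux V (x, π)) (flux V (x, π)) with hqdef
  set Q : ℝ := ∑ x ∈ blockSites L Y, q x with hQdef
  set S : ℝ := ∑ y ∈ Y, ∑ r : Fin d → Fin L, ∑ i ∈ range L, ∑ j ∈ range L,
      q ((L : ℤ) • y + boxVec L r + (i : ℤ) • e π.1.1 + (j : ℤ) • e π.1.2) with hSdef
  set G : ℝ := ∑ z ∈ nbhd (2 * L) (blockSites L Y), ∑ κ : Fin d,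
      (4 * a * ‖covGrad V (flux V) z κ π‖ + ‖covGrad V (flux V) z κ π‖ ^ 2) with hGdef
  have hmis : |((L : ℝ) ^ 2)⁻¹ * S - Q| ≤ 2 * L * N * G := stencil_mismatch_abs_le L hL hV ha1 hVa Y π
  -- coarse side
  set C₁ : ℝ := (L : ℝ) ^ 2 * ((L : ℝ) ^ d)⁻¹ / (2 * N) with hC₁def
  have hcoarse : ∑ y ∈ Y, wt (chol L V (y, π)) ≤ C₁ * S + Y.card * (711 * θ ^ 3) := by
    calc ∑ y ∈ Y, wt (chol L V (y, π))
        ≤ ∑ y ∈ Y, (C₁ * ∑ r : Fin d → Fin L, ∑ i ∈ range L, ∑ j ∈ range L,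
              q ((L : ℤ) • y + boxVec L r + (i : ℤ) • e π.1.1 + (j : ℤ) • e π.1.2) + 711 * θ ^ 3) :=
          Finset.sum_le_sum fun y _ => wt_chol_le L hL hV ha hsmall hVa y π
      _ = C₁ * S + Y.card * (711 * θ ^ 3) := by
          rw [Finset.sum_add_distrib, ← Finset.mul_sum, Finset.sum_const, nsmul_eq_mul]
  -- fine side
  have hfine : Q / (2 * N) - (L : ℝ) ^ d * Y.card * (5 / 6 * a ^ 4) ≤ ∑ x ∈ blockSites L Y, wt (fhol V (x, π)) := by
    calc Q / (2 * N) - (L : ℝ) ^ d * Y.card * (5 / 6 * a ^ 4)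
        = ∑ x ∈ blockSites L Y, (q x / (2 * N) - 5 / 6 * a ^ 4) := by
          rw [Finset.sum_sub_distrib, Finset.sum_const, nsmul_eq_mul, hcardB, hQdef, Finset.sum_div]
      _ ≤ ∑ x ∈ blockSites L Y, wt (fhol V (x, π)) :=
          Finset.sum_le_sum fun x _ => wt_fhol_ge hV ha1 (x, π) (hVa x π.1.1 π.1.2 hμν)
  -- `L^{d−4}·C₁·S = L⁻²S/2N`
  have hcancel : (L : ℝ) ^ ((d : ℤ) - 4) * (C₁ * S) = ((L : ℝ) ^ 2)⁻¹ * S / (2 * N) := by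
    rw [hzpow, hC₁def]
    field_simp
  have hmis' : ((L : ℝ) ^ 2)⁻¹ * S / (2 * N) - Q / (2 * N) ≤ L * G := by
    have h1 := (abs_le.mp hmis).2
    have h2 : ((L : ℝ) ^ 2)⁻¹ * S / (2 * N) - Q / (2 * N) = (((L : ℝ) ^ 2)⁻¹ * S - Q) / (2 * N) := by ring
    rw [h2, div_le_iff₀ (by positivity)]
    nlinarith
  have hθ3 : (L : ℝ) ^ ((d : ℤ) - 4) * (Y.card * (711 * θ ^ 3))
      = 364032 * ((d : ℝ) + 1) ^ 3 * ((d : ℝ) + 4) ^ 3 * (L : ℝ) ^ (d + 2) * a ^ 3 * Y.card := by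
    rw [hzpow, hθdef, pow_add]
    field_simp
    ring
  have ha4 : (L : ℝ) ^ d * Y.card * (5 / 6 * a ^ 4) ≤ (L : ℝ) ^ d * a ^ 3 * Y.card := by
    have : 5 / 6 * a ^ 4 ≤ a ^ 3 := by nlinarith [pow_nonneg ha 3]
    have h0 : 0 ≤ (L : ℝ) ^ d * Y.card := by positivity
    nlinarith
  have hzp0 : 0 ≤ (L : ℝ) ^ ((d : ℤ) - 4) := by rw [hzpow]; positivity
  have step : (L : ℝ) ^ ((d : ℤ) - 4) * ∑ y ∈ Y, wt (chol L V (y, π))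
      ≤ ((L : ℝ) ^ 2)⁻¹ * S / (2 * N)
        + 364032 * ((d : ℝ) + 1) ^ 3 * ((d : ℝ) + 4) ^ 3 * (L : ℝ) ^ (d + 2) * a ^ 3 * Y.card := by
    have := mul_le_mul_of_nonneg_left hcoarse hzp0
    rw [mul_add, hcancel, hθ3] at this
    exact this
  linarith [step, hfine, hmis', ha4]

set_option maxHeartbeats 800000 in
/-- **THE LOWER HALF OF β′-loc, per plane**: under the same hypotheses,
`Σ_{x∈B(Y)} wt(V(∂p_{x,π})) − L^{d−4}·Σ_{y∈Y} wt(V̄(∂P_{y,π}))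
   ≤ L·Σ_{N_{2L}(B(Y))}Σ_κ(4a|∇_V F| + |∇_V F|²) + 2·C_low·Σ_{N_{2L}(B(Y))}Σ_κ|∇_V F|²
     + (4608(d+1)³(d+4)³L^{d+2} + C_P·d(d+2)²/64)·a³·#Y`
(`wt_fhol_le`, `coarse_ge_y`, the stencil mismatch, and the stencil sums of the covariant gradient energy dominated
by `L²×` its sum over the `2L`-neighbourhood, `sum_shift_le_nbhd`). [folklore] -/
private theorem plane_blockWindow_ge (L : ℕ) (hL : 1 ≤ L) {V : Site d → Fin d → 𝕄ˣ} (hV : IsUnitaryCfg V) {a : ℝ}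
    (ha : 0 ≤ a) (hsmall : 512 * (d + 1) * (d + 4) * (L : ℝ) ^ 2 * a ≤ 1) (hVa : SmallField V a)
    (Y : Finset (Site d)) (π : Plane d) :
    ∑ x ∈ blockSites L Y, wt (fhol V (x, π)) - (L : ℝ) ^ ((d : ℤ) - 4) * ∑ y ∈ Y, wt (chol L V (y, π))
      ≤ (L : ℝ) * ∑ z ∈ nbhd (2 * L) (blockSites L Y), ∑ κ : Fin d,
            (4 * a * ‖covGrad V (flux V) z κ π‖ + ‖covGrad V (flux V) z κ π‖ ^ 2)
        + 2 * lowerConst d L * ∑ z ∈ nbhd (2 * L) (blockSites L Y), ∑ κ : Fin d, ‖covGrad V (flux V) z κ π‖ ^ 2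
        + (4608 * ((d : ℝ) + 1) ^ 3 * ((d : ℝ) + 4) ^ 3 * (L : ℝ) ^ (d + 2)
            + poincareConst d L * d * ((d : ℝ) + 2) ^ 2 / 64) * a ^ 3 * Y.card := by
  set N : ℝ := (Fintype.card n : ℝ) with hNdef
  have hN : 0 < N := by rw [hNdef]; exact_mod_cast Fintype.card_pos
  have hL0 : (0 : ℝ) < L := by exact_mod_cast (by omega : 0 < L)
  set θ : ℝ := 8 * (d + 1) * (d + 4) * (L : ℝ) ^ 2 * a with hθdef
  have hθ0 : 0 ≤ θ := by positivity
  set c₁ : ℝ := (L : ℝ) ^ ((d : ℤ) - 4) with hc₁def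
  have hzpow : c₁ = (L : ℝ) ^ d / (L : ℝ) ^ 4 := zpow_sub_four_eq L hL
  have hc₁ : 0 ≤ c₁ := by rw [hzpow]; positivity
  set c₂ : ℝ := ((L : ℝ) ^ 2)⁻¹ / (2 * N) with hc₂def
  set c₃ : ℝ := ((L : ℝ) ^ d)⁻¹ / (L : ℝ) ^ 4 / (4 * N) with hc₃def
  have hc₃ : 0 ≤ c₃ := by positivity
  set CP : ℝ := poincareConst d L with hCPdef
  have hCP : 0 ≤ CP := poincareConst_nonneg d L
  set E : ℝ := (L : ℝ) ^ (d + 2) * d * (32 * (((d : ℝ) + 2) * L) ^ 2 * N * a ^ 4) with hEdef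
  have hμν : π.1.1 ≠ π.1.2 := ne_of_lt π.2
  have hd : 1 ≤ d := π.1.1.pos
  have ha512 : a ≤ 1 / 512 := small_a_le hL hd ha hsmall
  have ha1 : a ≤ 1 / 4 := ha512.trans (by norm_num)
  set q : Site d → ℝ := fun x => hs (flux V (x, π)) (flux V (x, π)) with hqdef
  set g : Site d → ℝ := fun x => ∑ κ : Fin d, hs (covGrad V (flux V) x κ π) (covGrad V (flux V) x κ π) with hgdef
  have hg0 : ∀ x, 0 ≤ g x := fun x => by rw [hgdef]; exact Finset.sum_nonneg fun κ _ => hs_self_nonneg _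
  set Q : ℝ := ∑ x ∈ blockSites L Y, q x with hQdef
  set S : ℝ := ∑ y ∈ Y, ∑ r : Fin d → Fin L, ∑ i ∈ range L, ∑ j ∈ range L,
      q ((L : ℤ) • y + boxVec L r + (i : ℤ) • e π.1.1 + (j : ℤ) • e π.1.2) with hSdef
  set Gm : ℝ := ∑ z ∈ nbhd (2 * L) (blockSites L Y), ∑ κ : Fin d,
      (4 * a * ‖covGrad V (flux V) z κ π‖ + ‖covGrad V (flux V) z κ π‖ ^ 2) with hGmdef
  set G : ℝ := ∑ z ∈ nbhd (2 * L) (blockSites L Y), g z with hGdef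
  set G' : ℝ := ∑ z ∈ nbhd (2 * L) (blockSites L Y), ∑ κ : Fin d, ‖covGrad V (flux V) z κ π‖ ^ 2 with hG'def
  have hmis : |((L : ℝ) ^ 2)⁻¹ * S - Q| ≤ 2 * L * N * Gm := stencil_mismatch_abs_le L hL hV ha1 hVa Y π
  -- `hs ≤ N·|·|²`
  have hGG' : G ≤ N * G' := by
    rw [hGdef, hG'def, Finset.mul_sum]
    refine Finset.sum_le_sum fun x _ => ?_
    rw [hgdef, Finset.mul_sum]
    exact Finset.sum_le_sum fun κ _ => hs_self_le_card_mul_norm_sq _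
  -- the stencil sums: `q` exactly `S`, `g` dominated by `L²·G`
  have hSq : ∑ y ∈ Y, ∑ k ∈ stencilIdx d L, q ((L : ℤ) • y + stencilOff L π.1.1 π.1.2 k) = S := by
    rw [hSdef]
    exact Finset.sum_congr rfl fun y _ => sum_stencil_eq L q ((L : ℤ) • y) π.1.1 π.1.2
  have hSg : ∑ y ∈ Y, ∑ k ∈ stencilIdx d L, g ((L : ℤ) • y + stencilOff L π.1.1 π.1.2 k) ≤ (L : ℝ) ^ 2 * G := by
    rw [Finset.sum_congr rfl fun y _ => sum_stencil_eq L g ((L : ℤ) • y) π.1.1 π.1.2]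
    have h1 := sum_blocks_eq L hL Y
      (fun x => ∑ i ∈ range L, ∑ j ∈ range L, g (x + (i : ℤ) • e π.1.1 + (j : ℤ) • e π.1.2))
    rw [h1]
    calc ∑ x ∈ blockSites L Y, ∑ i ∈ range L, ∑ j ∈ range L, g (x + (i : ℤ) • e π.1.1 + (j : ℤ) • e π.1.2)
        = ∑ i ∈ range L, ∑ j ∈ range L, ∑ x ∈ blockSites L Y, g (x + ((i : ℤ) • e π.1.1 + (j : ℤ) • e π.1.2)) := by
          rw [Finset.sum_comm]
          refine Finset.sum_congr rfl fun i _ => ?_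
          rw [Finset.sum_comm]
          refine Finset.sum_congr rfl fun j _ => Finset.sum_congr rfl fun x _ => ?_
          rw [add_assoc]
      _ ≤ ∑ i ∈ range L, ∑ j ∈ range L, G :=
          Finset.sum_le_sum fun i hi => Finset.sum_le_sum fun j hj =>
            sum_shift_le_nbhd (blockSites L Y) hg0 _ fun l =>
              (abs_shift2_apply_le π.1.1 π.1.2 i j l).trans (by
                have := Finset.mem_range.mp hi; have := Finset.mem_range.mp hj; omega)
      _ = (L : ℝ) ^ 2 * G := by
          rw [Finset.sum_const, Finset.card_range, Finset.sum_const, Finset.card_range, smul_smul, nsmul_eq_mul]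
          push_cast; ring
  -- fine side from above
  have hfine : ∑ x ∈ blockSites L Y, wt (fhol V (x, π)) ≤ Q / (2 * N) := by
    calc ∑ x ∈ blockSites L Y, wt (fhol V (x, π))
        ≤ ∑ x ∈ blockSites L Y, q x / (2 * N) :=
          Finset.sum_le_sum fun x _ => wt_fhol_le hV ha1 (x, π) (hVa x π.1.1 π.1.2 hμν)
      _ = Q / (2 * N) := by rw [hQdef, Finset.sum_div]
  -- coarse side from below, summed over `Y`
  have hy : ∀ y ∈ Y,
      c₂ * ∑ k ∈ stencilIdx d L, q ((L : ℤ) • y + stencilOff L π.1.1 π.1.2 k) - c₁ * wt (chol L V (y, π))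
        ≤ c₃ * (CP * (2 * ∑ k ∈ stencilIdx d L, g ((L : ℤ) • y + stencilOff L π.1.1 π.1.2 k) + E))
          + c₁ * (9 * θ ^ 3) :=
    fun y _ => coarse_ge_y L hL hV ha hsmall hVa y π
  have hsum := Finset.sum_le_sum hy
  have lhs_eq : ∑ y ∈ Y,
      (c₂ * ∑ k ∈ stencilIdx d L, q ((L : ℤ) • y + stencilOff L π.1.1 π.1.2 k) - c₁ * wt (chol L V (y, π)))
        = c₂ * S - c₁ * ∑ y ∈ Y, wt (chol L V (y, π)) := by
    rw [Finset.sum_sub_distrib, ← Finset.mul_sum, ← Finset.mul_sum, hSq]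
  have rhs_le : ∑ y ∈ Y,
      (c₃ * (CP * (2 * ∑ k ∈ stencilIdx d L, g ((L : ℤ) • y + stencilOff L π.1.1 π.1.2 k) + E))
        + c₁ * (9 * θ ^ 3))
        ≤ c₃ * (CP * (2 * ((L : ℝ) ^ 2 * G))) + Y.card * (c₃ * (CP * E)) + Y.card * (c₁ * (9 * θ ^ 3)) := by
    have hre : ∑ y ∈ Y,
        (c₃ * (CP * (2 * ∑ k ∈ stencilIdx d L, g ((L : ℤ) • y + stencilOff L π.1.1 π.1.2 k) + E))
          + c₁ * (9 * θ ^ 3))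
        = c₃ * (CP * (2 * ∑ y ∈ Y, ∑ k ∈ stencilIdx d L, g ((L : ℤ) • y + stencilOff L π.1.1 π.1.2 k)))
          + Y.card * (c₃ * (CP * E)) + Y.card * (c₁ * (9 * θ ^ 3)) := by
      rw [Finset.sum_add_distrib, Finset.sum_const, nsmul_eq_mul]
      have : ∀ y ∈ Y, c₃ * (CP * (2 * ∑ k ∈ stencilIdx d L, g ((L : ℤ) • y + stencilOff L π.1.1 π.1.2 k) + E))
          = c₃ * CP * 2 * ∑ k ∈ stencilIdx d L, g ((L : ℤ) • y + stencilOff L π.1.1 π.1.2 k) + c₃ * (CP * E) := by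
        intro y _; ring
      rw [Finset.sum_congr rfl this, Finset.sum_add_distrib, ← Finset.mul_sum, Finset.sum_const, nsmul_eq_mul]
      ring
    rw [hre]
    have h0 : 0 ≤ c₃ * (CP * 2) := by positivity
    nlinarith [mul_le_mul_of_nonneg_left hSg h0]
  rw [lhs_eq] at hsum
  have hsum' := hsum.trans rhs_le
  -- the mismatch, fine minus coarse
  have hc₂S : c₂ * S = ((L : ℝ) ^ 2)⁻¹ * S / (2 * N) := by rw [hc₂def]; ring
  have hmis' : Q / (2 * N) - c₂ * S ≤ L * Gm := by
    have h1 := (abs_le.mp hmis).1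
    have h2 : Q / (2 * N) - c₂ * S = (Q - ((L : ℝ) ^ 2)⁻¹ * S) / (2 * N) := by rw [hc₂S]; ring
    rw [h2, div_le_iff₀ (by positivity)]
    nlinarith
  -- the gradient term: `c₃·C_P·2L²·G ≤ 2·C_low·G'`
  have hcoef : c₃ * (CP * (2 * ((L : ℝ) ^ 2 * (N * G')))) = 2 * lowerConst d L * G' := by
    rw [hc₃def, hCPdef, poincareConst, lowerConst, pow_add]
    field_simp
    ring
  have hgrad : c₃ * (CP * (2 * ((L : ℝ) ^ 2 * G))) ≤ 2 * lowerConst d L * G' := by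
    rw [← hcoef]
    have h0 : 0 ≤ c₃ * (CP * (2 * (L : ℝ) ^ 2)) := by positivity
    have := mul_le_mul_of_nonneg_left hGG' h0
    nlinarith [this]
  -- the transport-defect term
  have hE : c₃ * (CP * E) = 8 * CP * d * ((d : ℝ) + 2) ^ 2 * a ^ 4 := by
    rw [hc₃def, hEdef, pow_add]
    field_simp
    ring
  have ha4 : 8 * CP * d * ((d : ℝ) + 2) ^ 2 * a ^ 4 ≤ CP * d * ((d : ℝ) + 2) ^ 2 / 64 * a ^ 3 := by
    have h8 : 8 * a ^ 4 ≤ a ^ 3 / 64 := by nlinarith [pow_nonneg ha 3]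
    have h0 : 0 ≤ CP * d * ((d : ℝ) + 2) ^ 2 := by positivity
    nlinarith [mul_le_mul_of_nonneg_left h8 h0]
  have hE4 : c₃ * (CP * E) ≤ CP * d * ((d : ℝ) + 2) ^ 2 / 64 * a ^ 3 := by rw [hE]; exact ha4
  have hE' : (Y.card : ℝ) * (c₃ * (CP * E)) ≤ Y.card * (CP * d * ((d : ℝ) + 2) ^ 2 / 64 * a ^ 3) :=
    mul_le_mul_of_nonneg_left hE4 (Nat.cast_nonneg _)
  -- the cubic term
  have hθ3 : (Y.card : ℝ) * (c₁ * (9 * θ ^ 3))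
      = 4608 * ((d : ℝ) + 1) ^ 3 * ((d : ℝ) + 4) ^ 3 * (L : ℝ) ^ (d + 2) * a ^ 3 * Y.card := by
    have key : c₁ * (L : ℝ) ^ 6 = (L : ℝ) ^ (d + 2) := by
      rw [hzpow, pow_add, div_mul_eq_mul_div, div_eq_iff (by positivity)]; ring
    have h9 : c₁ * (9 * θ ^ 3) = 4608 * ((d : ℝ) + 1) ^ 3 * ((d : ℝ) + 4) ^ 3 * (c₁ * (L : ℝ) ^ 6) * a ^ 3 := by
      rw [hθdef]; ring
    rw [h9, key]; ring
  linarith [hsum', hfine, hmis', hgrad, hE', hθ3]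

omit [Nonempty n] in
/-- The plane sum of the mismatch functional is `4a·‖∇_V F‖_{ℓ¹(N)} + ‖∇_V F‖²_{ℓ²(N)}`. [folklore] -/
private theorem sum_planes_mismatch (V : Site d → Fin d → 𝕄ˣ) (a : ℝ) (T : Finset (Site d)) :
    ∑ π : Plane d, ∑ z ∈ T, ∑ κ : Fin d, (4 * a * ‖covGrad V (flux V) z κ π‖ + ‖covGrad V (flux V) z κ π‖ ^ 2)
      = 4 * a * gradFluxL1 V T + gradFluxSq V T := by
  unfold gradFluxL1 gradFluxSq
  rw [Finset.sum_comm, Finset.mul_sum, ← Finset.sum_add_distrib]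
  refine Finset.sum_congr rfl fun z _ => ?_
  rw [Finset.sum_comm, Finset.mul_sum, ← Finset.sum_add_distrib]
  refine Finset.sum_congr rfl fun κ _ => ?_
  rw [Finset.sum_add_distrib, Finset.mul_sum]

omit [Nonempty n] in
/-- The plane sum of the squared covariant flux gradient is `‖∇_V F‖²_{ℓ²(N)}`. [folklore] -/
private theorem sum_planes_gradSq (V : Site d → Fin d → 𝕄ˣ) (T : Finset (Site d)) :
    ∑ π : Plane d, ∑ z ∈ T, ∑ κ : Fin d, ‖covGrad V (flux V) z κ π‖ ^ 2 = gradFluxSq V T := by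
  unfold gradFluxSq
  rw [Finset.sum_comm]
  exact Finset.sum_congr rfl fun x _ => Finset.sum_comm

omit [Nonempty n] in
/-- The deficit of a block window as a plane sum. [folklore] -/
private theorem deficit_blockWindow_eq (L : ℕ) (V : Site d → Fin d → 𝕄ˣ) (Y : Finset (Site d)) :
    deficit L V (blockWindow L Y)
      = ∑ π : Plane d, ((L : ℝ) ^ ((d : ℤ) - 4) * ∑ y ∈ Y, wt (chol L V (y, π))
          - ∑ x ∈ blockSites L Y, wt (fhol V (x, π))) := by
  unfold deficit blockWindow coarseAction fineAction
  simp only []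
  rw [Finset.sum_product_right, Finset.sum_product_right, Finset.mul_sum, ← Finset.sum_sub_distrib]

/-- **THE UPPER HALF OF β′-loc FOR GENERAL `U(N)`-VALUED DATA**: for `L ≥ 1`, every `U(N)`-valued `V` on `ℤ^d` with
(44) `|V(∂p′) − 1| ≤ a`, `512(d+1)(d+4)L²a ≤ 1`, and every finite set `Y` of coarse sites,
`𝓓_{W(Y)}(V) ≤ 4La·‖∇_V F‖_{ℓ¹(N_{2L}(B(Y)))} + L·‖∇_V F‖²_{ℓ²(N_{2L}(B(Y)))} + upperConst(d,L)·a³·#Y`. [cite: Balaban1985Averaging, (42) p.23, (44) p.24; Balaban1985Variational, (5) p.278] -/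
theorem deficit_blockWindow_le (L : ℕ) (hL : 1 ≤ L) {V : Site d → Fin d → 𝕄ˣ} (hV : IsUnitaryCfg V) {a : ℝ}
    (ha : 0 ≤ a) (hsmall : 512 * (d + 1) * (d + 4) * (L : ℝ) ^ 2 * a ≤ 1) (hVa : SmallField V a)
    (Y : Finset (Site d)) :
    deficit L V (blockWindow L Y)
      ≤ 4 * L * a * gradFluxL1 V (nbhd (2 * L) (blockSites L Y)) + L * gradFluxSq V (nbhd (2 * L) (blockSites L Y))
        + upperConst d L * a ^ 3 * Y.card := by
  rw [deficit_blockWindow_eq]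
  calc ∑ π : Plane d, ((L : ℝ) ^ ((d : ℤ) - 4) * ∑ y ∈ Y, wt (chol L V (y, π))
          - ∑ x ∈ blockSites L Y, wt (fhol V (x, π)))
      ≤ ∑ π : Plane d, ((L : ℝ) * ∑ z ∈ nbhd (2 * L) (blockSites L Y), ∑ κ : Fin d,
            (4 * a * ‖covGrad V (flux V) z κ π‖ + ‖covGrad V (flux V) z κ π‖ ^ 2)
          + (364032 * ((d : ℝ) + 1) ^ 3 * ((d : ℝ) + 4) ^ 3 * (L : ℝ) ^ (d + 2) + (L : ℝ) ^ d)
            * a ^ 3 * Y.card) := Finset.sum_le_sum fun π _ => plane_blockWindow_le L hL hV ha hsmall hVa Y π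
    _ = 4 * L * a * gradFluxL1 V (nbhd (2 * L) (blockSites L Y)) + L * gradFluxSq V (nbhd (2 * L) (blockSites L Y))
        + upperConst d L * a ^ 3 * Y.card := by
        rw [Finset.sum_add_distrib, ← Finset.mul_sum, sum_planes_mismatch, Finset.sum_const, Finset.card_univ,
          nsmul_eq_mul, upperConst]
        ring_nf

/-- **THE LOWER HALF OF β′-loc FOR GENERAL `U(N)`-VALUED DATA**: under the same hypotheses,
`−𝓓_{W(Y)}(V) ≤ 4La·‖∇_V F‖_{ℓ¹(N_{2L})} + (L + 2·C_low)·‖∇_V F‖²_{ℓ²(N_{2L})} + lowerConstNA(d,L)·a³·#Y`. [cite: Balaban1985Averaging, (42) p.23, (44) p.24; Balaban1985Variational, (5) p.278] -/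
theorem deficit_blockWindow_ge (L : ℕ) (hL : 1 ≤ L) {V : Site d → Fin d → 𝕄ˣ} (hV : IsUnitaryCfg V) {a : ℝ}
    (ha : 0 ≤ a) (hsmall : 512 * (d + 1) * (d + 4) * (L : ℝ) ^ 2 * a ≤ 1) (hVa : SmallField V a)
    (Y : Finset (Site d)) :
    -deficit L V (blockWindow L Y)
      ≤ 4 * L * a * gradFluxL1 V (nbhd (2 * L) (blockSites L Y))
        + (L + 2 * lowerConst d L) * gradFluxSq V (nbhd (2 * L) (blockSites L Y))
        + lowerConstNA d L * a ^ 3 * Y.card := by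
  rw [deficit_blockWindow_eq, ← Finset.sum_neg_distrib]
  calc ∑ π : Plane d, -((L : ℝ) ^ ((d : ℤ) - 4) * ∑ y ∈ Y, wt (chol L V (y, π))
          - ∑ x ∈ blockSites L Y, wt (fhol V (x, π)))
      = ∑ π : Plane d, (∑ x ∈ blockSites L Y, wt (fhol V (x, π))
          - (L : ℝ) ^ ((d : ℤ) - 4) * ∑ y ∈ Y, wt (chol L V (y, π))) :=
        Finset.sum_congr rfl fun π _ => by ring
    _ ≤ ∑ π : Plane d, ((L : ℝ) * ∑ z ∈ nbhd (2 * L) (blockSites L Y), ∑ κ : Fin d,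
            (4 * a * ‖covGrad V (flux V) z κ π‖ + ‖covGrad V (flux V) z κ π‖ ^ 2)
          + 2 * lowerConst d L * ∑ z ∈ nbhd (2 * L) (blockSites L Y), ∑ κ : Fin d, ‖covGrad V (flux V) z κ π‖ ^ 2
          + (4608 * ((d : ℝ) + 1) ^ 3 * ((d : ℝ) + 4) ^ 3 * (L : ℝ) ^ (d + 2)
              + poincareConst d L * d * ((d : ℝ) + 2) ^ 2 / 64) * a ^ 3 * Y.card) :=
        Finset.sum_le_sum fun π _ => plane_blockWindow_ge L hL hV ha hsmall hVa Y π
    _ = 4 * L * a * gradFluxL1 V (nbhd (2 * L) (blockSites L Y))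
        + (L + 2 * lowerConst d L) * gradFluxSq V (nbhd (2 * L) (blockSites L Y))
        + lowerConstNA d L * a ^ 3 * Y.card := by
        rw [Finset.sum_add_distrib, Finset.sum_add_distrib, ← Finset.mul_sum, ← Finset.mul_sum, sum_planes_mismatch,
          sum_planes_gradSq, Finset.sum_const, Finset.card_univ, nsmul_eq_mul, lowerConstNA]
        ring

variable (d) in
/-- The constant of β′-loc: `wallConstNA + 5L`. [folklore] -/
def wallConstLoc (L : ℕ) : ℝ := wallConstNA d L + 5 * L

omit [Fintype n] [DecidableEq n] [Nonempty n] in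
/-- `0 ≤ wallConstLoc d L`. [folklore] -/
private theorem wallConstLoc_nonneg (L : ℕ) : 0 ≤ wallConstLoc d L := by
  unfold wallConstLoc
  have := wallConstNA_nonneg (d := d) L
  positivity

/-- **β′-loc, TWO-SIDED, FOR GENERAL `U(N)`-VALUED DATA**: for `L ≥ 1`, every `U(N)`-valued `V` on `ℤ^d` with (44)
and `512(d+1)(d+4)L²a ≤ 1`, and every finite `Y`,
`|𝓓_{W(Y)}(V)| ≤ wallConstLoc(d,L)·(a·‖∇_V F‖_{ℓ¹(N_{2L}(B(Y)))} + ‖∇_V F‖²_{ℓ²(N_{2L}(B(Y)))} + a³·#Y)`. [cite: Balaban1985Averaging, (42) p.23, (44) p.24; Balaban1985Variational, (5) p.278] -/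
theorem abs_deficit_blockWindow_le (L : ℕ) (hL : 1 ≤ L) {V : Site d → Fin d → 𝕄ˣ} (hV : IsUnitaryCfg V) {a : ℝ}
    (ha : 0 ≤ a) (hsmall : 512 * (d + 1) * (d + 4) * (L : ℝ) ^ 2 * a ≤ 1) (hVa : SmallField V a)
    (Y : Finset (Site d)) :
    |deficit L V (blockWindow L Y)|
      ≤ wallConstLoc d L * (a * gradFluxL1 V (nbhd (2 * L) (blockSites L Y))
          + gradFluxSq V (nbhd (2 * L) (blockSites L Y)) + a ^ 3 * Y.card) := by
  have hup := deficit_blockWindow_le L hL hV ha hsmall hVa Y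
  have hlo := deficit_blockWindow_ge L hL hV ha hsmall hVa Y
  have hg1 : 0 ≤ gradFluxL1 V (nbhd (2 * L) (blockSites L Y)) := by unfold gradFluxL1; positivity
  have hg2 : 0 ≤ gradFluxSq V (nbhd (2 * L) (blockSites L Y)) := by unfold gradFluxSq; positivity
  have h1 := upperConst_nonneg (d := d) L
  have h2 := lowerConst_nonneg d L
  have h3 := lowerConstNA_nonneg (d := d) L
  have hL0 : (0 : ℝ) ≤ L := by positivity
  have ha3 : 0 ≤ a ^ 3 * (Y.card : ℝ) := by positivity
  have hag : 0 ≤ a * gradFluxL1 V (nbhd (2 * L) (blockSites L Y)) := mul_nonneg ha hg1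
  rw [abs_le, wallConstLoc, wallConstNA]
  constructor
  · nlinarith [mul_nonneg h1 hg1, mul_nonneg h1 hag, mul_nonneg h1 hg2, mul_nonneg h1 ha3, mul_nonneg h2 hag,
      mul_nonneg h2 ha3, mul_nonneg h3 hag, mul_nonneg h3 hg2, mul_nonneg hL0 hag, mul_nonneg hL0 hg2,
      mul_nonneg hL0 ha3]
  · nlinarith [mul_nonneg h1 hag, mul_nonneg h1 hg2, mul_nonneg h2 hag, mul_nonneg h2 hg2, mul_nonneg h2 ha3,
      mul_nonneg h3 hag, mul_nonneg h3 hg2, mul_nonneg h3 ha3, mul_nonneg hL0 hag, mul_nonneg hL0 hg2,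
      mul_nonneg hL0 ha3]

/-- **`DeficitValueWallLoc d n L (wallConstLoc d L) (1/(512(d+1)(d+4)L²)) (2L)` HOLDS for every `L ≥ 1`** — the
local value wall β′-loc of `T4AveragingDeficitWallBoundary` (typed there, asserted nowhere, [analysis] in Appendix β
§9 (ix)) is a THEOREM for ALL `U(N)`-valued small-field data on `ℤ^d` and ALL finite windows; the typed conjunction
`ClaimBetaLoc = β ∧ β′-loc` thereby reduces to the derivative wall β alone (§11).  β is NOT touched. [cite: Balaban1985Averaging, (42) p.23, (44) p.24; Balaban1985Variational, (5) p.278] -/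
theorem deficitValueWallLoc_holds (L : ℕ) (hL : 1 ≤ L) :
    DeficitValueWallLoc d n L (wallConstLoc d L) (1 / (512 * ((d : ℝ) + 1) * ((d : ℝ) + 4) * (L : ℝ) ^ 2))
      (2 * L) := by
  intro V hV a ha ha₀ hVa Y
  have hpos : 0 < 512 * ((d : ℝ) + 1) * ((d : ℝ) + 4) * (L : ℝ) ^ 2 := by
    have hL0 : (0 : ℝ) < L := by exact_mod_cast (by omega : 0 < L)
    positivity
  have hsmall : 512 * (d + 1) * (d + 4) * (L : ℝ) ^ 2 * a ≤ 1 := by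
    have := (le_div_iff₀ hpos).mp ha₀
    linarith
  exact abs_deficit_blockWindow_le L hL hV ha hsmall hVa Y

end Local

/-! ## §11 The reduction `ClaimBetaLoc ⟺ β`: both typed walls are monotone in the radius `R` as well -/

section ReductionLoc

open Filter Finset
open T4AveragingDeficitWall hiding Site
open T4AveragingDeficitWallBoundary (gradFluxL1 DeficitValueWallLoc ClaimBetaLoc)

variable {d : ℕ} {n : Type*} [Fintype n] [DecidableEq n] [Nonempty n]

local notation "𝕄" => Matrix n n ℂ
local notation "Site" => B7Prop1Explicit.Site

omit [Fintype n] [DecidableEq n] [Nonempty n] in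
/-- `box R y ⊆ box R' y` for `R ≤ R'`. [folklore] -/
private theorem box_mono {R R' : ℕ} (h : R ≤ R') (y : Site d) :
    T4AveragingDeficitWall.box R y ⊆ T4AveragingDeficitWall.box R' y := by
  unfold T4AveragingDeficitWall.box
  refine Finset.Icc_subset_Icc ?_ ?_ <;> rw [Pi.le_def] <;> intro i
  · simp only [Pi.sub_apply]; omega
  · simp only [Pi.add_apply]; omega

omit [Fintype n] [DecidableEq n] [Nonempty n] in
/-- `N_R(T) ⊆ N_{R'}(T)` for `R ≤ R'`. [folklore] -/
private theorem nbhd_mono {R R' : ℕ} (h : R ≤ R') (T : Finset (Site d)) : nbhd R T ⊆ nbhd R' T := by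
  unfold nbhd
  exact Finset.biUnion_mono fun y _ => box_mono h y

omit [Nonempty n] in
/-- The derivative wall β is monotone in the radius `R` (for `C ≥ 0`). [folklore] -/
private theorem derivWall_mono_rad {L : ℕ} {C a₀ : ℝ} {R R' : ℕ} (hC : 0 ≤ C) (hR : R ≤ R')
    (h : DeficitDerivWall d n L C a₀ R) : DeficitDerivWall d n L C a₀ R' := by
  intro V hV a ha haa hVa ψ S hψ hS
  refine (h V hV a ha haa hVa ψ S hψ hS).mono fun W hW D hD => (hW D hD).trans ?_
  have hsub := nbhd_mono hR (bondSites S) (d := d)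
  have h1 : gradFluxSq V (nbhd R (bondSites S)) ≤ gradFluxSq V (nbhd R' (bondSites S)) := by
    unfold gradFluxSq
    exact Finset.sum_le_sum_of_subset_of_nonneg hsub fun _ _ _ => by positivity
  have h2 : curlSq V ψ (nbhd R (bondSites S)) ≤ curlSq V ψ (nbhd R' (bondSites S)) := by
    unfold curlSq
    exact Finset.sum_le_sum_of_subset_of_nonneg hsub fun _ _ _ => by positivity
  have h3 : dirL1 ψ (nbhd R (bondSites S)) ≤ dirL1 ψ (nbhd R' (bondSites S)) := by
    unfold dirL1
    exact Finset.sum_le_sum_of_subset_of_nonneg hsub fun _ _ _ => by positivity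
  have h4 : curlL1 V ψ (nbhd R (bondSites S)) ≤ curlL1 V ψ (nbhd R' (bondSites S)) := by
    unfold curlL1
    exact Finset.sum_le_sum_of_subset_of_nonneg hsub fun _ _ _ => by positivity
  have hs1 := Real.sqrt_le_sqrt h1
  have hs2 := Real.sqrt_le_sqrt h2
  have hq0 : 0 ≤ Real.sqrt (gradFluxSq V (nbhd R (bondSites S))) := Real.sqrt_nonneg _
  have hq0' : 0 ≤ Real.sqrt (curlSq V ψ (nbhd R' (bondSites S))) := Real.sqrt_nonneg _
  refine mul_le_mul_of_nonneg_left ?_ hC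
  have := mul_le_mul hs1 hs2 (Real.sqrt_nonneg _) (Real.sqrt_nonneg _)
  nlinarith [sq_nonneg a]

omit [Nonempty n] in
/-- The local value wall β′-loc is monotone in `C` (for `C' ≥ 0`), antitone in `a₀`, monotone in `R`. [folklore] -/
private theorem valueWallLoc_mono {L : ℕ} {C C' a₀ a₀' : ℝ} {R R' : ℕ} (hC : C ≤ C') (hC' : 0 ≤ C') (ha₀ : a₀' ≤ a₀)
    (hR : R ≤ R') (h : DeficitValueWallLoc d n L C a₀ R) : DeficitValueWallLoc d n L C' a₀' R' := by
  intro V hV a ha haa hVa Y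
  refine (h V hV a ha (haa.trans ha₀) hVa Y).trans ?_
  have hsub := nbhd_mono hR (blockSites L Y) (d := d)
  have h1 : gradFluxL1 V (nbhd R (blockSites L Y)) ≤ gradFluxL1 V (nbhd R' (blockSites L Y)) := by
    unfold gradFluxL1
    exact Finset.sum_le_sum_of_subset_of_nonneg hsub fun _ _ _ => by positivity
  have h2 : gradFluxSq V (nbhd R (blockSites L Y)) ≤ gradFluxSq V (nbhd R' (blockSites L Y)) := by
    unfold gradFluxSq
    exact Finset.sum_le_sum_of_subset_of_nonneg hsub fun _ _ _ => by positivity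
  have hg1 : 0 ≤ gradFluxL1 V (nbhd R (blockSites L Y)) := by unfold gradFluxL1; positivity
  have hg2 : 0 ≤ gradFluxSq V (nbhd R (blockSites L Y)) := by unfold gradFluxSq; positivity
  have ha3 : 0 ≤ a ^ 3 * (Y.card : ℝ) := by positivity
  calc C * (a * gradFluxL1 V (nbhd R (blockSites L Y)) + gradFluxSq V (nbhd R (blockSites L Y)) + a ^ 3 * Y.card)
      ≤ C' * (a * gradFluxL1 V (nbhd R (blockSites L Y)) + gradFluxSq V (nbhd R (blockSites L Y)) + a ^ 3 * Y.card) :=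
        mul_le_mul_of_nonneg_right hC (add_nonneg (add_nonneg (mul_nonneg ha hg1) hg2) ha3)
    _ ≤ C' * (a * gradFluxL1 V (nbhd R' (blockSites L Y)) + gradFluxSq V (nbhd R' (blockSites L Y))
          + a ^ 3 * Y.card) := by
        refine mul_le_mul_of_nonneg_left ?_ hC'
        nlinarith [mul_le_mul_of_nonneg_left h1 ha]

/-- **`ClaimBetaLoc` FOLLOWS FROM THE DERIVATIVE WALL β ALONE** (`L ≥ 1`): given `C ≥ 0`, `0 < a₀ ≤ 1`, `R` with
`DeficitDerivWall d N L C a₀ R`, the typed conjunction β ∧ β′-loc holds with `C' = max(C, wallConstLoc)`,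
`a₀' = min(a₀, 1/(512(d+1)(d+4)L²))`, `R' = max(R, 2L)` — β′-loc being the theorem `deficitValueWallLoc_holds`.
β itself is NOT claimed. [folklore] -/
private theorem claimBetaLoc_of_derivWall (L : ℕ) (hL : 1 ≤ L) {C a₀ : ℝ} {R : ℕ} (hC : 0 ≤ C) (ha₀ : 0 < a₀)
    (ha₁ : a₀ ≤ 1) (h : DeficitDerivWall d n L C a₀ R) : ClaimBetaLoc d n L := by
  have hL0 : (0 : ℝ) < L := by exact_mod_cast (by omega : 0 < L)
  have hpos : 0 < 1 / (512 * ((d : ℝ) + 1) * ((d : ℝ) + 4) * (L : ℝ) ^ 2) := by positivity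
  have hW := wallConstLoc_nonneg (d := d) L
  refine ⟨max C (wallConstLoc d L), min a₀ (1 / (512 * ((d : ℝ) + 1) * ((d : ℝ) + 4) * (L : ℝ) ^ 2)),
    max R (2 * L), hC.trans (le_max_left _ _), lt_min ha₀ hpos, (min_le_left _ _).trans ha₁, ?_, ?_⟩
  · exact derivWall_mono (le_max_left _ _) (min_le_left _ _)
      (derivWall_mono_rad hC (le_max_left _ _) h)
  · exact valueWallLoc_mono (le_max_right _ _) (hW.trans (le_max_right _ _)) (min_le_right _ _)
      (le_max_right _ _) (deficitValueWallLoc_holds L hL)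

/-- **`ClaimBetaLoc ⟺ β`** (`L ≥ 1`): the local repair of `ClaimBeta` is EQUIVALENT to the bare existence of
derivative-wall constants `∃ C ≥ 0, 0 < a₀ ≤ 1, R, DeficitDerivWall d N L C a₀ R` — hence also
`ClaimBetaLoc ⟺ ClaimBetaPer` (`claimBetaPer_iff_derivWall`).  Neither side is asserted. [cite: Balaban1985Averaging, (42) p.23, (44) p.24; Balaban1985Variational, (5) p.278] -/
theorem claimBetaLoc_iff_derivWall (L : ℕ) (hL : 1 ≤ L) :
    ClaimBetaLoc d n L ↔ ∃ C a₀ : ℝ, ∃ R : ℕ, 0 ≤ C ∧ 0 < a₀ ∧ a₀ ≤ 1 ∧ DeficitDerivWall d n L C a₀ R :=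
  ⟨fun ⟨C, a₀, R, hC, ha₀, ha₁, hβ, _⟩ => ⟨C, a₀, R, hC, ha₀, ha₁, hβ⟩,
    fun ⟨_, _, _, hC, ha₀, ha₁, hβ⟩ => claimBetaLoc_of_derivWall L hL hC ha₀ ha₁ hβ⟩

/-- **THE TWO REPAIRS OF `ClaimBeta` COINCIDE**: `ClaimBetaLoc d N L ⟺ ClaimBetaPer d N L` (`L ≥ 1`) — both are the
derivative wall β. [cite: Balaban1985Averaging, (42) p.23, (44) p.24; Balaban1985Variational, (5) p.278] -/
theorem claimBetaLoc_iff_claimBetaPer (L : ℕ) (hL : 1 ≤ L) :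
    ClaimBetaLoc d n L ↔ T4AveragingDeficitWallBoundary.ClaimBetaPer d n L := by
  rw [claimBetaLoc_iff_derivWall L hL, claimBetaPer_iff_derivWall L hL]

end ReductionLoc

end

end T4AveragingDeficitNonAbelian

end Literature.MathematicalPhysics.QuantumFieldTheory.Balaban1983to89
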